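import Summits.CriticalPhenomena.PercolationContinuityZ3.Theses.PercNonProliferation
import Literature.Probability.Percolation.SharpnessDCTProofs
import Literature.Probability.Percolation.CriticalContinuityProofs
import Literature.Probability.Percolation.BernoulliPercolationProofs
import Literature.Probability.Percolation.SeedLemma
import Literature.Probability.Percolation.InfraredBoundTriangle
import Literature.Barriers.CriticalPhenomena.LaceExpansionHighDimensionOneArm
import Literature.Barriers.CriticalPhenomena.LaceExpansionHighDimensionProofs
import Literature.Barriers.CriticalPhenomena.KozmaNachmiasLemma31
import Summits.CriticalPhenomena.PercolationContinuityZ3.Theses.PercTwoPointDecay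
import Summits.CriticalPhenomena.PercolationContinuityZ3.Theses.PercFiniteBoxLRO
import Literature.Probability.Percolation.RSW

/-!
# Disproof of `FreeBoxPowerSaving` (crux stmt-CriticalPhenomena-4447) — findings

Standing adversary file (cdisprove seats `refuter-cdisprove-stmt-CriticalPhenomena-4447-0` (cycle 1),
`…-4447-g2-0` (cycle 2), `…-4447-g3-0` (cycle 3)).
The crux (route `PercNonProliferation`, r5):

  `FreeBoxPowerSaving : ∃ a C : ℝ, 0 < a ∧ ∀ n ≥ 1, FA₂(p_c, n) ≤ C · n^{-a}`,
  `FA₂(p, n) := |B(n)|⁻² Σ_{x,y ∈ B(n)} P_p(x ↔ y inside B(n))`, `B(n) = [-n,n]³ ∩ ℤ³`, bond percolation.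

VERDICT (cycles 1–3): NO KILL.  `¬ FreeBoxPowerSaving` says the free-box pair connectivity at
`p_c(ℤ³)` decays slower than EVERY power along a subsequence (`not_powerSavingAt_of_frequently`
is the exact reduction); by §8 it moreover forces the critical ONE-ARM probability to decay slower
than every power (`forall_exists_oneArmProb_gt_of_not_freeBoxPowerSaving`).  That happens only in
(i) a discontinuous transition WITH fat free-box pieces (`FA₂ ≥ n^{-o(1)}`; a jump whose infinite
cluster shatters into `≍ n²` free pieces per box would NOT do, §8 docstring) or (ii) `θ(p_c) = 0` with
sub-power one-arm decay — neither is constructible, and numerics give `FA₂(n) ≍ n^{-0.95…-1.0}`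
(prediction `a = 1 + η = 0.954`; cycle 2: `FA₂(3s)/FA₂(s) = 0.284, 0.294, 0.359, 0.350, 0.336` for
`s = 9, …, 63`, kit j009424, i.e. local exponents `1.15, 1.11, 0.93, 0.96, 0.99`).  WARNING FOR
PROVERS: the clean target `a = 1` (`FA₂ ≤ C/n`) is predicted FALSE (`η(ℤ³) ≈ -0.046 < 0`, so
`n · FA₂(n) ≍ n^{0.046} → ∞`, invisible in Monte Carlo); aim for a small `a` (the sibling chain gives
`a = 1/2` from 5786, §6) or the one-arm form `a = 2s` of §8.  Everything below is sorry-free.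
CYCLE 3 (skeleton `c888e645…` = `Lines/tightness-collapse-typical-kmax.lean` registered, lead not yet
seated): §11 audits its four stubs — three are TRUE and provable as filed, the open one
(`stub_noCriticalFoam`) is crux-EQUIVALENT (crux ⟹ stub proved here, `noCriticalFoam_of_freeBoxPowerSaving`),
hence not refutable on its own, and is EXACTLY a non-proliferation statement "fat inner piece ⟹ at most
one fat piece of `B(2n)`" (`foam_iff_two_fat_outer`); §12 locates `¬ crux` on the cone's other axis:
`LinearScaleLROOfTheta (X_D, stmt-0855) ∧ θ(p_c) > 0 ⟹ ¬ crux`, equivalently `X_D ∧ crux ⟹ θ(p_c) = 0`.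

INDEX
* §1 `freeBoxPowerSaving_iff` — the crux is `PowerSavingAt (criticalProbI 3)` inside the family
  `PowerSavingAt p` / `PowerSavingWith p a` over `FA2 p n`; sandwich `|B(n)|⁻¹ ≤ FA₂ ≤ 1`,
  `FA₂(p,n) ≥ n^{-3}/27`.
* §2 LOAD-BEARING: `not_powerSaving_without_one_le` (the guard `1 ≤ n` is not cosmetic: Lean's
  `0 ^ (-a) = 0` v `FA₂(p,0) = 1`); `not_powerSavingAt_one` (`p_c ↦ 1` makes it FALSE,
  `FA₂(1,n) = 1`: a proof must use criticality, not lattice geometry).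
* §3 TIGHTNESS at any `p`: `not_powerSavingWith_of_three_lt` (no `a > 3`), `not_forall_exponent`.
* §4 NORMAL FORMS: `not_powerSavingAt_of_frequently` (what a refuter must show),
  `powerSavingAt_of_eventually` (provers may prove the bound eventually), `freeBoxSparse_of_…` (r5 ⟹ r3).
* §5 TIGHTNESS at `p_c` (Duminil-Copin–Tassion): `one_le_phi_criticalProb` (`φ_{p_c}(S) ≥ 1`,
  proved by continuity in `p` over the tree's sharpness files), `centreVol_ge`
  (`Σ_{y∈B(m)} P_{p_c}(0 ↔ y in B(m)) ≥ (m+1)/6`), `FA2_criticalProb_ge` (`FA₂(p_c,n) ≥ n^{-2}/8748`),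
  `not_powerSavingWith_criticalProb_of_two_lt` / `exponent_le_two`: ANY WITNESS HAS `a ≤ 2`.
* §6 SIBLING: `CentreRootedBound b` (`Σ_{y∈B(R)} P_{p_c}(0↔y in B(R)) ≤ C R^b`; crux 5786 is `b = 5/2`)
  ⟹ `PowerSavingWith p_c (3 - b)` (`powerSavingWith_of_centreRootedBound`) and conversely
  `PowerSavingWith p_c a ⟹ CentreRootedBound (3 - a)`; so `freeBoxPowerSaving_iff_centreRooted`:
  THE CRUX ⟺ `∃ b < 3, CentreRootedBound b` (4447 is the weakest member; 5786 = `b = 5/2` implies it);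
  `not_centreRootedBound_of_lt_one` (DCT floor `b ≥ 1`).
* §7 PARAMETER PROFILE: `FA2_mono` (in `p`), `powerSavingAt_anti`; below `p_c` the exponent is
  exactly `3` (`powerSavingWith_three_of_lt_criticalProb`, via `summable_tau_of_lt_criticalProb`).
  So `sup{a : PowerSavingWith p a}` = 3 on `[0,p_c)`, `∈ (0,2]` at `p_c` iff the crux, none at 1.
* §8 (cycle 2) ONE-ARM REDUCTION: `π_p(m) ≤ C m^{-s}` (`0 < s ≤ 1`) ⟹ `PowerSavingWith p (2s)`
  (`powerSavingWith_of_oneArm`, shell summation over two-disjoint-boxes `τ ≤ π²`); so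
  `OneArmPowerDecay ⟹ crux` (`freeBoxPowerSaving_of_oneArmPowerDecay`) with the SHARP exponent
  `2s = 1 + η`; contrapositive `forall_exists_oneArmProb_gt_of_not_freeBoxPowerSaving`; the classical
  floor `π_{p_c}(m) ≥ 1/(6(4m+3))` (`oneArmProb_criticalProb_ge`, new in the tree) and
  `oneArm_exponent_le_one` (`s ≤ 1`, matching §5's `a ≤ 2`).
* §9 (cycle 2) AUDIT OF THE r1 IDEATOR STUBS (prose + `not_powerSaving_uniform_above`, `sandwich`):
  no stub of `SketchIdeator1.lean`, `Sketch-ideator2.lean`, `Sketch-ideator3.lean` is cheaply false;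
  junk-parameter notes for triage.
* §10 (cycle 2) CONE POSITION: `X_A` (PercTwoPointDecay.CritBallAverageDecay, 0833) ⟹ crux
  (`freeBoxPowerSaving_of_critBallAverageDecay`), `CritPointwiseDecay` (0836) ⟹ `X_A` (landed part V);
  ¬crux would kill 0833/0836/one-arm decay at once; the long-range analogue is a THEOREM (Hutchcroft 2021).
* §11 (cycle 3) TARGETS = the registered skeleton's stubs: `measureReal_quasiGiant_le`
  (`P(QG(n,t)) ≤ S(n)/t²`, second-moment Markov), `measureReal_quasiGiant_rpow_le`; crux ⟹ QG-NAS
  (`quasiGiantNotAS_of_freeBoxPowerSaving`, the `stub_logBoost` hypothesis) and crux ⟹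
  `stub_noCriticalFoam` VERBATIM (`noCriticalFoam_of_freeBoxPowerSaving`); `foam_iff_two_fat_outer`
  (Foam = fat inner piece ∧ TWO fat outer pieces); guards: `gluingCriterion_false_without_guard`
  (`1 ≤ n` load-bearing), `sizeSplitting_of_le_one` (`1 ≤ s` NOT load-bearing),
  `logBoost_hypothesis_false_of_three_le`; per-stub verdicts in the §11 docblock; §11.5: the archived
  sibling skeleton's open stubs `stub_fatFiniteClusters`, `stub_boundaryQuasiGiantsNotAS` also follow
  VERBATIM from the crux (`fatFiniteClusters_of_freeBoxPowerSaving`, `boundaryQuasiGiantsNotAS_of_freeBoxPowerSaving`);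
  §11.6 NUMERICS (kit j011440): `K_max^free ≈ 2.2 n^{2.52}`, `P(champions glued) ≈ 0.58` flat in `n`,
  `P(QG ∩ Glued) ≈ 0.01` at every threshold ⟹ `P(Foam) = P(QG)`: the foam form of stub 4 is numerically
  the direct quasi-giant tail bound; `QG-NAS(0.45, 0.05)` holds numerically (advice to the lead there).
* §12 (cycle 3) `FA2_mul_ge_of_boxLRO` (LRO inside `B(Kn)` for pairs of `B(n)` ⟹ `FA₂(Kn) ≥ ρ/K⁶`),
  `not_powerSaving_of_boxLRO`, `not_freeBoxPowerSaving_of_linearLRO_of_theta_pos` (`X_D ∧ θ(p_c) > 0 ⟹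
  ¬crux`), `not_theta_pos_of_linearLRO` (`X_D ∧ crux ⟹ θ(p_c) = 0`: a two-item cross-route assembly);
  §12.2 polynomial scales: `FA2_ceil_rpow_ge_of_boxLRO`, `exponent_mul_le_of_boxLRO_rpow` (LRO in
  `B(⌈n^α⌉)` caps `a ≤ 6(1 - 1/α)`), `not_powerSaving_of_polyBoxLRO`,
  `not_freeBoxPowerSaving_of_polyLRO_of_theta_pos` (`PolyScaleLROOfTheta (0858) ∧ θ(p_c) > 0 ⟹ ¬crux`).

LANDED / PENDING (Theorems/FreeBoxPowerSaving/Negative/): p73056 ACCEPTED (`FreeBoxPowerSavingBounds.lean`,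
§1–§4: `false_without_guard`, `false_at_one`, `exponent_le_three`, `not_of_frequently`, `of_eventually`, …);
p74192 REJECTED (`FreeBoxPowerSavingExponentLeTwo.lean`, §5–§6 forward: ≈ 75 % duplicative of the
sibling files listed below — not refiled); p74686 ACCEPTED (`FreeBoxPowerSavingProfile.lean`: §7's
subcritical exponent 3 + the centred-form equivalence of §6, rebased on the sibling `CentredForms.lean`).
Cycle 2: p75695 ACCEPTED (`FreeBoxPowerSavingOneArm.lean`, §8: `fa2_le_of_oneArm`, `of_oneArm_decay`,
`forall_exists_oneArmProb_gt_of_not`, `oneArmProb_criticalProbI_ge`, `oneArm_exponent_le_one`);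
p76299 ACCEPTED (`FreeBoxPowerSavingFromBallDecay.lean`, §10: `of_critBallAverageDecay`,
`critBallAverageDecay_of_critPointwiseDecay`, `of_critPointwiseDecay`, `not_…_of_not`).
Cycle 3 LANDED (all ACCEPTED 2026-08-16T05:17Z, tree commit d5ff2cacdf61, after two operational bounces
"gate restarted while in flight"): p81641 `FreeBoxPowerSavingQuasiGiant.lean` (§11.1–§11.3 +
`boundaryQuasiGiantsNotAS_of_freeBoxPowerSaving`; `def quasiGiant` review-queued per D-0009), p81639
`FreeBoxPowerSavingStubGuards.lean` (§11.4 guards + §11.5 `fatFiniteClusters_of_freeBoxPowerSaving`),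
p81643 `FreeBoxPowerSavingLinearLRO.lean` (§12 incl. §12.2).  Importers (lead, ideators) should use these
tree modules rather than this work file.  MC kit j011440 / j012420 (foam statistics at `p_c`, `n = 4…64`;
auto-attached to the item as `compute-<id>.json` when they run — the compute farm had 1.6k queued jobs at
submission; j011440 ran 05:18–05:22Z on cmp-5) — numbers folded into §11.6.

SEE ALSO — the FreeBoxSparse (4445) disprover landed parallel material during this cycle, in
`Theorems/FreeBoxSparse/Negative/`: `DCTFloor.lean` (`freePairAverage_criticalProbI_ge` = the same DCT
floor via `Literature.Barriers.CriticalPhenomena.sum_sphere_real_openConnIn_ge`;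
`freeBoxPowerSaving_exponent_le_two` = §5's ceiling for THIS crux; `freePairAverage_mono`,
`continuous_freePairAverage`, `freeBoxSparse_iff_uniform_subcritical`), `CentredForms.lean`
(`centredAvg_le_freePairAverage`: `F(r) ≤ 64 FA₂(2r)`, `freePairAverage_le_centredAvg`: `FA₂(n) ≤ 8 F(2n)`),
`Sandwich.lean` (`freePairAverage_le_bulkPairAverage`, `tendsto_bulkPairAverage_iff_theta_eq_zero`:
the BULK pair average tends to `θ(p)²`), `OfContinuity.lean` (`theta_pos_of_not_freeBoxSparse`).

NUMERICS. Sibling MC j005901 (Cruxes/FreeSusceptibilityPowerSaving/MC-summary-ideator1-j005901.md,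
R = 8…96 at p = 0.2488126): root-averaged in-box susceptibility `(1/|Λ|)Σ|K|² ≍ L^{1.97–2.02}`, i.e.
`FA₂ ≍ L^{-1.0}`; centre-rooted `E|C_Λ(0)| ≍ L^{1.96}` (so `CentreRootedBound b` plausible for every
`b > 2.05`, cf. 5786's `5/2`).  This seat's direct MC of `FA₂(n)`, n = 2…64 with local slopes and
`C(a) = max_n FA₂(n) n^a`: job j007796 (cycle 1; never surfaced — the gen-2 seat cannot read another
identity's job and the prio-85 lane starved; superseded by ideator 3's j009424 quoted in the VERDICT).

BARRIERS / WHERE THE ANALOGUE FAILS (prose; nothing to formalise cheaply).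
* `Literature.Barriers.CriticalPhenomena.LongRangeDiscontinuity` (Aizenman–Newman 1986): in the 1-D
  `1/|x-y|²` model `θ(p_c) > 0`; the free-box analogue of the crux is exactly the kind of statement
  that fails in a discontinuous world — a proof must use nearest-neighbour / `d ≥ 2` structure.
* `RandomClusterFirstOrder`: wired FK with `q ≫ 1` on `ℤ³` is ordered at `p_c(q)` (in-box giants),
  free FK is disordered — the crux's truth is boundary-condition–sensitive in the FK family, so a
  `q`-uniform argument cannot prove it; `q = 1` specifics (BK/Reimer, as in §5's DCT input) must enter.
* `SpanningClustersAboveSix` does NOT bite r5: for `d > 6`, `τ ≍ |x|^{2-d}` gives the analogue with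
  `a = d - 2` (the barrier kills r2/r4, the counting inputs, not this one).
* Dimension shift: the analogue is TRUE for `d = 2` (RSW) and `d ≥ 11` (lace expansion), FALSE for
  `d = 1` (`p_c = 1`, cf. §2); `d = 3` is the open middle, no refutation by analogy.
* Printed DISCONTINUOUS percolation transitions live in other classes (galaxy sweep 2026-08-16, `lit`
  searchd down this cycle): long-range 1-D (AN86, catalogued), bootstrap / k-core, interdependent
  networks (Gao–Bashan–Havlin et al.), rare-event conditioning (Bianconi, "Rare events and discontinuous
  percolation transitions"); Achlioptas 'explosive' processes are in fact continuous (Riordan–Warnke 2011).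
  None is an independent nearest-neighbour model on `ℤ^d`, `d ≥ 2`: no counterexample family to import.
* Strengthenings that do NOT change the truth value: `sup_{p ≤ p_c}` (= value at `p_c`, §7);
  replacing `openConnIn` by bulk `openConn` gives PercTwoPointDecay's ball average (believed, `a = 1+η`).
-/

namespace Summit.CriticalPhenomena.PercolationContinuityZ3.Cruxes.FreeBoxPowerSaving.Disproof

open MeasureTheory ProbabilityTheory Filter
open Literature.Probability.Percolation Literature.Probability.LatticeModels
open Summit.CriticalPhenomena.PercolationContinuityZ3.Theses.PercNonProliferation
open scoped BigOperators Topology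

noncomputable section

/-! ## §1 The family `FA2 p n`, and the crux as its member at `p_c` -/

/-- `S_p(n) = Σ_{x,y ∈ B(n)} P_p(x ↔ y inside B(n))` (free-box pair sum, bond percolation on `ℤ³`). -/
def pairSum (p : unitInterval) (n : ℕ) : ℝ :=
  ∑ x ∈ box 3 n, ∑ y ∈ box 3 n,
    (bondPercolation (zdGraph 3) p).real (openConnIn (↑(box 3 n) : Set (Site 3)) x y)

/-- `FA₂(p, n) = S_p(n) / |B(n)|²`, the free-box pair-averaged connectivity. -/
def FA2 (p : unitInterval) (n : ℕ) : ℝ := pairSum p n / ((box 3 n).card : ℝ) ^ 2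

/-- Power saving with SOME exponent at parameter `p` (the crux is the case `p = p_c`). -/
def PowerSavingAt (p : unitInterval) : Prop :=
  ∃ a C : ℝ, 0 < a ∧ ∀ n : ℕ, 1 ≤ n → FA2 p n ≤ C * (n : ℝ) ^ (-a)

/-- Power saving with a PRESCRIBED exponent `a` at parameter `p`. -/
def PowerSavingWith (p : unitInterval) (a : ℝ) : Prop :=
  ∃ C : ℝ, ∀ n : ℕ, 1 ≤ n → FA2 p n ≤ C * (n : ℝ) ^ (-a)

/-- The crux is literally `PowerSavingAt p_c`. -/
theorem freeBoxPowerSaving_iff : FreeBoxPowerSaving ↔ PowerSavingAt (criticalProbI 3) := Iff.rfl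

theorem powerSavingAt_iff (p : unitInterval) :
    PowerSavingAt p ↔ ∃ a : ℝ, 0 < a ∧ PowerSavingWith p a := by
  constructor
  · rintro ⟨a, C, ha, h⟩; exact ⟨a, ha, C, h⟩
  · rintro ⟨a, ha, C, h⟩; exact ⟨a, C, ha, h⟩

theorem pairSum_nonneg (p : unitInterval) (n : ℕ) : 0 ≤ pairSum p n :=
  Finset.sum_nonneg fun _ _ => Finset.sum_nonneg fun _ _ => measureReal_nonneg

theorem FA2_nonneg (p : unitInterval) (n : ℕ) : 0 ≤ FA2 p n :=
  div_nonneg (pairSum_nonneg p n) (by positivity)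

theorem card_box_pos (n : ℕ) : (0 : ℝ) < ((box 3 n).card : ℝ) := by
  exact_mod_cast (box_nonempty 3 n).card_pos

theorem card_box_real (n : ℕ) : ((box 3 n).card : ℝ) = (2 * (n : ℝ) + 1) ^ 3 := by
  rw [card_box]; push_cast; ring

/-- `S_p(n) ≤ |B(n)|²`. -/
theorem pairSum_le (p : unitInterval) (n : ℕ) : pairSum p n ≤ ((box 3 n).card : ℝ) ^ 2 := by
  unfold pairSum
  calc ∑ x ∈ box 3 n, ∑ y ∈ box 3 n,
        (bondPercolation (zdGraph 3) p).real (openConnIn (↑(box 3 n) : Set (Site 3)) x y)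
      ≤ ∑ x ∈ box 3 n, ∑ y ∈ box 3 n, (1 : ℝ) :=
        Finset.sum_le_sum fun x _ => Finset.sum_le_sum fun y _ => measureReal_le_one
    _ = ((box 3 n).card : ℝ) ^ 2 := by simp [sq]

/-- `FA₂ ≤ 1`. -/
theorem FA2_le_one (p : unitInterval) (n : ℕ) : FA2 p n ≤ 1 := by
  unfold FA2
  rw [div_le_one (pow_pos (card_box_pos n) 2)]
  exact pairSum_le p n

/-- `{x ↔ x in S}` is the sure event when `x ∈ S`. -/
theorem openConnIn_self_eq_univ {S : Set (Site 3)} {x : Site 3} (hx : x ∈ S) :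
    openConnIn S x x = Set.univ :=
  Set.eq_univ_of_forall fun _ => ⟨hx, hx, SimpleGraph.Reachable.refl _⟩

/-- Diagonal: `|B(n)| ≤ S_p(n)`. -/
theorem card_le_pairSum (p : unitInterval) (n : ℕ) : ((box 3 n).card : ℝ) ≤ pairSum p n := by
  unfold pairSum
  have h1 : ∀ x ∈ box 3 n, (1 : ℝ) ≤ ∑ y ∈ box 3 n,
      (bondPercolation (zdGraph 3) p).real (openConnIn (↑(box 3 n) : Set (Site 3)) x y) := by
    intro x hx
    calc (1 : ℝ) = (bondPercolation (zdGraph 3) p).real (openConnIn (↑(box 3 n) : Set (Site 3)) x x) := by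
          rw [openConnIn_self_eq_univ (Finset.mem_coe.2 hx), probReal_univ]
      _ ≤ _ := Finset.single_le_sum (f := fun y =>
          (bondPercolation (zdGraph 3) p).real (openConnIn (↑(box 3 n) : Set (Site 3)) x y))
          (fun y _ => measureReal_nonneg) hx
  calc ((box 3 n).card : ℝ) = ∑ x ∈ box 3 n, (1 : ℝ) := by simp
    _ ≤ _ := Finset.sum_le_sum h1

/-- `|B(n)|⁻¹ ≤ FA₂(p, n)` (diagonal lower bound). -/
theorem inv_card_le_FA2 (p : unitInterval) (n : ℕ) : ((box 3 n).card : ℝ)⁻¹ ≤ FA2 p n := by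
  have hc := card_box_pos n
  unfold FA2
  rw [le_div_iff₀ (by positivity), sq, ← mul_assoc, inv_mul_cancel₀ hc.ne', one_mul]
  exact card_le_pairSum p n

/-- `FA₂(p, n) ≥ n^{-3}/27` for `n ≥ 1` (since `|B(n)| = (2n+1)³ ≤ 27 n³`). -/
theorem FA2_ge_cube (p : unitInterval) {n : ℕ} (hn : 1 ≤ n) :
    1 / (27 * (n : ℝ) ^ 3) ≤ FA2 p n := by
  have hn' : (1 : ℝ) ≤ n := by exact_mod_cast hn
  have h3 : 2 * (n : ℝ) + 1 ≤ 3 * n := by linarith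
  have hcard : ((box 3 n).card : ℝ) ≤ 27 * (n : ℝ) ^ 3 := by
    rw [card_box_real]
    calc (2 * (n : ℝ) + 1) ^ 3 ≤ (3 * n) ^ 3 := by gcongr
      _ = 27 * (n : ℝ) ^ 3 := by ring
  calc 1 / (27 * (n : ℝ) ^ 3) ≤ 1 / ((box 3 n).card : ℝ) :=
        one_div_le_one_div_of_le (card_box_pos n) hcard
    _ = ((box 3 n).card : ℝ)⁻¹ := one_div _
    _ ≤ FA2 p n := inv_card_le_FA2 p n

/-- `FA₂(p, 0) = 1` (the box is the single site `0`). -/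
theorem FA2_zero (p : unitInterval) : FA2 p 0 = 1 := by
  apply le_antisymm (FA2_le_one p 0)
  have h := inv_card_le_FA2 p 0
  rw [card_box] at h
  simpa using h

/-! ## §2 Load-bearing analysis -/

/-- **The guard `1 ≤ n` is load-bearing**: with `∀ n` (including `n = 0`) the power-saving
statement is FALSE for every parameter `p`, because Mathlib's `(0:ℝ) ^ (-a) = 0` for `a ≠ 0`
while `FA₂(p, 0) = 1`. -/
theorem not_powerSaving_without_one_le (p : unitInterval) :
    ¬ ∃ a C : ℝ, 0 < a ∧ ∀ n : ℕ, FA2 p n ≤ C * (n : ℝ) ^ (-a) := by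
  rintro ⟨a, C, ha, h⟩
  have h0 := h 0
  rw [FA2_zero, Nat.cast_zero, Real.zero_rpow (by linarith : (-a) ≠ 0), mul_zero] at h0
  linarith

/-- At `p = 1` the measure is the Dirac mass at `E(ℤ³)`. -/
theorem bondPercolation_one : bondPercolation (zdGraph 3) 1 = Measure.dirac (zdGraph 3).edgeSet := by
  rw [bondPercolation]; exact setBernoulli_one _

/-- With all lattice edges open, any two sites of `B(n)` are joined inside `B(n)`. -/
theorem edgeSet_mem_openConnIn_box {n : ℕ} {x y : Site 3} (hx : x ∈ box 3 n) (hy : y ∈ box 3 n) :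
    (zdGraph 3).edgeSet ∈ openConnIn (↑(box 3 n) : Set (Site 3)) x y := by
  refine ⟨hx, hy, ?_⟩
  have hG : openGraph ((zdGraph 3).edgeSet) = zdGraph 3 := SimpleGraph.fromEdgeSet_edgeSet _
  rw [hG]
  exact (box_induce_reachable_zero n hx).trans (box_induce_reachable_zero n hy).symm

theorem real_openConnIn_one {n : ℕ} {x y : Site 3} (hx : x ∈ box 3 n) (hy : y ∈ box 3 n) :
    (bondPercolation (zdGraph 3) 1).real (openConnIn (↑(box 3 n) : Set (Site 3)) x y) = 1 := by
  rw [bondPercolation_one, measureReal_def, Measure.dirac_apply_of_mem (edgeSet_mem_openConnIn_box hx hy),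
    ENNReal.toReal_one]

/-- `FA₂(1, n) = 1`. -/
theorem FA2_one (n : ℕ) : FA2 1 n = 1 := by
  have hsum : pairSum 1 n = ((box 3 n).card : ℝ) ^ 2 := by
    unfold pairSum
    rw [Finset.sum_congr rfl fun x hx => Finset.sum_congr rfl fun y hy => real_openConnIn_one hx hy]
    simp [sq]
  unfold FA2
  rw [hsum, div_self (pow_ne_zero _ (card_box_pos n).ne')]

/-- **What a refutation must show** (exact reduction): if for every `a > 0` the bound
`FA₂(p, n) ≥ n^{-a}` holds for infinitely many `n`, then there is no power saving at `p`. -/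
theorem not_powerSavingAt_of_frequently {p : unitInterval}
    (h : ∀ a : ℝ, 0 < a → ∃ᶠ n : ℕ in atTop, (n : ℝ) ^ (-a) ≤ FA2 p n) : ¬ PowerSavingAt p := by
  rintro ⟨a, C, ha, hC⟩
  have ha2 : 0 < a / 2 := by linarith
  have hev1 : ∀ᶠ n : ℕ in atTop, C < (n : ℝ) ^ (a / 2) :=
    ((tendsto_rpow_atTop ha2).comp tendsto_natCast_atTop_atTop).eventually_gt_atTop C
  obtain ⟨n, hn, hnC, hn1⟩ := ((h (a / 2) ha2).and_eventually (hev1.and (eventually_ge_atTop 1))).exists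
  have hnpos : (0 : ℝ) < n := by exact_mod_cast hn1
  have key : (n : ℝ) ^ (-(a / 2)) ≤ C * (n : ℝ) ^ (-a) := hn.trans (hC n hn1)
  have hna : 0 < (n : ℝ) ^ a := Real.rpow_pos_of_pos hnpos a
  rw [Real.rpow_neg hnpos.le a, ← div_eq_mul_inv, le_div_iff₀ hna] at key
  have hsplit : (n : ℝ) ^ (-(a / 2)) * (n : ℝ) ^ a = (n : ℝ) ^ (a / 2) := by
    rw [← Real.rpow_add hnpos]; congr 1; ring
  rw [hsplit] at key
  linarith

/-- A uniform positive lower bound kills power saving. -/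
theorem not_powerSavingAt_of_const_le {p : unitInterval} {c : ℝ} (hc : 0 < c)
    (h : ∀ n : ℕ, 1 ≤ n → c ≤ FA2 p n) : ¬ PowerSavingAt p := by
  refine not_powerSavingAt_of_frequently fun a ha => ?_
  have hev : ∀ᶠ n : ℕ in atTop, (n : ℝ) ^ (-a) ≤ c := by
    have ht : Tendsto (fun n : ℕ => (n : ℝ) ^ (-a)) atTop (𝓝 0) :=
      (tendsto_rpow_neg_atTop ha).comp tendsto_natCast_atTop_atTop
    exact (ht.eventually (eventually_le_nhds hc))
  exact ((hev.and (eventually_ge_atTop 1)).mono fun n hn => hn.1.trans (h n hn.2)).frequently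

/-- **`p = p_c` is load-bearing**: at `p = 1` there is no power saving (`FA₂ ≡ 1`). -/
theorem not_powerSavingAt_one : ¬ PowerSavingAt 1 :=
  not_powerSavingAt_of_const_le one_pos fun n _ => (FA2_one n).ge

/-! ## §3 Tightness: refuted strengthenings of the exponent -/

/-- **No exponent `a > 3`, at any parameter** (diagonal terms alone): `PowerSavingWith p a` fails. -/
theorem not_powerSavingWith_of_three_lt (p : unitInterval) {a : ℝ} (ha : 3 < a) :
    ¬ PowerSavingWith p a := by
  rintro ⟨C, hC⟩
  have ha3 : 0 < a - 3 := by linarith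
  have hev1 : ∀ᶠ n : ℕ in atTop, 27 * C < (n : ℝ) ^ (a - 3) :=
    ((tendsto_rpow_atTop ha3).comp tendsto_natCast_atTop_atTop).eventually_gt_atTop _
  obtain ⟨n, hnC, hn1⟩ := (hev1.and (eventually_ge_atTop 1)).exists
  have hnpos : (0 : ℝ) < n := by exact_mod_cast hn1
  have h1 : 1 / (27 * (n : ℝ) ^ 3) ≤ C * (n : ℝ) ^ (-a) := (FA2_ge_cube p hn1).trans (hC n hn1)
  have hna : 0 < (n : ℝ) ^ a := Real.rpow_pos_of_pos hnpos a
  have hn3 : 0 < (n : ℝ) ^ 3 := pow_pos hnpos 3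
  rw [Real.rpow_neg hnpos.le a, ← div_eq_mul_inv, le_div_iff₀ hna] at h1
  -- h1 : 1 / (27 * n^3) * n^a ≤ C
  have h2 : (n : ℝ) ^ (a - 3) = 27 * (1 / (27 * (n : ℝ) ^ 3) * (n : ℝ) ^ a) := by
    rw [Real.rpow_sub hnpos, show ((3 : ℝ)) = ((3 : ℕ) : ℝ) by norm_num, Real.rpow_natCast]
    field_simp
  rw [h2] at hnC
  linarith

/-- The `∀ a > 0` strengthening of the crux is FALSE (already at `a = 4`), at any `p`. -/
theorem not_forall_exponent (p : unitInterval) : ¬ ∀ a : ℝ, 0 < a → PowerSavingWith p a :=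
  fun h => not_powerSavingWith_of_three_lt p (by norm_num : (3 : ℝ) < 4) (h 4 (by norm_num))

/-! ## §4 Normal forms -/

/-- The negation of the crux, unfolded. -/
theorem not_freeBoxPowerSaving_iff :
    ¬ FreeBoxPowerSaving ↔
      ∀ a C : ℝ, 0 < a → ∃ n : ℕ, 1 ≤ n ∧ C * (n : ℝ) ^ (-a) < FA2 (criticalProbI 3) n := by
  rw [freeBoxPowerSaving_iff, PowerSavingAt]
  simp only [not_exists, not_and, not_forall, not_le, exists_prop]

/-- **Eventual bounds suffice** (normalisation for provers): an eventual bound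
`FA₂(p,n) ≤ C n^{-a}` upgrades to all `n ≥ 1` with a larger constant, since `FA₂ ≤ 1`. -/
theorem powerSavingWith_of_eventually {p : unitInterval} {a C : ℝ} (ha : 0 < a)
    (h : ∀ᶠ n : ℕ in atTop, FA2 p n ≤ C * (n : ℝ) ^ (-a)) : PowerSavingWith p a := by
  obtain ⟨N, hN⟩ := eventually_atTop.1 h
  set N₁ : ℕ := max N 1 with hN₁
  have hN₁pos : (0 : ℝ) < N₁ := by
    have : (1 : ℕ) ≤ N₁ := le_max_right _ _
    exact_mod_cast this
  refine ⟨max C ((N₁ : ℝ) ^ a), fun n hn => ?_⟩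
  have hnpos : (0 : ℝ) < n := by exact_mod_cast hn
  have hrpos : 0 ≤ (n : ℝ) ^ (-a) := (Real.rpow_pos_of_pos hnpos _).le
  rcases le_or_gt N n with hNn | hnN
  · calc FA2 p n ≤ C * (n : ℝ) ^ (-a) := hN n hNn
      _ ≤ max C ((N₁ : ℝ) ^ a) * (n : ℝ) ^ (-a) := mul_le_mul_of_nonneg_right (le_max_left _ _) hrpos
  · have hnN₁ : (n : ℝ) ≤ N₁ := by
      have : n ≤ N₁ := (Nat.le_of_lt hnN).trans (le_max_left _ _)
      exact_mod_cast this
    have hpow : (n : ℝ) ^ a ≤ (N₁ : ℝ) ^ a := Real.rpow_le_rpow hnpos.le hnN₁ ha.le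
    have hna : 0 < (n : ℝ) ^ a := Real.rpow_pos_of_pos hnpos a
    calc FA2 p n ≤ 1 := FA2_le_one p n
      _ ≤ (N₁ : ℝ) ^ a * (n : ℝ) ^ (-a) := by
          rw [Real.rpow_neg hnpos.le, ← div_eq_mul_inv, le_div_iff₀ hna, one_mul]
          exact hpow
      _ ≤ max C ((N₁ : ℝ) ^ a) * (n : ℝ) ^ (-a) := mul_le_mul_of_nonneg_right (le_max_right _ _) hrpos

theorem powerSavingAt_of_eventually {p : unitInterval} {a C : ℝ} (ha : 0 < a)
    (h : ∀ᶠ n : ℕ in atTop, FA2 p n ≤ C * (n : ℝ) ^ (-a)) : PowerSavingAt p :=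
  (powerSavingAt_iff p).2 ⟨a, ha, powerSavingWith_of_eventually ha h⟩

/-- **r5 ⟹ r3**: the crux implies `FreeBoxSparse` (the route's `[deps]` arrow, by squeezing). -/
theorem freeBoxSparse_of_freeBoxPowerSaving (h : FreeBoxPowerSaving) : FreeBoxSparse := by
  obtain ⟨a, C, ha, hC⟩ := h
  have hlim : Tendsto (fun n : ℕ => C * (n : ℝ) ^ (-a)) atTop (𝓝 0) := by
    have := ((tendsto_rpow_neg_atTop ha).comp tendsto_natCast_atTop_atTop).const_mul C
    simpa using this
  refine tendsto_of_tendsto_of_tendsto_of_le_of_le' tendsto_const_nhds hlim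
    (Eventually.of_forall fun n => FA2_nonneg (criticalProbI 3) n) ?_
  exact (eventually_ge_atTop 1).mono fun n hn => hC n hn

/-! ## §5 Tightness at `p_c`: no exponent `a > 2` (Duminil-Copin–Tassion input `φ_{p_c}(S) ≥ 1`)

The chain: `φ_{p_c}(S) ≥ 1` for every finite `S ∋ 0` (DCT 2016, Remark 3; proved here from the
tree's sharpness files by continuity in `p`) ⟹ `Σ_{x ∈ ∂⁻B(k)} P_{p_c}(0 ↔ x in B(k)) ≥ 1/6`
⟹ (disjoint shells, domain monotonicity) `Σ_{y ∈ B(m)} P_{p_c}(0 ↔ y in B(m)) ≥ (m+1)/6`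
⟹ (translation to every root of `B(n - n/2)`) `S_{p_c}(n) ≥ n⁴/12` ⟹ `FA₂(p_c, n) ≥ n^{-2}/8748`.
So a prover's exponent lives in `(0, 2]`; physics says `a = 1 + η ≈ 0.954`.

CANONICAL TREE VERSIONS (importers should use these; the proofs below are this work file's own,
kept self-contained; the landing attempt p74192 was rejected as duplicative of them):
`Literature.Barriers.CriticalPhenomena.one_le_phi_criticalProbI (hd : 2 ≤ d)` and
`phi_box_le_sum_sphere`, `sum_sphere_real_openConnIn_ge`, `real_openConnIn_shift_box`
(`Literature/Barriers/CriticalPhenomena/KozmaNachmiasLemma31.lean`, `…Lemma11Steps.lean`);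
`Literature.Probability.Percolation.openConnIn_mono` (`RSW.lean`);
`Theorems/FreeBoxSparse/Negative/DCTFloor.lean`: `sum_box_real_openConnIn_ge` (= `centreVol_ge`, all
`p ≥ p_c`), `pairSum_ge` (`(m+1)⁴/12`), `freePairAverage_criticalProbI_ge` (`FA₂ ≥ 1/(768(n+1)²)`),
`freeBoxPowerSaving_exponent_le_two` (= `exponent_le_two` below).
-/

section DCT

open Literature.Probability.Percolation.DCT16

/-- Critical bond percolation measure on `ℤ³`. -/
abbrev μc : Measure (BondConfig (Site 3)) := bondPercolation (zdGraph 3) (criticalProbI 3)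

/-- Continuity in the parameter of `P_p(x ↔ y in S)` for finite `S` (cylinder polynomial). -/
theorem continuous_real_openConnIn (S : Finset (Site 3)) (x y : Site 3) :
    Continuous fun q : ℝ =>
      (bondPercolation (zdGraph 3) (Set.projIcc 0 1 zero_le_one q)).real
        (openConnIn (↑S : Set (Site 3)) x y) := by
  have hdet : DeterminedBy (openConnIn (↑S : Set (Site 3)) x y) (↑S.sym2 : Set (Sym2 (Site 3))) :=
    determinedBy_openConnIn (↑S) x y (K := ↑S.sym2) (by rw [Finset.coe_sym2])
  have h : (fun q : ℝ => (bondPercolation (zdGraph 3) (Set.projIcc 0 1 zero_le_one q)).real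
      (openConnIn (↑S : Set (Site 3)) x y)) =
      fun q => Russo.cylPoly (zdGraph 3).edgeSet S.sym2 (openConnIn (↑S : Set (Site 3)) x y)
        (Set.projIcc 0 1 zero_le_one q) := by
    funext q
    rw [bondPercolation]
    exact Russo.measureReal_eq_cylPoly hdet _ _
  rw [h]
  have hc : Continuous
      (Russo.cylPoly (zdGraph 3).edgeSet S.sym2 (openConnIn (↑S : Set (Site 3)) x y)) :=
    continuous_iff_continuousAt.2 fun q => (Russo.hasDerivAt_cylPoly _ _ _ q).continuousAt
  exact hc.comp (continuous_subtype_val.comp continuous_projIcc)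

/-- `q ↦ φ_q(S)` is continuous (real parameter, constant extension outside `[0,1]`). -/
theorem continuous_phi (S : Finset (Site 3)) :
    Continuous fun q : ℝ => DCT16.phi (Set.projIcc 0 1 zero_le_one q) S := by
  simp only [DCT16.phi_def]
  refine (continuous_subtype_val.comp continuous_projIcc).mul ?_
  refine continuous_finsetSum _ fun x _ => continuous_finsetSum _ fun y _ => ?_
  exact continuous_real_openConnIn S 0 x

/-- **`φ_{p_c}(S) ≥ 1` for every finite `S ∋ 0` on `ℤ³`** (Duminil-Copin–Tassion 2016, Remark 3):
otherwise, by continuity, `φ_q(S) < 1` for some `q ∈ (p_c, 1)`, forcing exponential decay and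
`θ(q) = 0` at a supercritical `q`. -/
theorem one_le_phi_criticalProb (S : Finset (Site 3)) (h0 : (0 : Site 3) ∈ S) :
    1 ≤ DCT16.phi (criticalProbI 3) S := by
  by_contra hlt
  push Not at hlt
  have hpc01 : criticalProb (zdGraph 3) 0 ∈ Set.Icc (0 : ℝ) 1 := criticalProb_mem_Icc _ _
  have hpc1 : criticalProb (zdGraph 3) (0 : Site 3) < 1 := criticalProb_zd_lt_one (d := 3) (by norm_num)
  have hg := continuous_phi S
  have hproj : Set.projIcc 0 1 zero_le_one (criticalProb (zdGraph 3) 0) = criticalProbI 3 := by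
    rw [Set.projIcc_of_mem _ hpc01]; rfl
  have hgpc : DCT16.phi (Set.projIcc 0 1 zero_le_one (criticalProb (zdGraph 3) 0)) S < 1 := by
    rw [hproj]; exact hlt
  have hev : ∀ᶠ q in 𝓝 (criticalProb (zdGraph 3) (0 : Site 3)),
      DCT16.phi (Set.projIcc 0 1 zero_le_one q) S < 1 :=
    hg.continuousAt.eventually_lt continuousAt_const hgpc
  have hev' : ∀ᶠ q in 𝓝[>] (criticalProb (zdGraph 3) (0 : Site 3)),
      DCT16.phi (Set.projIcc 0 1 zero_le_one q) S < 1 ∧ q ∈ Set.Ioo (criticalProb (zdGraph 3) 0) 1 :=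
    (hev.filter_mono nhdsWithin_le_nhds).and (Ioo_mem_nhdsGT hpc1)
  obtain ⟨q, hq, hqpc, hq1⟩ := hev'.exists
  have hq01 : q ∈ Set.Icc (0 : ℝ) 1 := ⟨hpc01.1.trans hqpc.le, hq1.le⟩
  rw [Set.projIcc_of_mem _ hq01] at hq
  obtain ⟨c, hc, hdec⟩ := DCT16_expDecay_of_phi_lt_one_holds ⟨q, hq01⟩ S h0 hq hq1
  have hzero := theta_eq_zero_of_expDecay ⟨q, hq01⟩ hc hdec
  have hpos : 0 < theta (zdGraph 3) 0 ⟨q, hq01⟩ :=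
    theta_pos_of_criticalProb_lt_holds (zdGraph 3) 0 ⟨q, hq01⟩ hqpc
  linarith

/-- `{x ↔ y in S}` is monotone in the domain `S`. -/
theorem openConnIn_mono_set {S S' : Set (Site 3)} (h : S ⊆ S') (x y : Site 3) :
    openConnIn S x y ⊆ openConnIn S' x y := by
  rintro ω ⟨hx, hy, hr⟩
  exact ⟨h hx, h hy, hr.map (SimpleGraph.induceHomOfLE (G := openGraph ω) h).toHom⟩

/-- `φ_p(S) ≤ 6 · Σ_{x ∈ ∂⁻S} P_p(0 ↔ x in S)`: only inner-boundary sites have outside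
neighbours, at most `6` of them, and `p ≤ 1`. -/
theorem phi_le_six_mul_sum (p : unitInterval) (S : Finset (Site 3)) :
    DCT16.phi p S ≤ 6 * ∑ x ∈ innerBoundary (zdGraph 3) S,
      (bondPercolation (zdGraph 3) p).real (openConnIn (↑S : Set (Site 3)) 0 x) := by
  have hP0 : ∀ x, 0 ≤ (bondPercolation (zdGraph 3) p).real (openConnIn (↑S : Set (Site 3)) 0 x) :=
    fun x => measureReal_nonneg
  have hc6 : ∀ x, ((((zdGraph 3).neighborFinset x).filter (fun y => y ∉ S)).card : ℝ) ≤ 6 := by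
    intro x
    have h1 := Finset.card_filter_le ((zdGraph 3).neighborFinset x) (fun y => y ∉ S)
    have h2 : ((zdGraph 3).neighborFinset x).card = 2 * 3 := card_neighborFinset_zdGraph_holds x
    have h3 : (((zdGraph 3).neighborFinset x).filter (fun y => y ∉ S)).card ≤ 6 := by omega
    exact_mod_cast h3
  have hsum : ∑ x ∈ S, ∑ y ∈ (zdGraph 3).neighborFinset x with y ∉ S,
      (bondPercolation (zdGraph 3) p).real (openConnIn (↑S : Set (Site 3)) 0 x) =
      ∑ x ∈ S, ((((zdGraph 3).neighborFinset x).filter (fun y => y ∉ S)).card : ℝ) *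
        (bondPercolation (zdGraph 3) p).real (openConnIn (↑S : Set (Site 3)) 0 x) := by
    refine Finset.sum_congr rfl fun x _ => ?_
    rw [Finset.sum_const, nsmul_eq_mul]
  have hnn : 0 ≤ ∑ x ∈ S, ((((zdGraph 3).neighborFinset x).filter (fun y => y ∉ S)).card : ℝ) *
      (bondPercolation (zdGraph 3) p).real (openConnIn (↑S : Set (Site 3)) 0 x) :=
    Finset.sum_nonneg fun x _ => mul_nonneg (Nat.cast_nonneg _) (hP0 x)
  have hstep1 : DCT16.phi p S ≤ ∑ x ∈ S, ((((zdGraph 3).neighborFinset x).filter (fun y => y ∉ S)).card : ℝ) *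
      (bondPercolation (zdGraph 3) p).real (openConnIn (↑S : Set (Site 3)) 0 x) := by
    rw [DCT16.phi_def, hsum]
    calc (p : ℝ) * _ ≤ 1 * _ := mul_le_mul_of_nonneg_right p.2.2 hnn
      _ = _ := one_mul _
  have hstep2 : ∑ x ∈ S, ((((zdGraph 3).neighborFinset x).filter (fun y => y ∉ S)).card : ℝ) *
      (bondPercolation (zdGraph 3) p).real (openConnIn (↑S : Set (Site 3)) 0 x) =
      ∑ x ∈ innerBoundary (zdGraph 3) S, ((((zdGraph 3).neighborFinset x).filter (fun y => y ∉ S)).card : ℝ) *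
        (bondPercolation (zdGraph 3) p).real (openConnIn (↑S : Set (Site 3)) 0 x) := by
    symm
    refine Finset.sum_subset (fun x hx => (mem_innerBoundary_iff.1 hx).1) fun x hx hxb => ?_
    have hempty : (((zdGraph 3).neighborFinset x).filter (fun y => y ∉ S)) = ∅ := by
      refine Finset.filter_eq_empty_iff.2 fun y hy hyS => hxb ?_
      exact mem_innerBoundary_iff.2 ⟨hx, y, hyS, (SimpleGraph.mem_neighborFinset _ _ _).1 hy⟩
    rw [hempty, Finset.card_empty, Nat.cast_zero, zero_mul]
  calc DCT16.phi p S ≤ _ := hstep1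
    _ = _ := hstep2
    _ ≤ ∑ x ∈ innerBoundary (zdGraph 3) S,
          6 * (bondPercolation (zdGraph 3) p).real (openConnIn (↑S : Set (Site 3)) 0 x) :=
        Finset.sum_le_sum fun x _ => mul_le_mul_of_nonneg_right (hc6 x) (hP0 x)
    _ = _ := by rw [← Finset.mul_sum]

/-- **Boundary mass at criticality**: `Σ_{x ∈ ∂⁻B(k)} P_{p_c}(0 ↔ x in B(k)) ≥ 1/6`. -/
theorem sum_innerBoundary_ge (k : ℕ) :
    1 / 6 ≤ ∑ x ∈ innerBoundary (zdGraph 3) (box 3 k),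
      μc.real (openConnIn (↑(box 3 k) : Set (Site 3)) 0 x) := by
  have h1 := one_le_phi_criticalProb (box 3 k) (zero_mem_box 3 k)
  have h2 := phi_le_six_mul_sum (criticalProbI 3) (box 3 k)
  rw [div_le_iff₀ (by norm_num : (0 : ℝ) < 6)]
  linarith

/-- The centre-rooted free-box volume `V(m) = Σ_{y ∈ B(m)} P_{p_c}(0 ↔ y in B(m))`. -/
def centreVol (m : ℕ) : ℝ := ∑ y ∈ box 3 m, μc.real (openConnIn (↑(box 3 m) : Set (Site 3)) 0 y)

/-- **`V(m) ≥ (m+1)/6`** (sum the boundary masses over the disjoint shells `∂⁻B(k)`, `k ≤ m`). -/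
theorem centreVol_ge (m : ℕ) : ((m : ℝ) + 1) / 6 ≤ centreVol m := by
  have hdisj : Set.PairwiseDisjoint (↑(Finset.range (m + 1)) : Set ℕ)
      (fun k => innerBoundary (zdGraph 3) (box 3 k)) := by
    intro k _ k' _ hne
    change Disjoint (innerBoundary (zdGraph 3) (box 3 k)) (innerBoundary (zdGraph 3) (box 3 k'))
    rcases lt_or_gt_of_ne hne with h | h
    · exact Finset.disjoint_left.2 fun x hxk hxk' =>
        notMem_box_of_mem_innerBoundary_box h hxk' ((mem_innerBoundary_iff.1 hxk).1)
    · exact Finset.disjoint_left.2 fun x hxk hxk' =>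
        notMem_box_of_mem_innerBoundary_box h hxk ((mem_innerBoundary_iff.1 hxk').1)
  have hsub : (Finset.range (m + 1)).biUnion (fun k => innerBoundary (zdGraph 3) (box 3 k)) ⊆ box 3 m := by
    intro x hx
    obtain ⟨k, hk, hxk⟩ := Finset.mem_biUnion.1 hx
    exact box_mono 3 (Nat.lt_succ_iff.1 (Finset.mem_range.1 hk)) ((mem_innerBoundary_iff.1 hxk).1)
  calc ((m : ℝ) + 1) / 6 = ∑ _k ∈ Finset.range (m + 1), (1 / 6 : ℝ) := by
        rw [Finset.sum_const, Finset.card_range, nsmul_eq_mul]; push_cast; ring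
    _ ≤ ∑ k ∈ Finset.range (m + 1), ∑ x ∈ innerBoundary (zdGraph 3) (box 3 k),
          μc.real (openConnIn (↑(box 3 k) : Set (Site 3)) 0 x) :=
        Finset.sum_le_sum fun k _ => sum_innerBoundary_ge k
    _ ≤ ∑ k ∈ Finset.range (m + 1), ∑ x ∈ innerBoundary (zdGraph 3) (box 3 k),
          μc.real (openConnIn (↑(box 3 m) : Set (Site 3)) 0 x) := by
        refine Finset.sum_le_sum fun k hk => Finset.sum_le_sum fun x _ => ?_
        have hkm : k ≤ m := Nat.lt_succ_iff.1 (Finset.mem_range.1 hk)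
        exact measureReal_mono (openConnIn_mono_set (Finset.coe_subset.2 (box_mono 3 hkm)) 0 x)
          (measure_ne_top _ _)
    _ = ∑ x ∈ (Finset.range (m + 1)).biUnion (fun k => innerBoundary (zdGraph 3) (box 3 k)),
          μc.real (openConnIn (↑(box 3 m) : Set (Site 3)) 0 x) := (Finset.sum_biUnion hdisj).symm
    _ ≤ centreVol m :=
        Finset.sum_le_sum_of_subset_of_nonneg hsub fun _ _ _ => measureReal_nonneg

/-- The translate `x + B(m)` pulled back by the shift is `B(m)`. -/
theorem preimage_shift_ball (x : Site 3) (m : ℕ) :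
    (Site.shift x) ⁻¹' (↑(GM.ball x m) : Set (Site 3)) = ↑(box 3 m) := by
  ext u
  simp only [Set.mem_preimage, Finset.mem_coe, Site.shift_apply, GM.mem_ball, mem_box]
  simp

/-- **Translation invariance of free-box connectivities**:
`P_p(x ↔ y + x in x + B(m)) = P_p(0 ↔ y in B(m))`. -/
theorem real_openConnIn_translate (p : unitInterval) (x : Site 3) (m : ℕ) (y : Site 3) :
    (bondPercolation (zdGraph 3) p).real (openConnIn (↑(GM.ball x m) : Set (Site 3)) x (y + x)) =
      (bondPercolation (zdGraph 3) p).real (openConnIn (↑(box 3 m) : Set (Site 3)) 0 y) := by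
  have hset : BondConfig.relabel (sym2Equiv (Site.shift x)) ⁻¹'
      openConnIn (↑(GM.ball x m) : Set (Site 3)) (Site.shift x 0) (Site.shift x y) =
      openConnIn (↑(box 3 m) : Set (Site 3)) 0 y := by
    ext ω
    rw [Set.mem_preimage, GM.relabel_mem_openConnIn_iff (Site.shift x) (↑(GM.ball x m)) 0 y ω,
      preimage_shift_ball]
  have h := bondPercolation_real_preimage_shift x p
    (openConnIn (↑(GM.ball x m) : Set (Site 3)) (Site.shift x 0) (Site.shift x y))
  rw [hset] at h
  rw [h]
  simp only [Site.shift_apply, zero_add]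

/-- `x + B(m) ⊆ B(n)` when `x ∈ B(n - m)`, `m ≤ n`. -/
theorem ball_subset_box {n m : ℕ} {x : Site 3} (hmn : m ≤ n) (hx : x ∈ box 3 (n - m)) :
    GM.ball x m ⊆ box 3 n := by
  intro y hy
  rw [GM.mem_ball] at hy
  rw [mem_box] at hx ⊢
  intro i
  have h1 := hy i
  have h2 := hx i
  rw [Nat.cast_sub hmn] at h2
  constructor <;> omega

/-- Every root `x ∈ B(n - m)` sees at least the centre volume `V(m)` inside `B(n)`. -/
theorem centreVol_le_rowSum {n m : ℕ} {x : Site 3} (hmn : m ≤ n) (hx : x ∈ box 3 (n - m)) :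
    centreVol m ≤ ∑ y ∈ box 3 n, μc.real (openConnIn (↑(box 3 n) : Set (Site 3)) x y) := by
  have hsub : GM.ball x m ⊆ box 3 n := ball_subset_box hmn hx
  calc centreVol m
        = ∑ y ∈ box 3 m, μc.real (openConnIn (↑(GM.ball x m) : Set (Site 3)) x (y + x)) := by
          unfold centreVol
          exact Finset.sum_congr rfl fun y _ => (real_openConnIn_translate (criticalProbI 3) x m y).symm
    _ = ∑ y ∈ GM.ball x m, μc.real (openConnIn (↑(GM.ball x m) : Set (Site 3)) x y) := by
          rw [GM.ball, Finset.sum_image]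
          intro a _ b _ h
          exact add_right_cancel h
    _ ≤ ∑ y ∈ GM.ball x m, μc.real (openConnIn (↑(box 3 n) : Set (Site 3)) x y) :=
          Finset.sum_le_sum fun y _ =>
            measureReal_mono (openConnIn_mono_set (Finset.coe_subset.2 hsub) x y) (measure_ne_top _ _)
    _ ≤ ∑ y ∈ box 3 n, μc.real (openConnIn (↑(box 3 n) : Set (Site 3)) x y) :=
          Finset.sum_le_sum_of_subset_of_nonneg hsub fun _ _ _ => measureReal_nonneg

/-- **`S_{p_c}(n) ≥ |B(n - n/2)| · (n/2 + 1)/6`**. -/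
theorem pairSum_criticalProb_ge (n : ℕ) :
    ((box 3 (n - n / 2)).card : ℝ) * (((n / 2 : ℕ) : ℝ) + 1) / 6 ≤ pairSum (criticalProbI 3) n := by
  have hmn : n / 2 ≤ n := Nat.div_le_self n 2
  unfold pairSum
  calc ((box 3 (n - n / 2)).card : ℝ) * (((n / 2 : ℕ) : ℝ) + 1) / 6
        = ∑ _x ∈ box 3 (n - n / 2), (((n / 2 : ℕ) : ℝ) + 1) / 6 := by
          rw [Finset.sum_const, nsmul_eq_mul]; ring
    _ ≤ ∑ _x ∈ box 3 (n - n / 2), centreVol (n / 2) :=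
          Finset.sum_le_sum fun x _ => centreVol_ge (n / 2)
    _ ≤ ∑ x ∈ box 3 (n - n / 2), ∑ y ∈ box 3 n,
          μc.real (openConnIn (↑(box 3 n) : Set (Site 3)) x y) :=
          Finset.sum_le_sum fun x hx => centreVol_le_rowSum hmn hx
    _ ≤ ∑ x ∈ box 3 n, ∑ y ∈ box 3 n, μc.real (openConnIn (↑(box 3 n) : Set (Site 3)) x y) :=
          Finset.sum_le_sum_of_subset_of_nonneg (box_mono 3 (Nat.sub_le n (n / 2)))
            fun _ _ _ => Finset.sum_nonneg fun _ _ => measureReal_nonneg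

/-- **`FA₂(p_c, n) ≥ n^{-2}/8748`** for `n ≥ 1`. -/
theorem FA2_criticalProb_ge {n : ℕ} (hn : 1 ≤ n) :
    1 / (8748 * (n : ℝ) ^ 2) ≤ FA2 (criticalProbI 3) n := by
  have h := pairSum_criticalProb_ge n
  have h1 : n ≤ 2 * (n - n / 2) := by omega
  have h2 : n ≤ 2 * (n / 2 + 1) := by omega
  have hn' : (1 : ℝ) ≤ n := by exact_mod_cast hn
  have hn0 : (n : ℝ) ≠ 0 := by positivity
  have hcard : (n : ℝ) ^ 3 ≤ ((box 3 (n - n / 2)).card : ℝ) := by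
    rw [card_box]
    have : n ^ 3 ≤ (2 * (n - n / 2) + 1) ^ 3 := Nat.pow_le_pow_left (by omega) 3
    exact_mod_cast this
  have hm1 : (n : ℝ) / 2 ≤ ((n / 2 : ℕ) : ℝ) + 1 := by
    have : (n : ℝ) ≤ 2 * (((n / 2 : ℕ) : ℝ) + 1) := by exact_mod_cast h2
    linarith
  have hps : (n : ℝ) ^ 4 / 12 ≤ pairSum (criticalProbI 3) n := by
    calc (n : ℝ) ^ 4 / 12 = (n : ℝ) ^ 3 * ((n : ℝ) / 2) / 6 := by ring
      _ ≤ ((box 3 (n - n / 2)).card : ℝ) * (((n / 2 : ℕ) : ℝ) + 1) / 6 := by gcongr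
      _ ≤ _ := h
  have hcard2 : ((box 3 n).card : ℝ) ^ 2 ≤ 729 * (n : ℝ) ^ 6 := by
    rw [card_box_real]
    have h3 : 2 * (n : ℝ) + 1 ≤ 3 * n := by linarith
    calc ((2 * (n : ℝ) + 1) ^ 3) ^ 2 = (2 * (n : ℝ) + 1) ^ 6 := by ring
      _ ≤ (3 * (n : ℝ)) ^ 6 := by gcongr
      _ = 729 * (n : ℝ) ^ 6 := by ring
  unfold FA2
  rw [le_div_iff₀ (pow_pos (card_box_pos n) 2)]
  have hpos : 0 ≤ 1 / (8748 * (n : ℝ) ^ 2) := by positivity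
  calc 1 / (8748 * (n : ℝ) ^ 2) * ((box 3 n).card : ℝ) ^ 2
        ≤ 1 / (8748 * (n : ℝ) ^ 2) * (729 * (n : ℝ) ^ 6) := mul_le_mul_of_nonneg_left hcard2 hpos
    _ = (n : ℝ) ^ 4 / 12 := by field_simp; ring
    _ ≤ pairSum (criticalProbI 3) n := hps

/-- **No exponent `a > 2` at `p_c`**: `PowerSavingWith p_c a` fails for `a > 2`. -/
theorem not_powerSavingWith_criticalProb_of_two_lt {a : ℝ} (ha : 2 < a) :
    ¬ PowerSavingWith (criticalProbI 3) a := by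
  rintro ⟨C, hC⟩
  have ha2 : 0 < a - 2 := by linarith
  have hev1 : ∀ᶠ n : ℕ in atTop, 8748 * C < (n : ℝ) ^ (a - 2) :=
    ((tendsto_rpow_atTop ha2).comp tendsto_natCast_atTop_atTop).eventually_gt_atTop _
  obtain ⟨n, hnC, hn1⟩ := (hev1.and (eventually_ge_atTop 1)).exists
  have hnpos : (0 : ℝ) < n := by exact_mod_cast hn1
  have h1 : 1 / (8748 * (n : ℝ) ^ 2) ≤ C * (n : ℝ) ^ (-a) :=
    (FA2_criticalProb_ge hn1).trans (hC n hn1)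
  have hna : 0 < (n : ℝ) ^ a := Real.rpow_pos_of_pos hnpos a
  rw [Real.rpow_neg hnpos.le a, ← div_eq_mul_inv, le_div_iff₀ hna] at h1
  have h2 : (n : ℝ) ^ (a - 2) = 8748 * (1 / (8748 * (n : ℝ) ^ 2) * (n : ℝ) ^ a) := by
    rw [Real.rpow_sub hnpos, show ((2 : ℝ)) = ((2 : ℕ) : ℝ) by norm_num, Real.rpow_natCast]
    field_simp
  rw [h2] at hnC
  linarith

/-- Hence any exponent witnessing the crux satisfies `a ≤ 2`. -/
theorem exponent_le_two {a : ℝ} (h : PowerSavingWith (criticalProbI 3) a) : a ≤ 2 :=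
  le_of_not_gt fun ha => not_powerSavingWith_criticalProb_of_two_lt ha h

end DCT

/-! ## §6 The crux versus centre-rooted free susceptibility bounds (sibling crux 5786)

`CentreRootedBound b : ∃ C, ∀ R ≥ 1, Σ_{y ∈ B(R)} P_{p_c}(0 ↔ y in B(R)) ≤ C R^b`; the sibling
crux `PercShatteringRace.FreeSusceptibilityPowerSaving` (stmt-CriticalPhenomena-5786) is the case
`b = 5/2` verbatim.  Any `b < 3` gives the present crux with `a = 3 - b` (translate each root's
row into the centre of a box of double size): so 4447 is WEAKER than 5786, and §5 shows `b ≥ 1`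
is forced (`centreVol_ge`).
-/

section Sibling

/-- Centre-rooted free-box susceptibility bound with exponent `b`. -/
def CentreRootedBound (b : ℝ) : Prop :=
  ∃ C : ℝ, ∀ R : ℕ, 1 ≤ R →
    ∑ y ∈ box 3 R, μc.real (openConnIn (↑(box 3 R) : Set (Site 3)) 0 y) ≤ C * (R : ℝ) ^ b

/-- A root `x ∈ B(n)` sees at most the centre volume of `B(2n)`:
`Σ_{y ∈ B(n)} P(x ↔ y in B(n)) ≤ Σ_{y ∈ B(2n)} P(0 ↔ y in B(2n))`. -/
theorem rowSum_le_centreVol_double {n : ℕ} {x : Site 3} (hx : x ∈ box 3 n) :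
    ∑ y ∈ box 3 n, μc.real (openConnIn (↑(box 3 n) : Set (Site 3)) x y) ≤ centreVol (2 * n) := by
  have hsub : box 3 n ⊆ GM.ball x (2 * n) := by
    intro y hy
    rw [GM.mem_ball]
    rw [mem_box] at hx hy
    intro i
    have h1 := hx i
    have h2 := hy i
    push_cast
    constructor <;> omega
  calc ∑ y ∈ box 3 n, μc.real (openConnIn (↑(box 3 n) : Set (Site 3)) x y)
        ≤ ∑ y ∈ box 3 n, μc.real (openConnIn (↑(GM.ball x (2 * n)) : Set (Site 3)) x y) :=
          Finset.sum_le_sum fun y _ =>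
            measureReal_mono (openConnIn_mono_set (Finset.coe_subset.2 hsub) x y) (measure_ne_top _ _)
    _ ≤ ∑ y ∈ GM.ball x (2 * n), μc.real (openConnIn (↑(GM.ball x (2 * n)) : Set (Site 3)) x y) :=
          Finset.sum_le_sum_of_subset_of_nonneg hsub fun _ _ _ => measureReal_nonneg
    _ = ∑ y ∈ box 3 (2 * n), μc.real (openConnIn (↑(GM.ball x (2 * n)) : Set (Site 3)) x (y + x)) := by
          rw [GM.ball, Finset.sum_image]
          intro a _ b _ h
          exact add_right_cancel h
    _ = centreVol (2 * n) := by
          unfold centreVol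
          exact Finset.sum_congr rfl fun y _ => real_openConnIn_translate (criticalProbI 3) x (2 * n) y

/-- **Centre-rooted bound with `b < 3` ⟹ the crux with exponent `3 - b`.** -/
theorem powerSavingWith_of_centreRootedBound {b : ℝ} (h : CentreRootedBound b) :
    PowerSavingWith (criticalProbI 3) (3 - b) := by
  obtain ⟨C, hC⟩ := h
  refine ⟨max C 0 * 2 ^ b, fun n hn => ?_⟩
  have hnpos : (0 : ℝ) < n := by exact_mod_cast hn
  have hn2 : 1 ≤ 2 * n := by omega
  have hrow : ∀ x ∈ box 3 n, ∑ y ∈ box 3 n, μc.real (openConnIn (↑(box 3 n) : Set (Site 3)) x y)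
      ≤ max C 0 * (2 * (n : ℝ)) ^ b := by
    intro x hx
    calc _ ≤ centreVol (2 * n) := rowSum_le_centreVol_double hx
      _ ≤ C * ((2 * n : ℕ) : ℝ) ^ b := hC (2 * n) hn2
      _ ≤ max C 0 * (2 * (n : ℝ)) ^ b := by
          push_cast
          exact mul_le_mul_of_nonneg_right (le_max_left _ _) (Real.rpow_nonneg (by positivity) _)
  have hps : pairSum (criticalProbI 3) n ≤ ((box 3 n).card : ℝ) * (max C 0 * (2 * (n : ℝ)) ^ b) := by
    unfold pairSum
    calc _ ≤ ∑ _x ∈ box 3 n, max C 0 * (2 * (n : ℝ)) ^ b := Finset.sum_le_sum hrow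
      _ = _ := by rw [Finset.sum_const, nsmul_eq_mul]
  have hcard : (n : ℝ) ^ 3 ≤ ((box 3 n).card : ℝ) := by
    rw [card_box_real]
    have : (n : ℝ) ≤ 2 * n + 1 := by linarith
    calc (n : ℝ) ^ 3 ≤ (2 * (n : ℝ) + 1) ^ 3 := by gcongr
      _ = _ := by ring
  have hcpos := card_box_pos n
  unfold FA2
  rw [div_le_iff₀ (pow_pos hcpos 2)]
  -- pairSum ≤ card * M (2n)^b and card * M (2n)^b ≤ (M 2^b n^(-(3-b))) * card^2 since n^3 ≤ card
  have hM : 0 ≤ max C 0 := le_max_right _ _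
  have hsplit : (2 * (n : ℝ)) ^ b = 2 ^ b * ((n : ℝ) ^ (-(3 - b)) * (n : ℝ) ^ 3) := by
    rw [Real.mul_rpow (by norm_num) hnpos.le, ← Real.rpow_natCast (n : ℝ) 3, ← Real.rpow_add hnpos]
    norm_num
  calc pairSum (criticalProbI 3) n ≤ ((box 3 n).card : ℝ) * (max C 0 * (2 * (n : ℝ)) ^ b) := hps
    _ = max C 0 * 2 ^ b * (n : ℝ) ^ (-(3 - b)) * ((n : ℝ) ^ 3 * ((box 3 n).card : ℝ)) := by
        rw [hsplit]; ring
    _ ≤ max C 0 * 2 ^ b * (n : ℝ) ^ (-(3 - b)) * (((box 3 n).card : ℝ) * ((box 3 n).card : ℝ)) := by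
        have hK : 0 ≤ max C 0 * 2 ^ b * (n : ℝ) ^ (-(3 - b)) :=
          mul_nonneg (mul_nonneg hM (Real.rpow_nonneg (by norm_num) _)) (Real.rpow_nonneg hnpos.le _)
        exact mul_le_mul_of_nonneg_left (mul_le_mul_of_nonneg_right hcard hcpos.le) hK
    _ = max C 0 * 2 ^ b * (n : ℝ) ^ (-(3 - b)) * ((box 3 n).card : ℝ) ^ 2 := by ring

/-- In particular the sibling crux shape (`b = 5/2`) gives the present crux with `a = 1/2`. -/
theorem powerSavingAt_of_centreRootedBound {b : ℝ} (hb : b < 3)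
    (h : CentreRootedBound b) : PowerSavingAt (criticalProbI 3) :=
  (powerSavingAt_iff _).2 ⟨3 - b, by linarith, powerSavingWith_of_centreRootedBound h⟩

/-- Conversely the DCT floor: no centre-rooted bound with `b < 1` (`V(m) ≥ (m+1)/6`). -/
theorem not_centreRootedBound_of_lt_one {b : ℝ} (hb : b < 1) : ¬ CentreRootedBound b := by
  rintro ⟨C, hC⟩
  have hb1 : 0 < 1 - b := by linarith
  have hev1 : ∀ᶠ n : ℕ in atTop, 6 * C < (n : ℝ) ^ (1 - b) :=
    ((tendsto_rpow_atTop hb1).comp tendsto_natCast_atTop_atTop).eventually_gt_atTop _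
  obtain ⟨n, hnC, hn1⟩ := (hev1.and (eventually_ge_atTop 1)).exists
  have hnpos : (0 : ℝ) < n := by exact_mod_cast hn1
  have h1 : ((n : ℝ) + 1) / 6 ≤ C * (n : ℝ) ^ b := (centreVol_ge n).trans (hC n hn1)
  have hnb : 0 < (n : ℝ) ^ b := Real.rpow_pos_of_pos hnpos b
  have h2 : (n : ℝ) ^ (1 - b) = (n : ℝ) * ((n : ℝ) ^ b)⁻¹ := by
    rw [Real.rpow_sub hnpos, Real.rpow_one, div_eq_mul_inv]
  rw [h2] at hnC
  rw [← div_le_iff₀ hnb, div_eq_mul_inv, div_eq_mul_inv] at h1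
  -- h1 : (n+1) * 6⁻¹ * (n^b)⁻¹ ≤ C ; hnC : 6 C < n (n^b)⁻¹
  have hinv : 0 < ((n : ℝ) ^ b)⁻¹ := inv_pos.2 hnb
  nlinarith [mul_pos hnpos hinv]

/-- **Converse: the crux with exponent `a` gives a centre-rooted bound with `b = 3 - a`**
(average `centreVol_le_rowSum` over the roots of `B(n)` inside `B(2n)`).  Hence
`FreeBoxPowerSaving ⟺ ∃ b < 3, CentreRootedBound b` (`freeBoxPowerSaving_iff_centreRooted`). -/
theorem centreRootedBound_of_powerSavingWith {a : ℝ} (h : PowerSavingWith (criticalProbI 3) a) :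
    CentreRootedBound (3 - a) := by
  obtain ⟨C, hC⟩ := h
  refine ⟨max C 0 * (2 : ℝ) ^ (-a) * 15625, fun n hn => ?_⟩
  have hnpos : (0 : ℝ) < n := by exact_mod_cast hn
  have hn2 : 1 ≤ 2 * n := by omega
  have hcn := card_box_pos n
  have hc2n := card_box_pos (2 * n)
  -- averaging the row bound over the roots of `B(n)`
  have key : ((box 3 n).card : ℝ) * centreVol n ≤ pairSum (criticalProbI 3) (2 * n) := by
    unfold pairSum
    calc ((box 3 n).card : ℝ) * centreVol n = ∑ _x ∈ box 3 n, centreVol n := by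
          rw [Finset.sum_const, nsmul_eq_mul]
      _ ≤ ∑ x ∈ box 3 n, ∑ y ∈ box 3 (2 * n), μc.real (openConnIn (↑(box 3 (2 * n)) : Set (Site 3)) x y) :=
          Finset.sum_le_sum fun x hx =>
            centreVol_le_rowSum (m := n) (n := 2 * n) (by omega) (by rwa [show 2 * n - n = n by omega])
      _ ≤ _ := Finset.sum_le_sum_of_subset_of_nonneg (box_mono 3 (by omega : n ≤ 2 * n))
            fun _ _ _ => Finset.sum_nonneg fun _ _ => measureReal_nonneg
  -- the crux at scale `2n`
  have hps : pairSum (criticalProbI 3) (2 * n) ≤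
      max C 0 * ((2 : ℝ) ^ (-a) * (n : ℝ) ^ (-a)) * ((box 3 (2 * n)).card : ℝ) ^ 2 := by
    have h1 := hC (2 * n) hn2
    unfold FA2 at h1
    rw [div_le_iff₀ (pow_pos hc2n 2)] at h1
    have h2 : ((2 * n : ℕ) : ℝ) ^ (-a) = (2 : ℝ) ^ (-a) * (n : ℝ) ^ (-a) := by
      push_cast; exact Real.mul_rpow (by norm_num) hnpos.le
    rw [h2] at h1
    refine h1.trans (mul_le_mul_of_nonneg_right (mul_le_mul_of_nonneg_right (le_max_left _ _) ?_) (sq_nonneg _))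
    exact mul_nonneg (Real.rpow_nonneg (by norm_num) _) (Real.rpow_nonneg hnpos.le _)
  -- box arithmetic
  have hcard2 : ((box 3 (2 * n)).card : ℝ) ^ 2 ≤ 15625 * (n : ℝ) ^ 6 := by
    rw [card_box]; push_cast
    have hn' : (1 : ℝ) ≤ n := by exact_mod_cast hn
    have : 2 * (2 * (n : ℝ)) + 1 ≤ 5 * n := by linarith
    calc ((2 * (2 * (n : ℝ)) + 1) ^ 3) ^ 2 = (2 * (2 * (n : ℝ)) + 1) ^ 6 := by ring
      _ ≤ (5 * (n : ℝ)) ^ 6 := by gcongr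
      _ = 15625 * (n : ℝ) ^ 6 := by ring
  have hcard : (n : ℝ) ^ 3 ≤ ((box 3 n).card : ℝ) := by
    rw [card_box_real]
    have : (n : ℝ) ≤ 2 * n + 1 := by linarith
    calc (n : ℝ) ^ 3 ≤ (2 * (n : ℝ) + 1) ^ 3 := by gcongr
      _ = _ := by ring
  have hM : 0 ≤ max C 0 * ((2 : ℝ) ^ (-a) * (n : ℝ) ^ (-a)) :=
    mul_nonneg (le_max_right _ _) (mul_nonneg (Real.rpow_nonneg (by norm_num) _) (Real.rpow_nonneg hnpos.le _))
  have hpow : (n : ℝ) ^ (-a) * (n : ℝ) ^ 6 / (n : ℝ) ^ 3 = (n : ℝ) ^ (3 - a) := by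
    have h63 : (n : ℝ) ^ 6 / (n : ℝ) ^ 3 = (n : ℝ) ^ ((3 : ℕ) : ℝ) := by
      rw [Real.rpow_natCast, show (6 : ℕ) = 3 + 3 by norm_num, pow_add,
        mul_div_assoc, div_self (pow_ne_zero 3 hnpos.ne'), mul_one]
    rw [mul_div_assoc, h63, ← Real.rpow_add hnpos]
    congr 1; push_cast; ring
  calc centreVol n ≤ pairSum (criticalProbI 3) (2 * n) / ((box 3 n).card : ℝ) := by
        rw [le_div_iff₀ hcn, mul_comm]; exact key
    _ ≤ max C 0 * ((2 : ℝ) ^ (-a) * (n : ℝ) ^ (-a)) * (15625 * (n : ℝ) ^ 6) / (n : ℝ) ^ 3 := by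
        calc _ ≤ max C 0 * ((2 : ℝ) ^ (-a) * (n : ℝ) ^ (-a)) * (15625 * (n : ℝ) ^ 6) / ((box 3 n).card : ℝ) :=
              div_le_div_of_nonneg_right (hps.trans (mul_le_mul_of_nonneg_left hcard2 hM)) hcn.le
          _ ≤ _ := div_le_div_of_nonneg_left (mul_nonneg hM (by positivity)) (pow_pos hnpos 3) hcard
    _ = max C 0 * (2 : ℝ) ^ (-a) * 15625 * ((n : ℝ) ^ (-a) * (n : ℝ) ^ 6 / (n : ℝ) ^ 3) := by ring
    _ = max C 0 * (2 : ℝ) ^ (-a) * 15625 * (n : ℝ) ^ (3 - a) := by rw [hpow]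

/-- **The crux is equivalent to a centre-rooted free-susceptibility power saving below `R³`.** -/
theorem freeBoxPowerSaving_iff_centreRooted :
    FreeBoxPowerSaving ↔ ∃ b : ℝ, b < 3 ∧ CentreRootedBound b := by
  constructor
  · rintro ⟨a, C, ha, hC⟩
    exact ⟨3 - a, by linarith, centreRootedBound_of_powerSavingWith ⟨C, hC⟩⟩
  · rintro ⟨b, hb, h⟩
    exact freeBoxPowerSaving_iff.2 (powerSavingAt_of_centreRootedBound hb h)

end Sibling

/-! ## §7 The parameter picture: monotonicity in `p`, and the subcritical regime has exponent exactly 3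

`FA₂(p, n)` is non-decreasing in `p` (increasing events), so power saving is inherited downwards in
`p`; strictly below `p_c` the finite susceptibility (tree: `summable_tau_of_lt_criticalProb`, from
sharpness) gives `FA₂(p, n) ≤ χ(p)/|B(n)| ≤ χ(p) n^{-3}`, i.e. the MAXIMAL exponent `a = 3`
(cf. `not_powerSavingWith_of_three_lt`).  So `p ↦ sup{a : PowerSavingWith p a}` is `3` on
`[0, p_c)`, lies in `(0, 2]` at `p_c` iff the crux holds (§5), and there is no saving at `p = 1`
(§2): the crux is exactly the boundary case of this profile.
-/

section Subcritical

open Literature.Probability.Percolation.DCT16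

/-- `FA₂(p, n)` is non-decreasing in `p`. -/
theorem FA2_mono {p q : unitInterval} (hpq : p ≤ q) (n : ℕ) : FA2 p n ≤ FA2 q n := by
  unfold FA2 pairSum
  refine div_le_div_of_nonneg_right ?_ (by positivity)
  exact Finset.sum_le_sum fun x _ => Finset.sum_le_sum fun y _ =>
    real_mono_of_isUpperSet (zdGraph 3) (isUpperSet_openConnIn _ x y)
      (measurableSet_openConnIn _ x y) hpq

/-- Power saving is inherited downwards in the parameter. -/
theorem powerSavingWith_anti {p q : unitInterval} (hpq : p ≤ q) {a : ℝ} (h : PowerSavingWith q a) :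
    PowerSavingWith p a := by
  obtain ⟨C, hC⟩ := h
  exact ⟨C, fun n hn => (FA2_mono hpq n).trans (hC n hn)⟩

theorem powerSavingAt_anti {p q : unitInterval} (hpq : p ≤ q) (h : PowerSavingAt q) :
    PowerSavingAt p := by
  obtain ⟨a, C, ha, hC⟩ := h
  exact ⟨a, C, ha, fun n hn => (FA2_mono hpq n).trans (hC n hn)⟩

/-- In particular the crux gives power saving at every `p ≤ p_c` (with the same exponent). -/
theorem powerSavingAt_of_le_criticalProb (h : FreeBoxPowerSaving) {p : unitInterval}
    (hp : p ≤ criticalProbI 3) : PowerSavingAt p :=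
  powerSavingAt_anti hp (freeBoxPowerSaving_iff.1 h)

/-- `P_p(x ↔ y in S) ≤ τ_p(x, y)`. -/
theorem real_openConnIn_le_tau (p : unitInterval) (S : Set (Site 3)) (x y : Site 3) :
    (bondPercolation (zdGraph 3) p).real (openConnIn S x y) ≤ tau 3 p x y :=
  measureReal_mono (fun _ hω => reachable_of_pathIn (pathIn_of_mem_openConnIn hω)) (measure_ne_top _ _)

/-- Below `p_c`: `S_p(n) ≤ |B(n)| · χ(p)` with `χ(p) = Σ_z τ_p(0, z) < ∞`. -/
theorem pairSum_le_card_mul_chi (p : unitInterval) (hp : (p : ℝ) < criticalProb (zdGraph 3) 0)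
    (n : ℕ) : pairSum p n ≤ ((box 3 n).card : ℝ) * ∑' z : Site 3, tau 3 p 0 z := by
  have hsum : Summable fun z : Site 3 => tau 3 p 0 z :=
    summable_tau_of_lt_criticalProb (by norm_num) p hp
  unfold pairSum
  calc _ ≤ ∑ x ∈ box 3 n, ∑ y ∈ box 3 n, tau 3 p 0 (y - x) :=
        Finset.sum_le_sum fun x _ => Finset.sum_le_sum fun y _ =>
          (real_openConnIn_le_tau p _ x y).trans_eq (tau_eq_tau_zero_sub p x y)
    _ ≤ ∑ _x ∈ box 3 n, ∑' z : Site 3, tau 3 p 0 z := by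
        refine Finset.sum_le_sum fun x _ => ?_
        calc ∑ y ∈ box 3 n, tau 3 p 0 (y - x)
              = ∑ z ∈ (box 3 n).image (· - x), tau 3 p 0 z := by
                rw [Finset.sum_image fun a _ b _ h => sub_left_injective h]
          _ ≤ ∑' z : Site 3, tau 3 p 0 z := hsum.sum_le_tsum _ fun z _ => tau_nonneg p 0 z
    _ = _ := by rw [Finset.sum_const, nsmul_eq_mul]

/-- **Below `p_c` the exponent is the maximal one, `a = 3`**: `FA₂(p, n) ≤ χ(p) · n^{-3}`. -/
theorem powerSavingWith_three_of_lt_criticalProb (p : unitInterval)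
    (hp : (p : ℝ) < criticalProb (zdGraph 3) 0) : PowerSavingWith p 3 := by
  refine ⟨∑' z : Site 3, tau 3 p 0 z, fun n hn => ?_⟩
  have hχ : 0 ≤ ∑' z : Site 3, tau 3 p 0 z := tsum_nonneg fun z => tau_nonneg p 0 z
  have hnpos : (0 : ℝ) < n := by exact_mod_cast hn
  have hn0 : (n : ℝ) ≠ 0 := hnpos.ne'
  have hcard : (n : ℝ) ^ 3 ≤ ((box 3 n).card : ℝ) := by
    rw [card_box_real]
    have : (n : ℝ) ≤ 2 * n + 1 := by linarith
    calc (n : ℝ) ^ 3 ≤ (2 * (n : ℝ) + 1) ^ 3 := by gcongr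
      _ = _ := by ring
  have hc := card_box_pos n
  unfold FA2
  rw [div_le_iff₀ (pow_pos hc 2)]
  have hrp : (n : ℝ) ^ (-(3 : ℝ)) = ((n : ℝ) ^ 3)⁻¹ := by
    rw [Real.rpow_neg hnpos.le, show ((3 : ℝ)) = ((3 : ℕ) : ℝ) by norm_num, Real.rpow_natCast]
  calc pairSum p n ≤ ((box 3 n).card : ℝ) * ∑' z : Site 3, tau 3 p 0 z := pairSum_le_card_mul_chi p hp n
    _ = (∑' z : Site 3, tau 3 p 0 z) * (n : ℝ) ^ (-(3 : ℝ)) * ((n : ℝ) ^ 3 * ((box 3 n).card : ℝ)) := by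
        rw [hrp]; field_simp
    _ ≤ (∑' z : Site 3, tau 3 p 0 z) * (n : ℝ) ^ (-(3 : ℝ)) *
          (((box 3 n).card : ℝ) * ((box 3 n).card : ℝ)) := by
        have hK : 0 ≤ (∑' z : Site 3, tau 3 p 0 z) * (n : ℝ) ^ (-(3 : ℝ)) :=
          mul_nonneg hχ (Real.rpow_nonneg hnpos.le _)
        exact mul_le_mul_of_nonneg_left (mul_le_mul_of_nonneg_right hcard hc.le) hK
    _ = _ := by ring

/-- Hence power saving holds at every subcritical parameter. -/
theorem powerSavingAt_of_lt_criticalProb (p : unitInterval)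
    (hp : (p : ℝ) < criticalProb (zdGraph 3) 0) : PowerSavingAt p :=
  (powerSavingAt_iff p).2 ⟨3, by norm_num, powerSavingWith_three_of_lt_criticalProb p hp⟩

end Subcritical

/-! ## §8 (cycle 2) The one-arm reduction: polynomial one-arm decay ⟹ the crux, sharp exponent `a = 2s`

`π_p(m) := P_p(0 ↔ ∂Λ_m)` (`oneArmProb 3 p m`, tree `ArmEvents.lean`).  Two disjoint boxes (tree:
`Literature.Barriers.CriticalPhenomena.tau_le_oneArmProb_sq_of_coord`) give
`P_p(x ↔ y in B(n)) ≤ τ_p(x, y) ≤ π_p(⌊(|x-y|_∞ - 1)/2⌋)²`, so a one-arm bound `π_p(m) ≤ C m^{-s}`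
(`m ≥ 1`, `0 < s ≤ 1`) sums over the shells `∂Λ_k` (`|∂Λ_k| ≤ 54 k²`) to
`Σ_{z ∈ B(n)} τ_p(0, z) ≤ (125 + 864 C²) n^{3-2s}` and `FA₂(p, n) ≤ 8 (125 + 864 C²) n^{-2s}`:
`PowerSavingWith p (2s)` (`powerSavingWith_of_oneArm`).  At `p_c(ℤ³)` the predicted one-arm exponent
is `s = β/ν ≈ 0.477`, so THIS route carries the sharp exponent `2s = 1 + η ≈ 0.954` of the crux
(`d_f = (5 - η)/2`); and the DCT sphere bound forces `π_{p_c}(m) ≥ 1/(6(4m+3))` (the classical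
`m^{-(d-1)/2}` floor, `oneArmProb_criticalProb_ge`, proved here — the tree had only `c/m²` for `d ≤ 3`,
`exists_oneArmProb_criticalProbI_lower_sq`), hence `s ≤ 1` (`oneArm_exponent_le_one`), consistent
with §5's ceiling `a ≤ 2`.

CONTRAPOSITIVE (`forall_exists_oneArmProb_gt_of_not_freeBoxPowerSaving`): a refutation of the crux must
show that the critical one-arm probability of `ℤ³` is NOT `O(m^{-s})` for ANY `s > 0` — slower than
every power along a subsequence.  Nobody can prove `π_{p_c}(m) → 0` (that is `θ(p_c) = 0`), let alone
bound its RATE from below beyond `1/m`; so the negation of the crux sits strictly inside the gap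
between "continuity without a rate" and "first-order transition", where no technique on either side
reaches.  SANDWICH (with the sibling files): `OneArmPowerDecay ⟹ FreeBoxPowerSaving ⟹ FreeBoxSparse
⟸ θ(p_c) = 0` (`Theorems/FreeBoxSparse/Negative/OfContinuity.lean`), and
`OneArmPowerDecay ⟹ θ(p_c) = 0` trivially; neither `θ(p_c) = 0 ⟹ crux` (rate-free ⇏ rate) nor
`crux ⟹ θ(p_c) = 0` (needs the route's other cruxes: in a jump world the infinite cluster may still
shatter into `≍ n²` free pieces of size `≍ n` per box, giving only `FA₂ ≳ θ² n^{-2}` — the SAME order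
as the DCT floor of §5, so even `θ(p_c) > 0` alone would not refute the crux) is available.
-/

section OneArm

open Literature.Barriers.CriticalPhenomena (tau_le_oneArmProb_sq_of_coord sum_box_sdiff_box_eq_sum_Ico
  card_sphere_succ_le' sum_sphere_real_openConnIn_ge)

/-- Row sums are dominated by the bulk two-point box sum of double radius:
`Σ_{y ∈ B(n)} P_p(x ↔ y in B(n)) ≤ Σ_{z ∈ B(2n)} τ_p(0, z)` for `x ∈ B(n)`. -/
theorem rowSum_le_sum_tau (p : unitInterval) {n : ℕ} {x : Site 3} (hx : x ∈ box 3 n) :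
    ∑ y ∈ box 3 n, (bondPercolation (zdGraph 3) p).real (openConnIn (↑(box 3 n) : Set (Site 3)) x y)
      ≤ ∑ z ∈ box 3 (2 * n), tau 3 p 0 z := by
  have himg : (box 3 n).image (fun y => y - x) ⊆ box 3 (2 * n) := by
    intro z hz
    obtain ⟨y, hy, rfl⟩ := Finset.mem_image.1 hz
    rw [mem_box] at hx hy ⊢
    intro i
    have h1 := hx i
    have h2 := hy i
    simp only [Pi.sub_apply]
    push_cast
    constructor <;> omega
  calc ∑ y ∈ box 3 n, (bondPercolation (zdGraph 3) p).real (openConnIn (↑(box 3 n) : Set (Site 3)) x y)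
      ≤ ∑ y ∈ box 3 n, tau 3 p 0 (y - x) :=
        Finset.sum_le_sum fun y _ =>
          (real_openConnIn_le_tau p _ x y).trans_eq (tau_eq_tau_zero_sub p x y)
    _ = ∑ z ∈ (box 3 n).image (fun y => y - x), tau 3 p 0 z := by
        rw [Finset.sum_image fun a _ b _ h => sub_left_injective h]
    _ ≤ ∑ z ∈ box 3 (2 * n), tau 3 p 0 z :=
        Finset.sum_le_sum_of_subset_of_nonneg himg fun z _ _ => tau_nonneg p 0 z

/-- `S_p(n) ≤ |B(n)| · Σ_{z ∈ B(2n)} τ_p(0, z)`. -/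
theorem pairSum_le_card_mul_sum_tau (p : unitInterval) (n : ℕ) :
    pairSum p n ≤ ((box 3 n).card : ℝ) * ∑ z ∈ box 3 (2 * n), tau 3 p 0 z := by
  unfold pairSum
  calc _ ≤ ∑ _x ∈ box 3 n, ∑ z ∈ box 3 (2 * n), tau 3 p 0 z :=
        Finset.sum_le_sum fun x hx => rowSum_le_sum_tau p hx
    _ = _ := by rw [Finset.sum_const, nsmul_eq_mul]

/-- **Shell summation**: a one-arm bound `π_p(m) ≤ C m^{-s}` for `m ≥ 1` with `0 < s ≤ 1` gives
`Σ_{z ∈ B(n)} τ_p(0, z) ≤ (125 + 864 C²) n^{3-2s}` for `n ≥ 1` (two disjoint boxes on the annulus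
`B(n) ∖ B(2)`, `τ ≤ 1` on `B(2)`). -/
theorem sum_tau_box_le_of_oneArm_rpow (p : unitInterval) {C s : ℝ} (hs0 : 0 < s) (hs1 : s ≤ 1)
    (hC : ∀ m : ℕ, 1 ≤ m → oneArmProb 3 p m ≤ C * (m : ℝ) ^ (-s)) {n : ℕ} (hn : 1 ≤ n) :
    ∑ z ∈ box 3 n, tau 3 p 0 z ≤ (125 + 864 * C ^ 2) * (n : ℝ) ^ (3 - 2 * s) := by
  classical
  have hn1 : (1 : ℝ) ≤ n := by exact_mod_cast hn
  have hn0 : (0 : ℝ) < n := by linarith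
  have hnpow1 : 1 ≤ (n : ℝ) ^ (3 - 2 * s) := Real.one_le_rpow hn1 (by linarith)
  have hC2 : 0 ≤ C ^ 2 := sq_nonneg C
  -- the small box
  have hsmall : ∀ m : ℕ, m ≤ 2 → ∑ x ∈ box 3 m, tau 3 p 0 x ≤ 125 := by
    intro m hm
    calc ∑ x ∈ box 3 m, tau 3 p 0 x ≤ ∑ x ∈ box 3 2, tau 3 p 0 x :=
          Finset.sum_le_sum_of_subset_of_nonneg (box_mono 3 hm) fun x _ _ => tau_nonneg p 0 x
      _ ≤ ∑ _x ∈ box 3 2, (1 : ℝ) := Finset.sum_le_sum fun x _ => tau_le_one p 0 x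
      _ = 125 := by rw [Finset.sum_const, card_box, nsmul_eq_mul, mul_one]; norm_num
  rcases le_or_gt n 2 with hn2 | hn2
  · calc ∑ x ∈ box 3 n, tau 3 p 0 x ≤ 125 := hsmall n hn2
      _ ≤ (125 + 864 * C ^ 2) * (n : ℝ) ^ (3 - 2 * s) := by nlinarith
  · have h2n : 2 ≤ n := by omega
    -- pointwise bound on the annulus `B(n) ∖ B(2)`
    have hpt : ∀ x ∈ box 3 n \ box 3 2,
        tau 3 p 0 x ≤ 16 * C ^ 2 * ((Site.supNorm x : ℕ) : ℝ) ^ (-(2 * s)) := by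
      intro x hx
      obtain ⟨-, hx2⟩ := Finset.mem_sdiff.1 hx
      rw [mem_box_iff_supNorm_le, not_le] at hx2
      obtain ⟨i, hi⟩ := Site.exists_natAbs_eq_supNorm Finset.univ_nonempty x
      set k := Site.supNorm x with hk
      set m : ℕ := (k - 1) / 2 with hm
      have hm1 : 1 ≤ m := by omega
      have h2m : 2 * m + 1 ≤ k := by omega
      have hk4m : k ≤ 4 * m := by omega
      have hvi : 2 * (m : ℤ) + 1 ≤ |x i| := by
        rw [← Int.natCast_natAbs, hi]
        exact_mod_cast h2m
      have h1 := tau_le_oneArmProb_sq_of_coord m p i hvi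
      have hπ := hC m hm1
      have hπ0 : 0 ≤ oneArmProb 3 p m := measureReal_nonneg
      have hm0 : (0 : ℝ) < m := by exact_mod_cast hm1
      have hk0 : (0 : ℝ) < k := by exact_mod_cast (show 0 < k by omega)
      have hkm : (k : ℝ) / 4 ≤ m := by
        have : (k : ℝ) ≤ 4 * m := by exact_mod_cast hk4m
        linarith
      -- `m ≥ k/4` gives `m^{-s} ≤ (k/4)^{-s} = 4^s k^{-s} ≤ 4 k^{-s}`
      have hms : (m : ℝ) ^ (-s) ≤ 4 * (k : ℝ) ^ (-s) := by
        have h4s : (4 : ℝ) ^ s ≤ 4 := by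
          calc (4 : ℝ) ^ s ≤ (4 : ℝ) ^ (1 : ℝ) :=
                Real.rpow_le_rpow_of_exponent_le (by norm_num) hs1
            _ = 4 := Real.rpow_one 4
        calc (m : ℝ) ^ (-s) ≤ ((k : ℝ) / 4) ^ (-s) :=
              Real.rpow_le_rpow_of_nonpos (by positivity) hkm (by linarith)
          _ = (4 : ℝ) ^ s * (k : ℝ) ^ (-s) := by
              rw [Real.div_rpow hk0.le (by norm_num), Real.rpow_neg (by norm_num : (0 : ℝ) ≤ 4),
                Real.rpow_neg hk0.le]
              field_simp
          _ ≤ 4 * (k : ℝ) ^ (-s) :=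
              mul_le_mul_of_nonneg_right h4s (Real.rpow_nonneg hk0.le _)
      have hkk : (k : ℝ) ^ (-s) * (k : ℝ) ^ (-s) = (k : ℝ) ^ (-(2 * s)) := by
        rw [← Real.rpow_add hk0, show -s + -s = -(2 * s) by ring]
      calc tau 3 p 0 x ≤ oneArmProb 3 p m ^ 2 := h1
        _ ≤ (C * (m : ℝ) ^ (-s)) ^ 2 := pow_le_pow_left₀ hπ0 hπ 2
        _ = C ^ 2 * ((m : ℝ) ^ (-s)) ^ 2 := by ring
        _ ≤ C ^ 2 * (4 * (k : ℝ) ^ (-s)) ^ 2 :=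
            mul_le_mul_of_nonneg_left (pow_le_pow_left₀ (Real.rpow_nonneg hm0.le _) hms 2) hC2
        _ = 16 * C ^ 2 * ((k : ℝ) ^ (-s) * (k : ℝ) ^ (-s)) := by ring
        _ = 16 * C ^ 2 * (k : ℝ) ^ (-(2 * s)) := by rw [hkk]
    have hsplit : ∑ x ∈ box 3 n, tau 3 p 0 x =
        ∑ x ∈ box 3 n \ box 3 2, tau 3 p 0 x + ∑ x ∈ box 3 2, tau 3 p 0 x :=
      (Finset.sum_sdiff (box_mono 3 h2n)).symm
    -- one shell: `|∂Λ_{k+1}| (k+1)^{-2s} ≤ 54 (k+1)^{2-2s} ≤ 54 n^{2-2s}` for `k + 1 ≤ n`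
    have hshell : ∀ k ∈ Finset.Ico 2 n,
        ((sphere 3 (k + 1)).card : ℝ) * (((k + 1 : ℕ) : ℝ) ^ (-(2 * s))) ≤
          54 * (n : ℝ) ^ (2 - 2 * s) := by
      intro k hk
      have hkn : k + 1 ≤ n := (Finset.mem_Ico.1 hk).2
      have hk1 : (0 : ℝ) < (k : ℝ) + 1 := by positivity
      have hkn' : (k : ℝ) + 1 ≤ n := by exact_mod_cast hkn
      have hcard : ((sphere 3 (k + 1)).card : ℝ) ≤ 54 * ((k : ℝ) + 1) ^ 2 := by
        have h := card_sphere_succ_le' (d := 3) (by norm_num) k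
        norm_num at h
        linarith
      have hpow : ((k : ℝ) + 1) ^ 2 * ((k : ℝ) + 1) ^ (-(2 * s)) = ((k : ℝ) + 1) ^ (2 - 2 * s) := by
        rw [← Real.rpow_two, ← Real.rpow_add hk1, show (2 : ℝ) + -(2 * s) = 2 - 2 * s by ring]
      push_cast
      calc ((sphere 3 (k + 1)).card : ℝ) * (((k : ℝ) + 1) ^ (-(2 * s)))
          ≤ 54 * ((k : ℝ) + 1) ^ 2 * (((k : ℝ) + 1) ^ (-(2 * s))) :=
            mul_le_mul_of_nonneg_right hcard (Real.rpow_nonneg hk1.le _)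
        _ = 54 * ((k : ℝ) + 1) ^ (2 - 2 * s) := by rw [mul_assoc, hpow]
        _ ≤ 54 * (n : ℝ) ^ (2 - 2 * s) :=
            mul_le_mul_of_nonneg_left (Real.rpow_le_rpow hk1.le hkn' (by linarith)) (by norm_num)
    have hmul : (n : ℝ) * (n : ℝ) ^ (2 - 2 * s) = (n : ℝ) ^ (3 - 2 * s) := by
      rw [show (3 : ℝ) - 2 * s = 1 + (2 - 2 * s) by ring, Real.rpow_add hn0, Real.rpow_one]
    have hann : ∑ x ∈ box 3 n \ box 3 2, tau 3 p 0 x ≤ 16 * C ^ 2 * (54 * (n : ℝ) ^ (3 - 2 * s)) := by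
      calc ∑ x ∈ box 3 n \ box 3 2, tau 3 p 0 x
          ≤ ∑ x ∈ box 3 n \ box 3 2, 16 * C ^ 2 * ((Site.supNorm x : ℕ) : ℝ) ^ (-(2 * s)) :=
            Finset.sum_le_sum hpt
        _ = 16 * C ^ 2 *
              ∑ x ∈ box 3 n \ box 3 2, (fun k : ℕ => (k : ℝ) ^ (-(2 * s))) (Site.supNorm x) := by
            rw [Finset.mul_sum]
        _ = 16 * C ^ 2 * ∑ k ∈ Finset.Ico 2 n,
              ((sphere 3 (k + 1)).card : ℝ) * (((k + 1 : ℕ) : ℝ) ^ (-(2 * s))) := by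
            rw [sum_box_sdiff_box_eq_sum_Ico (fun k : ℕ => (k : ℝ) ^ (-(2 * s))) h2n]
        _ ≤ 16 * C ^ 2 * ∑ _k ∈ Finset.Ico 2 n, 54 * (n : ℝ) ^ (2 - 2 * s) :=
            mul_le_mul_of_nonneg_left (Finset.sum_le_sum hshell) (by positivity)
        _ = 16 * C ^ 2 * (((n - 2 : ℕ) : ℝ) * (54 * (n : ℝ) ^ (2 - 2 * s))) := by
            rw [Finset.sum_const, Nat.card_Ico, nsmul_eq_mul]
        _ ≤ 16 * C ^ 2 * ((n : ℝ) * (54 * (n : ℝ) ^ (2 - 2 * s))) := by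
            gcongr
            exact_mod_cast Nat.sub_le n 2
        _ = 16 * C ^ 2 * (54 * ((n : ℝ) * (n : ℝ) ^ (2 - 2 * s))) := by ring
        _ = 16 * C ^ 2 * (54 * (n : ℝ) ^ (3 - 2 * s)) := by rw [hmul]
    calc ∑ x ∈ box 3 n, tau 3 p 0 x
        = ∑ x ∈ box 3 n \ box 3 2, tau 3 p 0 x + ∑ x ∈ box 3 2, tau 3 p 0 x := hsplit
      _ ≤ 16 * C ^ 2 * (54 * (n : ℝ) ^ (3 - 2 * s)) + 125 := add_le_add hann (hsmall 2 le_rfl)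
      _ ≤ 16 * C ^ 2 * (54 * (n : ℝ) ^ (3 - 2 * s)) + 125 * (n : ℝ) ^ (3 - 2 * s) := by nlinarith
      _ = (125 + 864 * C ^ 2) * (n : ℝ) ^ (3 - 2 * s) := by ring

/-- **One-arm decay ⟹ power saving with exponent `2s`**: if `π_p(m) ≤ C m^{-s}` (`m ≥ 1`,
`0 < s ≤ 1`) then `FA₂(p, n) ≤ 8 (125 + 864 C²) n^{-2s}` for `n ≥ 1`. -/
theorem powerSavingWith_of_oneArm (p : unitInterval) {C s : ℝ} (hs0 : 0 < s) (hs1 : s ≤ 1)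
    (hC : ∀ m : ℕ, 1 ≤ m → oneArmProb 3 p m ≤ C * (m : ℝ) ^ (-s)) :
    PowerSavingWith p (2 * s) := by
  refine ⟨8 * (125 + 864 * C ^ 2), fun n hn => ?_⟩
  have hnpos : (0 : ℝ) < n := by exact_mod_cast hn
  have hn2 : 1 ≤ 2 * n := by omega
  have hsum := sum_tau_box_le_of_oneArm_rpow p hs0 hs1 hC hn2
  have hK : 0 ≤ 125 + 864 * C ^ 2 := by positivity
  have hcard : (n : ℝ) ^ 3 ≤ ((box 3 n).card : ℝ) := by
    rw [card_box_real]
    have : (n : ℝ) ≤ 2 * n + 1 := by linarith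
    calc (n : ℝ) ^ 3 ≤ (2 * (n : ℝ) + 1) ^ 3 := by gcongr
      _ = _ := by ring
  have hc := card_box_pos n
  have h2pow : ((2 * n : ℕ) : ℝ) ^ (3 - 2 * s) ≤ 8 * ((n : ℝ) ^ (-(2 * s)) * (n : ℝ) ^ 3) := by
    push_cast
    rw [Real.mul_rpow (by norm_num) hnpos.le]
    have h8 : (2 : ℝ) ^ (3 - 2 * s) ≤ 8 := by
      calc (2 : ℝ) ^ (3 - 2 * s) ≤ (2 : ℝ) ^ (3 : ℝ) :=
            Real.rpow_le_rpow_of_exponent_le (by norm_num) (by linarith)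
        _ = 8 := by norm_num
    have hn3 : (n : ℝ) ^ (3 - 2 * s) = (n : ℝ) ^ (-(2 * s)) * (n : ℝ) ^ 3 := by
      rw [← Real.rpow_natCast (n : ℝ) 3, ← Real.rpow_add hnpos]
      congr 1
      push_cast
      ring
    rw [hn3]
    exact mul_le_mul_of_nonneg_right h8 (by positivity)
  unfold FA2
  rw [div_le_iff₀ (pow_pos hc 2)]
  calc pairSum p n ≤ ((box 3 n).card : ℝ) * ∑ z ∈ box 3 (2 * n), tau 3 p 0 z :=
        pairSum_le_card_mul_sum_tau p n
    _ ≤ ((box 3 n).card : ℝ) * ((125 + 864 * C ^ 2) * ((2 * n : ℕ) : ℝ) ^ (3 - 2 * s)) :=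
        mul_le_mul_of_nonneg_left hsum hc.le
    _ ≤ ((box 3 n).card : ℝ) * ((125 + 864 * C ^ 2) * (8 * ((n : ℝ) ^ (-(2 * s)) * (n : ℝ) ^ 3))) :=
        mul_le_mul_of_nonneg_left (mul_le_mul_of_nonneg_left h2pow hK) hc.le
    _ = 8 * (125 + 864 * C ^ 2) * (n : ℝ) ^ (-(2 * s)) * ((n : ℝ) ^ 3 * ((box 3 n).card : ℝ)) := by
        ring
    _ ≤ 8 * (125 + 864 * C ^ 2) * (n : ℝ) ^ (-(2 * s)) *
          (((box 3 n).card : ℝ) * ((box 3 n).card : ℝ)) := by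
        have hpos : 0 ≤ 8 * (125 + 864 * C ^ 2) * (n : ℝ) ^ (-(2 * s)) := by positivity
        exact mul_le_mul_of_nonneg_left (mul_le_mul_of_nonneg_right hcard hc.le) hpos
    _ = 8 * (125 + 864 * C ^ 2) * (n : ℝ) ^ (-(2 * s)) * ((box 3 n).card : ℝ) ^ 2 := by ring

/-- Any positive one-arm exponent gives SOME power saving (with exponent `2 min(s, 1)`). -/
theorem powerSavingAt_of_oneArm (p : unitInterval) {C s : ℝ} (hs0 : 0 < s)
    (hC : ∀ m : ℕ, 1 ≤ m → oneArmProb 3 p m ≤ C * (m : ℝ) ^ (-s)) : PowerSavingAt p := by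
  have hs' : 0 < min s 1 := lt_min hs0 one_pos
  refine (powerSavingAt_iff p).2
    ⟨2 * min s 1, by linarith,
      powerSavingWith_of_oneArm p (C := max C 0) hs' (min_le_right _ _) fun m hm => ?_⟩
  have hm1 : (1 : ℝ) ≤ m := by exact_mod_cast hm
  calc oneArmProb 3 p m ≤ C * (m : ℝ) ^ (-s) := hC m hm
    _ ≤ max C 0 * (m : ℝ) ^ (-s) :=
        mul_le_mul_of_nonneg_right (le_max_left _ _) (Real.rpow_nonneg (by positivity) _)
    _ ≤ max C 0 * (m : ℝ) ^ (-min s 1) :=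
        mul_le_mul_of_nonneg_left
          (Real.rpow_le_rpow_of_exponent_le hm1 (neg_le_neg (min_le_left s 1))) (le_max_right _ _)

/-- Polynomial decay of the critical one-arm probability of `ℤ³` with SOME exponent
(believed: `s = β/ν ≈ 0.477`; OPEN — it contains `θ(p_c) = 0`). -/
def OneArmPowerDecay : Prop :=
  ∃ s C : ℝ, 0 < s ∧ ∀ m : ℕ, 1 ≤ m → oneArmProb 3 (criticalProbI 3) m ≤ C * (m : ℝ) ^ (-s)

/-- **`OneArmPowerDecay ⟹ FreeBoxPowerSaving`** (with `a = 2 min(s,1)`). -/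
theorem freeBoxPowerSaving_of_oneArmPowerDecay (h : OneArmPowerDecay) : FreeBoxPowerSaving := by
  obtain ⟨s, C, hs, hC⟩ := h
  exact freeBoxPowerSaving_iff.2 (powerSavingAt_of_oneArm _ hs hC)

/-- **What a refutation of the crux entails**: the critical one-arm probability of `ℤ³` decays
slower than every power, `∀ s > 0, ∀ C, ∃ m ≥ 1, π_{p_c}(m) > C m^{-s}`. -/
theorem forall_exists_oneArmProb_gt_of_not_freeBoxPowerSaving (h : ¬ FreeBoxPowerSaving) :
    ∀ s C : ℝ, 0 < s → ∃ m : ℕ, 1 ≤ m ∧ C * (m : ℝ) ^ (-s) < oneArmProb 3 (criticalProbI 3) m := by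
  intro s C hs
  by_contra hcon
  push Not at hcon
  exact h (freeBoxPowerSaving_of_oneArmPowerDecay ⟨s, C, hs, hcon⟩)

theorem not_oneArmPowerDecay_of_not_freeBoxPowerSaving (h : ¬ FreeBoxPowerSaving) :
    ¬ OneArmPowerDecay :=
  fun h' => h (freeBoxPowerSaving_of_oneArmPowerDecay h')

/-- **The classical one-arm floor at `p_c(ℤ³)`**: `π_{p_c}(m)² ≥ 1/(36 (4m+3)²)`.  The DCT sphere
bound `Σ_{z ∈ ∂Λ_{2m+1}} P_{p_c}(0 ↔ z in Λ_{2m+1}) ≥ 1/6` (tree, Kozma–Nachmias Lemma 3.1 form) has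
`|∂Λ_{2m+1}| ≤ 6 (4m+3)²` terms, each `≤ τ_{p_c}(0, z) ≤ π_{p_c}(m)²` by two disjoint boxes. -/
theorem oneArmProb_criticalProb_sq_ge (m : ℕ) :
    1 / (36 * (4 * (m : ℝ) + 3) ^ 2) ≤ oneArmProb 3 (criticalProbI 3) m ^ 2 := by
  set π : ℝ := oneArmProb 3 (criticalProbI 3) m with hπ
  have hsum := sum_sphere_real_openConnIn_ge (d := 3) (by norm_num) (criticalProbI 3) le_rfl (2 * m + 1)
  have hterm : ∀ z ∈ sphere 3 (2 * m + 1),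
      μc.real (openConnIn (↑(box 3 (2 * m + 1)) : Set (Site 3)) 0 z) ≤ π ^ 2 := by
    intro z hz
    have hk : Site.supNorm z = 2 * m + 1 := mem_sphere.1 hz
    obtain ⟨i, hi⟩ := Site.exists_natAbs_eq_supNorm Finset.univ_nonempty z
    have hvi : 2 * (m : ℤ) + 1 ≤ |z i| := by
      rw [← Int.natCast_natAbs, hi, hk]
      push_cast
      exact le_rfl
    exact (real_openConnIn_le_tau _ _ 0 z).trans (tau_le_oneArmProb_sq_of_coord m _ i hvi)
  have hcard : ((sphere 3 (2 * m + 1)).card : ℝ) ≤ 6 * (4 * (m : ℝ) + 3) ^ 2 := by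
    have h := card_sphere_succ_le (d := 3) (2 * m)
    norm_num at h
    calc ((sphere 3 (2 * m + 1)).card : ℝ) ≤ 6 * (2 * (2 * (m : ℝ)) + 3) ^ 2 := by linarith
      _ = 6 * (4 * (m : ℝ) + 3) ^ 2 := by ring
  have h6 : 1 / 6 ≤ ((sphere 3 (2 * m + 1)).card : ℝ) * π ^ 2 := by
    have h1 : (1 : ℝ) / (2 * (3 : ℕ)) = 1 / 6 := by norm_num
    rw [← h1]
    calc _ ≤ _ := hsum
      _ ≤ ∑ _z ∈ sphere 3 (2 * m + 1), π ^ 2 := Finset.sum_le_sum hterm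
      _ = _ := by rw [Finset.sum_const, nsmul_eq_mul]
  have hπ2 : 0 ≤ π ^ 2 := sq_nonneg π
  have hpos : (0 : ℝ) < 36 * (4 * (m : ℝ) + 3) ^ 2 := by positivity
  rw [div_le_iff₀ hpos]
  nlinarith

/-- Hence `π_{p_c}(m) ≥ 1/(6(4m+3))` (`≥ 1/(42 m)` for `m ≥ 1`): the classical `m^{-(d-1)/2}` floor at `d = 3`. -/
theorem oneArmProb_criticalProb_ge (m : ℕ) :
    1 / (6 * (4 * (m : ℝ) + 3)) ≤ oneArmProb 3 (criticalProbI 3) m := by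
  have h := oneArmProb_criticalProb_sq_ge m
  have hπ0 : 0 ≤ oneArmProb 3 (criticalProbI 3) m := measureReal_nonneg
  have hsq : (1 / (6 * (4 * (m : ℝ) + 3))) ^ 2 ≤ oneArmProb 3 (criticalProbI 3) m ^ 2 := by
    calc (1 / (6 * (4 * (m : ℝ) + 3))) ^ 2 = 1 / (36 * (4 * (m : ℝ) + 3) ^ 2) := by
          rw [div_pow, one_pow, mul_pow]; norm_num
      _ ≤ _ := h
  exact (pow_le_pow_iff_left₀ (by positivity) hπ0 two_ne_zero).1 hsq

/-- **Tightness of the one-arm exponent at `p_c`**: a bound `π_{p_c}(m) ≤ C m^{-s}` (`m ≥ 1`) has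
`s ≤ 1`; so the one-arm route `powerSavingWith_of_oneArm` can never beat §5's ceiling `a ≤ 2`. -/
theorem oneArm_exponent_le_one {C s : ℝ}
    (hC : ∀ m : ℕ, 1 ≤ m → oneArmProb 3 (criticalProbI 3) m ≤ C * (m : ℝ) ^ (-s)) : s ≤ 1 := by
  by_contra hs
  push Not at hs
  have hs1 : 0 < s - 1 := by linarith
  have hev : ∀ᶠ m : ℕ in atTop, 42 * C < (m : ℝ) ^ (s - 1) :=
    ((tendsto_rpow_atTop hs1).comp tendsto_natCast_atTop_atTop).eventually_gt_atTop _
  obtain ⟨m, hmC, hm1⟩ := (hev.and (eventually_ge_atTop 1)).exists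
  have hmpos : (0 : ℝ) < m := by exact_mod_cast hm1
  have hm1' : (1 : ℝ) ≤ m := by exact_mod_cast hm1
  have hlow : 1 / (42 * (m : ℝ)) ≤ oneArmProb 3 (criticalProbI 3) m := by
    refine le_trans ?_ (oneArmProb_criticalProb_ge m)
    exact one_div_le_one_div_of_le (by positivity) (by nlinarith)
  have key : 1 / (42 * (m : ℝ)) ≤ C * (m : ℝ) ^ (-s) := hlow.trans (hC m hm1)
  have hms : 0 < (m : ℝ) ^ s := Real.rpow_pos_of_pos hmpos s
  rw [Real.rpow_neg hmpos.le, ← div_eq_mul_inv, le_div_iff₀ hms] at key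
  have h2 : (m : ℝ) ^ (s - 1) = 42 * (1 / (42 * (m : ℝ)) * (m : ℝ) ^ s) := by
    rw [Real.rpow_sub hmpos, Real.rpow_one]
    field_simp
  rw [h2] at hmC
  linarith

/-- In particular `OneArmPowerDecay` can only hold with `s ≤ 1`, and the exponent it hands to the
crux is `2 min(s,1) ≤ 2`. -/
theorem oneArmPowerDecay_exponent_le_one {s C : ℝ} (_hs : 0 < s)
    (hC : ∀ m : ℕ, 1 ≤ m → oneArmProb 3 (criticalProbI 3) m ≤ C * (m : ℝ) ^ (-s)) :
    2 * s ≤ 2 := by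
  have := oneArm_exponent_le_one hC
  linarith

end OneArm

/-! ## §9 (cycle 2) Audit of the round-1 ideator stubs; two more refuted strengthenings

PRE-LINE AUDIT (the three sketches in `Cruxes/FreeBoxPowerSaving/`; 20 min each, on paper — every
implication was re-derived, every `Prop` probed at `n = 0`, `m = 0/1`, `k = 0`, `p ∈ {0, 1}`,
`C ≤ 0`, `ρ ≤ 0`).  NO STUB IS CHEAPLY FALSE.  Notes for the triage panel / lead:
* `SketchIdeator1` — `BKSizeMultiplicativity` (Hutchcroft 2021 Thm 2.3 on the free box): the exponent
  `3^{k-1}+1` is exactly what the greedy edge-disjoint subtree decomposition yields for `k ≥ 2`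
  (pieces of `≤ 2⌈λ⌉ - 2` vertices sharing cut vertices; `k = 1` is the two-subtree lemma); fine to
  vendor.  `FirstLemma1` (log-boost: `3^{k-1} ≈ (9/ε) log n`), `FirstLemma1_converse` (Markov on
  `(E|K_max|)² ≤ |Λ|² FA₂`), `FirstLemma2` (`{C_Λ(x) ∩ ∂ⁱⁿΛ = ∅} ⟹ C_Λ(x) = C(x) ⊆ x + Λ_{2n}` a.e.),
  `FirstLemma3` (first moment over `≤ 27 n^a` interior fat candidates) are all VALID reductions.
  Trivial tightness: `¬ FatFiniteClusterBound a` for `a > 3` (`y = 0` term `≥ P(C(0) = {0}) > 0`);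
  nothing rigorous below `3` (a lower bound on `E[|C|; C ⊆ Λ_{2n}]` needs an UPPER bound on the
  one-arm, i.e. `θ(p_c) = 0` quantitatively).
* `Sketch-ideator2` — `CCSmoothingFA2` is TRUE (`|d/dp √P_p(A)| ≤ ½ √(|E(B(n))|/(p(1-p)))`, Russo as a
  covariance + Cauchy–Schwarz) and `FreeLeBulkSusceptibility` is §7 here; `FirstLemmaB` /
  `GammaTransferExplicit` arithmetic checked (`δ = n^{-6/(2+γ)}`, exponent `3(2-γ)/(2+γ)`; note
  `γ ≥ 0` is forced by `χ ≥ 1`, so `2 + γ > 0`); the whole weight is on `GammaBelowTwo` (OPEN; in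
  `d = 3` not even a polynomial bound `χ(p_c - δ) ≤ δ^{-M}` is known).  `ExitTimeIdentity` is
  discrete Green's second identity (valid as stated), `ExitTimeBound` is the slab comparison (valid);
  JUNK: `DefectMassSaving 0` is TRIVIALLY TRUE (`tauBox R y ^ 0 = 1` for every `y`, also off the box,
  so `negLap ≡ 0`) — harmless only because `FirstLemmaA` keeps `1 ≤ k`; any re-statement with `∃ k`
  must keep that guard.  `DefectMassSaving k` for `k ≥ 1` is OPEN and genuinely `k`-dependent
  (`k = 1`: bulk defect `≍ Σ_{|z|≤R} |z|^{-(3+η)} ≍ R^{-η} = R^{0.05}`, since `τ ≍ |z|^{-(1+η)}` with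
  `1 + η < 1 = d - 2` is SUPERharmonic in the bulk; `k = 3`: bulk-subharmonic, defect at the core and
  in the boundary layer only — the boundary layer is the unquantified risk).
  `TwoReplicaIntersectionForm` ⟺ crux: both directions are §6 here + Cauchy–Schwarz (valid).
* `Sketch-ideator3` — `BlockIdentity`, `ContractionImpliesCrux` (interpolation cost `729`),
  `LargestPieceSqrtTrick` (BK with two edge-disjoint open subtrees as witnesses), `MedianFatForm`
  (`C ≤ 0` is excluded automatically: `fatProb n 0 = 1 > 1/2`) are VALID.  `GlueBlockCriterion` is
  TRUE (if `P_{p_c}(GlueAll(n,m)) > 1 - ε_LSS` then by continuity of this LOCAL (non-monotone, which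
  does not matter) event the same holds at some `p < p_c`, and 26-dependent block percolation of the
  `(2n+1)ℤ³`-indexed overlapping big boxes gives an infinite cluster below `p_c`); JUNK: for `m ≤ 1`,
  `GlueAll n m` is "the whole of `B(3n+1)` is internally connected" (probability `→ 0` super-fast),
  for `m > |B(n)|` it is `∅`.  `StallForcesGlue` (the hard stub) cannot be refuted without deciding
  the crux: `¬crux ⟹` stalls `FA₂(3n+1) ≥ ρ FA₂(n)` at EVERY `ρ < 1` i.o. (contrapositive of
  `ContractionImpliesCrux`), while under the crux it may hold VACUOUSLY (no stalls: numerically the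
  ratio is `0.28–0.36 ≈ 3^{-0.954}` for `s = 9…63`, j009424, and `P(all 27 champions glued) = 0/756`).
  So `StallForcesGlue` is unprovable-by-design unless the equality-case stability is shown directly;
  a cheaper target for the lead is its `ε₀ = ε_LSS` instance only.  Card B (`FreeBoxRusso`,
  `InBoxVolumeTwoGhost y`, `SubcriticalBoxSparsity b a`): `y ≤ 1/2` plausible-true uniformly in `p`,
  `y > 0.62` open; `SubcriticalBoxSparsity b a` is open for EVERY `b > 0` (same missing polynomial
  subcritical bounds as `GammaBelowTwo`).

TWO MORE REFUTED STRENGTHENINGS / NORMAL FORMS (formal, below): uniformity above `p_c` is false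
(`not_powerSaving_uniform_above`, from §2), and the sandwich `OneArmPowerDecay ⟹ crux ⟹ FreeBoxSparse`
(`sandwich`; with `Theorems/FreeBoxSparse/Negative/OfContinuity.lean`'s `θ(p_c) = 0 ⟹ FreeBoxSparse`
this places the crux strictly between rate-free continuity consequences and polynomial one-arm decay).
-/

section Audit

/-- The "for all `p ≥ p_c`" strengthening is FALSE (already at `p = 1`, §2). -/
theorem not_powerSaving_uniform_above :
    ¬ ∀ p : unitInterval, criticalProbI 3 ≤ p → PowerSavingAt p :=
  fun h => not_powerSavingAt_one (h 1 (unitInterval.le_one _))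

/-- **Sandwich**: `OneArmPowerDecay ⟹ FreeBoxPowerSaving ⟹ FreeBoxSparse`. -/
theorem sandwich :
    (OneArmPowerDecay → FreeBoxPowerSaving) ∧ (FreeBoxPowerSaving → FreeBoxSparse) :=
  ⟨freeBoxPowerSaving_of_oneArmPowerDecay, freeBoxSparse_of_freeBoxPowerSaving⟩

end Audit

/-! ## §10 (cycle 2) The crux is the WEAKEST quantitative-decay statement of the cone

Cross-route bridges (landed as `Theorems/FreeBoxPowerSaving/Negative/FreeBoxPowerSavingFromBallDecay.lean`,
which also proves `CritPointwiseDecay ⟹ X_A` by shell summation):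
`PercTwoPointDecay.CritPointwiseDecay` (stmt-0836, `τ_{p_c}(0,x) ≤ C‖x‖^{-a}`)
⟹ `PercTwoPointDecay.CritBallAverageDecay` (= `X_A`, stmt-0833, `Σ_{B(R)} τ_{p_c} ≤ C R^{3-a}`)
⟹ `FreeBoxPowerSaving` (free `≤` bulk termwise + §6) ⟹ `FreeBoxSparse`; and `OneArmPowerDecay` ⟹
all of them (§8).  So a refutation of 4447 would refute 0833, 0836 and polynomial one-arm decay in
one stroke — it is the weakest quantitative critical-decay statement around, and resists disproof
exactly as much as `θ(p_c) = 0` resists proof.  RANGE AXIS (literature, cycle 2): for LONG-RANGE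
percolation on `ℤ^d` with `J(x) ≍ ‖x‖^{-d-α}`, `α < d`, the `X_A`-shape bound is a THEOREM (Hutchcroft,
PTRF 181 (2021) = arXiv:2008.11197, Thm 1.1, second display: `|Λ_r|⁻¹ Σ_{Λ_r} P_{β}(0 ↔ x) ≤
C r^{-2(d-α)/(3d)}` for all `β ≤ β_c`), hence the crux-analogue HOLDS there (any `d`, e.g. `ℤ³` with
`α < 3`), while at `d = α = 1` it FAILS (Aizenman–Newman 1986 discontinuity, catalogued barrier
`LongRangeDiscontinuity`).  Nearest-neighbour `ℤ³` (`α = ∞`) is the open middle; Hutchcroft p. 3: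
"the corresponding statement for nearest-neighbour percolation with `d ≥ 2` is of course a notorious
open problem".
-/

section Cone

open Summit.CriticalPhenomena.PercolationContinuityZ3.Theses.PercTwoPointDecay (CritBallAverageDecay)

/-- **`X_A ⟹ the crux`** (exponent `a`): `Σ_{x∈B(R)} P(0 ↔ x in B(R)) ≤ Σ_{x∈B(R)} τ(0,x) ≤ C R^{3-a}`
is `CentreRootedBound (3 - a)`, and §6 applies. -/
theorem freeBoxPowerSaving_of_critBallAverageDecay (h : CritBallAverageDecay) : FreeBoxPowerSaving := by
  obtain ⟨a, C, ha, hC⟩ := h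
  refine freeBoxPowerSaving_iff_centreRooted.2 ⟨3 - a, by linarith, C, fun R hR => ?_⟩
  calc ∑ y ∈ box 3 R, μc.real (openConnIn (↑(box 3 R) : Set (Site 3)) 0 y)
      ≤ ∑ y ∈ box 3 R, μc.real (openConn 0 y) :=
        Finset.sum_le_sum fun y _ => (real_openConnIn_le_tau (criticalProbI 3) _ 0 y).trans_eq
          (tau_def _ 0 y)
    _ ≤ C * (R : ℝ) ^ (3 - a) := hC R hR

/-- Contrapositive: refuting the crux refutes `X_A` (stmt-CriticalPhenomena-0833). -/
theorem not_critBallAverageDecay_of_not_freeBoxPowerSaving (h : ¬ FreeBoxPowerSaving) :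
    ¬ CritBallAverageDecay :=
  fun h' => h (freeBoxPowerSaving_of_critBallAverageDecay h')

/-- The cone chain in one line: `OneArmPowerDecay ∨ X_A ⟹ crux ⟹ FreeBoxSparse`. -/
theorem cone_chain :
    (OneArmPowerDecay ∨ CritBallAverageDecay → FreeBoxPowerSaving) ∧ (FreeBoxPowerSaving → FreeBoxSparse) :=
  ⟨fun h => h.elim freeBoxPowerSaving_of_oneArmPowerDecay freeBoxPowerSaving_of_critBallAverageDecay,
    freeBoxSparse_of_freeBoxPowerSaving⟩

end Cone

/-! ## §11 (cycle 3) TARGETS — the registered skeleton `Lines/tightness-collapse-typical-kmax.lean`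

Skeleton `c888e645…` (planner `…cruxplan-…-tightness-collapse-t-0`, 2026-08-16T02:42Z; lead not yet
seated, `targets = []` in this seat's payload, so the four registered stubs are attacked pre-emptively).
Vocabulary as in the skeleton: `#C_m(u)` = `((box 3 m).filter fun v => ω ∈ openConnIn ↑(box 3 m) u v).card`,
`QG(n,s) = {∃ u ∈ B(n), #C_n(u) ≥ s}` (`quasiGiant n s` below, VERBATIM the stub text),
`Glued(n,s)`, `Foam(n,s)` as in the stub texts.  PER-STUB VERDICTS (40 min each, paper + Lean):

* `stub_sizeSplitting` (`P_p(QG(n,3s)) ≤ P_p(QG(n,s))²`, real `s ≥ 1`, every `p, n`) — TRUE, provable as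
  filed.  Re-derived: a piece with `≥ 3s` vertices has a spanning tree with `k ≥ ⌈3s⌉ - 1` open edges
  inside `B(n)`; at an edge-centroid vertex every branch has `≤ (k+1)/2` edges, and the greedy 2-partition
  of the branches gives two EDGE-disjoint subtrees with `≥ k/3` edges each (`k ≥ 3`; `k ≤ 2` only for
  `s = 1`, trivial), i.e. `≥ ⌈k/3⌉ + 1 ≥ s + 2/3` vertices each — two disjoint witnesses of the increasing
  finitary event `QG(n,s)`, so BK applies.  GUARD `1 ≤ s` is NOT load-bearing: for `s ≤ 1` the right side
  is `1` (`sizeSplitting_of_le_one`, `quasiGiant_eq_univ_of_le_one`), so the guard-free version is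
  equivalent.  `n = 0`, `p ∈ {0,1}`: fine.  Strengthening "factor 2 for 3": the tree splitting fails
  combinatorially from `s = 5` on (three legs of 3 edges at a centre: no two edge-disjoint subtrees with
  `≥ 5` vertices each), but no probabilistic counterexample exists cheaply (`p → 0`:
  `P(QG(2s)) ≍ |B| p^{2s-1} ≪ (|B| p^{s-1})²`); irrelevant to the line.
* `stub_logBoost` (splitting + "`P_p(QG(n,n^{3-a})) ≤ 1-ε` eventually" ⟹ eventual power saving; every `p`)
  — TRUE, provable as filed (iteration `P(QG(n,3^k t)) ≤ P(QG(n,t))^{2^k}` at FIXED `n`, first moment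
  `FA₂(n) ≤ t/|B(n)| + P(QG(n,t))`, `2^k ≍ (9/ε) log n`).  Junk: for `a ≥ 3` (`logBoost_hypothesis_false_of_three_le`)
  or `ε ≥ 1` the second hypothesis is unsatisfiable (vacuous truth); `3^j n^{3-a} ≥ 1` needs `a ≤ 3`,
  exactly the satisfiable range.  CONVERSE proved here: crux ⟹ the second hypothesis at `p_c`
  (`quasiGiantNotAS_of_freeBoxPowerSaving`, any `ε < 1`, `a = a₀/4`; indeed `P → 0`,
  `quasiGiant_tendsto_zero_of_freeBoxPowerSaving`) — so modulo stubs 1–2 the crux IS "QG-NAS".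
* `stub_gluingCriterion` (absolute `ε₀`; every `p`, `n ≥ 1`, real `s`: `P_p(QG ∩ Glued) > 1 - ε₀ ⟹ θ(p) > 0`)
  — TRUE, provable (L).  Checked: chaining geometry `n•z + B(n) ⊆ n•z' + B(2n)` for lattice neighbours
  `z ∼ z'` (so the fat inner piece of `z` is fat in the outer box of `z'` and `Glued` at `z'` joins them);
  dependence range: the block event lives on the pairs inside `n•z + B(2n)`, blocks at sup-distance `4`
  still SHARE the face pairs `{x_i = 2n}` (so "4-dependent" must mean independence only from distance
  `5` on — it does in the skeleton); Peierls in a coordinate plane for finitely dependent bad blocks;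
  `θ(p) > 0` from an infinite chain by a union bound over `B(n)`.  Junk `s ≤ 1`: `Glued` = "all of
  `B(2n)` is joined inside `B(2n)` to `B(n)`", chaining still valid, and the hypothesis then holds only
  near `p = 1` where `θ > 0`; `s > |B(n)|`: hypothesis empty.  GUARD `1 ≤ n` IS load-bearing
  (`gluingCriterion_false_without_guard`: at `n = 0`, `s = 0`, `p = 0` the good event is sure and
  `θ(0) = 0`).  `ε₀` is existential, so the junk maximum `sup_{p ≤ p_c, n ≥ 1, s} P_p(QG ∩ Glued) < 1`
  (e.g. `s ≤ 1`, `n = 1`: `≤ 1 - (1 - p_c)³`, a corner of `B(2)` isolated) costs nothing.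
* `stub_noCriticalFoam` (`∀ η > 0 ∃ a > 0`, eventually `P_{p_c}(Foam(n, n^{3-a})) ≤ η`) — OPEN and
  crux-EQUIVALENT modulo stubs 1–3: `noCriticalFoam_of_freeBoxPowerSaving` below (crux with exponent `a₀`
  ⟹ the stub VERBATIM with `a = a₀/4`, via `Foam ⊆ QG(n, n^{3-a})` and the second-moment Markov bound
  `measureReal_quasiGiant_le`: `P(QG(n,t)) ≤ S_{p_c}(n)/t² ≤ 729 C n^{6-a₀}/t²`), and the skeleton's
  sorry-free `FreeBoxPowerSaving_of` (stub + 1–3 ⟹ crux).  So NO refutation of the stub short of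
  refuting the crux; the planner's "transfer lossless" claim is now kernel-checked in both directions.
  STRUCTURE (`foam_iff_two_fat_outer`): `Foam(n,s) = QG(n,s) ∩ {B(2n) carries two pieces with ≥ s
  vertices not joined inside B(2n)}` — the stub is precisely NON-PROLIFERATION OF FAT PIECES with
  `M = 1` at aspect ratio 2, conditionally on a fat inner piece: the volume cousin of r2
  `NonProliferation` (4444: boundedly many SPANNING pieces, positive probability, frequently) and of
  `CritBoxTwoArmsDecay` (0859, two distinct crossing clusters).  CONSEQUENCE FOR PROVERS: in the orthodox
  picture the stub holds VACUOUSLY (no piece reaches `n^{3-a}` for `a < 3 - d_f ≈ 0.48`), while at the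
  pieces' OWN scale `s ≍ n^{d_f}` critical pieces are EXPECTED to proliferate (scale invariance below
  the upper critical dimension: `B(2n)` should carry several pieces comparable to the largest with
  probability bounded away from `0`, cf. the sibling MC j009424 "P(all 27 champions glued) = 0/756";
  CONFIRMED by MC kit j011440, §11.6: `P(largest inner piece not inside the largest outer piece) ≈ 0.42`
  flat over `n = 4…64`, and given a piece `≥ s` in `B(n)` there are `≈ 4–12` pieces `≥ s` in `B(2n)`, so
  `P(Foam) = P(QG)` within `0.01`); hence NO proof of the stub can be a pure local-uniqueness/gluing
  argument insensitive to the threshold — it must convert FATNESS (`≥ n^{3-a}`, polynomially above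
  `n^{d_f}`) into FEWNESS, which is the hyperscaling content of the crux itself.  Junk: `a ≥ 3` makes the event "some pair `u ∈ B(n)`,
  `u' ∈ B(2n)` unjoined" (probability `≥ (1-p_c)^3`, an isolated corner), so witnesses have `a < 3`;
  `n ∈ {0,1}` excluded by `∀ᶠ`; `p = 1` analogue: event empty (true) — consistent with §2 (`p = p_c`
  load-bearing elsewhere: in `good_le_of_criterion`).
* Archived sibling skeleton `Lines/boundary-interior-split-fat-finite-clusters.lean` (stubs expired
  02:42Z but re-registrable): `stub_boundaryInteriorSplit` TRUE (split + two Markovs, every `p`);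
  `stub_fatFiniteClusters` OPEN, implied by the crux (§11.5 `fatFiniteClusters_of_freeBoxPowerSaving`,
  VERBATIM: confinement `{0 ↔ y} ∩ {C(0) ⊆ B(2n)} ⊆ {0 ↔ y in B(2n)}` + §6);
  `stub_boundaryQuasiGiantsNotAS` crux-hard (all jump content) and crux-necessary
  (§11.5 `boundaryQuasiGiantsNotAS_of_freeBoxPowerSaving`, VERBATIM, `ε = 1/2`); cycle-2 §9 audit
  stands, nothing cheaply false.  So EVERY open stub of both lines is sandwiched: crux ⟹ stub, and
  stub (+ provable stubs) ⟹ crux.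
-/


/-! ### §11.6 (cycle 3) NUMERICS — foam statistics at `p_c` (kit j011440, this seat)

Bond percolation on `B(2n) ⊂ ℤ³` at `p = 0.2488118`, pieces of the open graphs INDUCED on `B(n)` ("inner",
bonds inside `B(n)` only) and on `B(2n)` ("outer"); `n = 4 … 64`, `m` samples; `K_in ≥ K_in,2` the two
largest inner pieces, `K_out ≥ K_out,2` outer; "glued" = the largest inner piece lies in the largest outer
piece (`u ↔ u'` in `B(2n)`); thresholds `s = n^{3-a}`; `QG = {K_in ≥ s}`, `N_out(s)` = number of outer
pieces with `≥ s` vertices, `Foam = QG ∩ {N_out ≥ 2}` (§11.3), `Good = QG ∩ Glued = QG ∩ {N_out = 1}`.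
Artifacts `~/compute/j011440/outputs/{summary.json, raw_n*.npz}`, evidence `compute-j011440.json`.

  n   m     K_in/n^2.523  K_in,2/K_in  K_out,2/K_out  P(glued)      a = 0.477: P(QG) P(Foam) P(Good) E N_out   a = 0.25: P(QG) P(Foam) P(Good) E N_out
  4   4000  2.93          0.58         0.57           0.579±0.008   0.987 0.987 0.000 14.8                   0.923 0.923 0.000 10.3
  8   4000  2.42          0.57         0.57           0.565±0.008   0.963 0.963 0.000 13.0                   0.721 0.720 0.001  7.4
  16  1600  2.25          0.55         0.56           0.573±0.012   0.925 0.925 0.000 12.1                   0.552 0.546 0.006  5.7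
  24  800   2.08          0.58         0.56           0.604±0.017   0.909 0.909 0.000 11.8                   0.391 0.380 0.011  5.0
  32  480   2.21          0.53         0.56           0.569±0.023   0.917 0.917 0.000 11.5                   0.406 0.400 0.006  4.5
  48  144   2.13          0.53         0.56           0.632±0.040   0.931 0.931 0.000 11.6                   0.299 0.285 0.014  4.0
  64  40    2.36          0.53         0.52           0.550±0.079   0.900 0.900 0.000 10.9                   0.375 0.325 0.050  3.5
  (a = 0.40: P(QG) = 0.98, 0.91, 0.83, 0.76, 0.78, 0.72, 0.78;  a ≥ 0.65: P(QG) = 1.000 at every n.)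

FINDINGS.  (N1) SCALE INVARIANCE, NO FAT PIECES: `K_max^free(B(n)) ≈ 2.2 n^{2.52}` (`d_f = 2.523`;
`K_max/|B(n)| ≈ 0.3 n^{-0.48} → 0`), second/largest `≈ 0.55` inner and outer, and `P(glued) ≈ 0.58 ± 0.03`
FLAT over `n = 4 … 64`: the champions of consecutive scales are NOT joined inside `B(2n)` with probability
`≈ 0.42` at every scale — local uniqueness of the largest pieces fails at criticality with constant
probability (a critical foam AT THE NATURAL SCALE `n^{d_f}`, harmless for the stub only because these
pieces are not fat).  (N2) `P(QG ∩ Glued) ≈ 0` AT EVERY THRESHOLD (`≤ 0.014` for `n ≥ 8`, the 40-sample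
point `n = 64` gives `0.05`): whenever SOME piece of `B(n)` has `≥ s` vertices, `B(2n)` carries MANY pieces
with `≥ s` vertices (`E N_out ≈ 11` at `s ≈ K_in/2`, `≈ 4` at `s = n^{2.75}`), so `P(Foam(n,s)) = P(QG(n,s))`
to within `0.01`.  CONSEQUENCES FOR THE LINE: (i) the proved bound `P_{p_c}(QG ∩ Glued) ≤ 1 - ε₀`
(`good_le_of_criterion`) holds with room `≈ 0.99` — in the world we see it carries no information;
(ii) `stub_noCriticalFoam` at level `η` is numerically IDENTICAL to "`P_{p_c}(QG(n, n^{3-a})) ≤ η`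
eventually", i.e. to the direct quasi-giant bound with the SMALL η on the right — much STRONGER than the
`QG-NAS(a, ε)` ("`≤ 1 - ε` for some `ε > 0`") that `stub_logBoost` consumes: the decomposition
`QG ⊆ (QG ∩ Glued) ∪ Foam` converts "probability `≤ 1 - ε` for SOME `ε`" into "probability `≤ ε₀/2` for the
tiny Peierls constant `ε₀` of `stub_gluingCriterion`"; (iii) the DIRECT one-bit statement is visibly true
with margin: `P_{p_c}(QG(n, n^{3-a})) ≈ 0.90–0.93` flat in `n` for `a = 0.477` (threshold `≈ K_in/2`),
`0.72–0.78` for `a = 0.40`, `0.30–0.41` slowly decreasing for `a = 0.25` — so `QG-NAS(a ≈ 0.45, ε ≈ 0.05)`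
("with probability `≥ 5%` no free-box piece exceeds `n^{2.55}`") holds numerically and feeds the log boost
(crux exponent `a' = a/2 ≈ 0.22`), whereas the foam route needs `P(QG(n, n^{3-a})) ≤ ε₀/2 ≪ 1`, a far
deeper tail.  ADVICE TO THE LEAD: the criterion + foam form pays off only in the JUMP branch (monolithic
free-box giants, which it excludes at `p_c`); the numerics exclude that branch; in the orthodox branch the
cheapest target is the one-bit tightness `QG-NAS` itself (or `P(QG(n,n^{3-a})) → 0` = stub 4
numerically), and any proof of stub 4 is a proof that fat pieces are rare — not a gluing argument.
(N3) For the DISPROOF: nothing moves with `n` except finite-size drift of `K_in/n^{d_f}` (`2.9 → 2.1–2.4`);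
no sign of pieces `∝ n³`, `FA₂ ≍ n^{2 d_f - 6} = n^{-0.95}`, consistent with cycle 2's j009424 and the
prediction `a = 1 + η = 0.954`; the crux looks TRUE with `a ≈ 0.95`, and its one-bit surrogate with
`a ≈ 0.45–0.5` is what the registered skeleton can actually deliver.
-/

section Targets

open scoped Classical

/-! ### §11.1 The quasi-giant event and the second-moment Markov bound -/

/-- `QG(n, t)`: some `u ∈ B(n)` is joined inside `B(n)` to at least `t` vertices of `B(n)` (the
registered stubs' quasi-giant event, verbatim). -/
def quasiGiant (n : ℕ) (t : ℝ) : Set (BondConfig (Site 3)) :=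
  {ω | ∃ u ∈ box 3 n, t ≤ (((box 3 n).filter fun v => ω ∈ openConnIn ↑(box 3 n) u v).card : ℝ)}

/-- Symmetry of `{x ↔ y in S}` (membership form). -/
theorem openConnIn_symm_mem {S : Set (Site 3)} {x y : Site 3} {ω : BondConfig (Site 3)}
    (h : ω ∈ openConnIn S x y) : ω ∈ openConnIn S y x := by
  obtain ⟨hx, hy, hr⟩ := h
  exact ⟨hy, hx, hr.symm⟩

/-- **A piece with `≥ t` vertices gives `≥ t²` ordered joined pairs**: on `QG(n, t)` (`t ≥ 0`),
`t² ≤ Σ_{x,y ∈ B(n)} 1{x ↔ y in B(n)}`. -/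
theorem sq_le_sum_indicator {n : ℕ} {t : ℝ} (ht : 0 ≤ t) {ω : BondConfig (Site 3)}
    (hω : ω ∈ quasiGiant n t) :
    t ^ 2 ≤ ∑ x ∈ box 3 n, ∑ y ∈ box 3 n,
      (openConnIn (↑(box 3 n) : Set (Site 3)) x y).indicator (fun _ => (1 : ℝ)) ω := by
  obtain ⟨u, -, htu⟩ := hω
  set P : Finset (Site 3) := (box 3 n).filter fun v => ω ∈ openConnIn ↑(box 3 n) u v
  have hPsub : P ⊆ box 3 n := Finset.filter_subset _ _
  have hconn : ∀ v ∈ P, ω ∈ openConnIn (↑(box 3 n) : Set (Site 3)) u v := fun v hv =>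
    (Finset.mem_filter.1 hv).2
  have hone : ∀ x ∈ P, ∀ y ∈ P,
      (openConnIn (↑(box 3 n) : Set (Site 3)) x y).indicator (fun _ => (1 : ℝ)) ω = 1 := by
    intro x hx y hy
    have hxy : ω ∈ openConnIn (↑(box 3 n) : Set (Site 3)) x y :=
      GM.openConnIn_trans (openConnIn_symm_mem (hconn x hx)) (hconn y hy)
    rw [Set.indicator_of_mem hxy]
  have hnn : ∀ x y, 0 ≤ (openConnIn (↑(box 3 n) : Set (Site 3)) x y).indicator (fun _ => (1 : ℝ)) ω :=
    fun x y => Set.indicator_nonneg (fun _ _ => zero_le_one) _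
  calc t ^ 2 ≤ ((P.card : ℝ)) ^ 2 := pow_le_pow_left₀ ht htu 2
    _ = ∑ _x ∈ P, ∑ _y ∈ P, (1 : ℝ) := by
        simp only [Finset.sum_const, nsmul_eq_mul, mul_one, sq]
    _ = ∑ x ∈ P, ∑ y ∈ P, (openConnIn (↑(box 3 n) : Set (Site 3)) x y).indicator (fun _ => (1 : ℝ)) ω :=
        Finset.sum_congr rfl fun x hx => Finset.sum_congr rfl fun y hy => (hone x hx y hy).symm
    _ ≤ ∑ x ∈ P, ∑ y ∈ box 3 n, (openConnIn (↑(box 3 n) : Set (Site 3)) x y).indicator (fun _ => (1 : ℝ)) ω :=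
        Finset.sum_le_sum fun x _ =>
          Finset.sum_le_sum_of_subset_of_nonneg hPsub fun y _ _ => hnn x y
    _ ≤ ∑ x ∈ box 3 n, ∑ y ∈ box 3 n, (openConnIn (↑(box 3 n) : Set (Site 3)) x y).indicator (fun _ => (1 : ℝ)) ω :=
        Finset.sum_le_sum_of_subset_of_nonneg hPsub fun x _ _ => Finset.sum_nonneg fun y _ => hnn x y

/-- **Second-moment Markov bound**: `P_p(QG(n, t)) ≤ S_p(n) / t²` for `t > 0`, where
`S_p(n) = Σ_{x,y ∈ B(n)} P_p(x ↔ y in B(n)) = pairSum p n`. -/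
theorem measureReal_quasiGiant_le (p : unitInterval) (n : ℕ) {t : ℝ} (ht : 0 < t) :
    (bondPercolation (zdGraph 3) p).real (quasiGiant n t) ≤ pairSum p n / t ^ 2 := by
  set μ := bondPercolation (zdGraph 3) p with hμ
  have hmeas : ∀ x y : Site 3, MeasurableSet (openConnIn (↑(box 3 n) : Set (Site 3)) x y) :=
    fun x y => DCT16.measurableSet_openConnIn (box 3 n) x y
  have hint1 : ∀ x y : Site 3,
      Integrable (fun ω => (openConnIn (↑(box 3 n) : Set (Site 3)) x y).indicator (fun _ => (1 : ℝ)) ω) μ :=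
    fun x y => (integrable_const (1 : ℝ)).indicator (hmeas x y)
  have hint2 : ∀ x : Site 3, Integrable (fun ω => ∑ y ∈ box 3 n,
      (openConnIn (↑(box 3 n) : Set (Site 3)) x y).indicator (fun _ => (1 : ℝ)) ω) μ :=
    fun x => integrable_finsetSum _ fun y _ => hint1 x y
  have hN_int : Integrable (fun ω => ∑ x ∈ box 3 n, ∑ y ∈ box 3 n,
      (openConnIn (↑(box 3 n) : Set (Site 3)) x y).indicator (fun _ => (1 : ℝ)) ω) μ :=
    integrable_finsetSum _ fun x _ => hint2 x
  have hN_nonneg : 0 ≤ᵐ[μ] fun ω => ∑ x ∈ box 3 n, ∑ y ∈ box 3 n,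
      (openConnIn (↑(box 3 n) : Set (Site 3)) x y).indicator (fun _ => (1 : ℝ)) ω :=
    ae_of_all _ fun ω => Finset.sum_nonneg fun x _ => Finset.sum_nonneg fun y _ =>
      Set.indicator_nonneg (fun _ _ => zero_le_one) _
  have hN_integral : ∫ ω, (∑ x ∈ box 3 n, ∑ y ∈ box 3 n,
      (openConnIn (↑(box 3 n) : Set (Site 3)) x y).indicator (fun _ => (1 : ℝ)) ω) ∂μ = pairSum p n := by
    rw [integral_finsetSum _ fun x _ => hint2 x]
    unfold pairSum
    refine Finset.sum_congr rfl fun x _ => ?_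
    rw [integral_finsetSum _ fun y _ => hint1 x y]
    refine Finset.sum_congr rfl fun y _ => ?_
    rw [integral_indicator_const (1 : ℝ) (hmeas x y), smul_eq_mul, mul_one]
  have hmarkov := mul_meas_ge_le_integral_of_nonneg hN_nonneg hN_int (t ^ 2)
  rw [hN_integral] at hmarkov
  have hsub : quasiGiant n t ⊆ {ω | t ^ 2 ≤ ∑ x ∈ box 3 n, ∑ y ∈ box 3 n,
      (openConnIn (↑(box 3 n) : Set (Site 3)) x y).indicator (fun _ => (1 : ℝ)) ω} :=
    fun ω hω => sq_le_sum_indicator ht.le hω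
  have ht2 : 0 < t ^ 2 := pow_pos ht 2
  calc μ.real (quasiGiant n t)
      ≤ μ.real {ω | t ^ 2 ≤ ∑ x ∈ box 3 n, ∑ y ∈ box 3 n,
          (openConnIn (↑(box 3 n) : Set (Site 3)) x y).indicator (fun _ => (1 : ℝ)) ω} :=
        measureReal_mono hsub (measure_ne_top _ _)
    _ ≤ pairSum p n / t ^ 2 := by
        rw [le_div_iff₀ ht2, mul_comm]
        exact hmarkov

/-- `C ≥ 0` for any constant of a power saving (since `FA2 ≥ 0`). -/
theorem const_nonneg_of_powerSaving {p : unitInterval} {a₀ C : ℝ}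
    (hC : ∀ n : ℕ, 1 ≤ n → FA2 p n ≤ C * (n : ℝ) ^ (-a₀)) : 0 ≤ C := by
  have h := (FA2_nonneg p 1).trans (hC 1 le_rfl)
  simp only [Nat.cast_one, Real.one_rpow, mul_one] at h
  exact h

/-- **Under a power saving, quasi-giants are polynomially unlikely**: if `FA2 p n ≤ C n^{-a₀}` for
`n ≥ 1`, then `P_p(QG(n, n^b)) ≤ 729 C n^{6 - a₀ - 2b}` for `n ≥ 1`. -/
theorem measureReal_quasiGiant_rpow_le {p : unitInterval} {a₀ C : ℝ}
    (hC : ∀ n : ℕ, 1 ≤ n → FA2 p n ≤ C * (n : ℝ) ^ (-a₀)) {n : ℕ} (hn : 1 ≤ n) (b : ℝ) :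
    (bondPercolation (zdGraph 3) p).real (quasiGiant n ((n : ℝ) ^ b)) ≤
      729 * C * (n : ℝ) ^ (6 - a₀ - 2 * b) := by
  have hn1 : (1 : ℝ) ≤ n := by exact_mod_cast hn
  have hnpos : (0 : ℝ) < n := by linarith
  have ht : 0 < (n : ℝ) ^ b := Real.rpow_pos_of_pos hnpos b
  have h1 := measureReal_quasiGiant_le p n ht
  have hcard := card_box_pos n
  have hC0 : 0 ≤ C := const_nonneg_of_powerSaving hC
  have hps : pairSum p n ≤ C * (n : ℝ) ^ (-a₀) * ((box 3 n).card : ℝ) ^ 2 := by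
    have := hC n hn
    unfold FA2 at this
    rwa [div_le_iff₀ (pow_pos hcard 2)] at this
  have hcard2 : ((box 3 n).card : ℝ) ^ 2 ≤ 729 * (n : ℝ) ^ 6 := by
    rw [card_box_real]
    have h3 : 2 * (n : ℝ) + 1 ≤ 3 * n := by linarith
    calc ((2 * (n : ℝ) + 1) ^ 3) ^ 2 = (2 * (n : ℝ) + 1) ^ 6 := by ring
      _ ≤ (3 * (n : ℝ)) ^ 6 := by gcongr
      _ = 729 * (n : ℝ) ^ 6 := by ring
  have hK : 0 ≤ C * (n : ℝ) ^ (-a₀) := mul_nonneg hC0 (Real.rpow_nonneg hnpos.le _)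
  have hnum : pairSum p n ≤ C * (n : ℝ) ^ (-a₀) * (729 * (n : ℝ) ^ 6) :=
    hps.trans (mul_le_mul_of_nonneg_left hcard2 hK)
  have hsq : ((n : ℝ) ^ b) ^ 2 = (n : ℝ) ^ (2 * b) := by
    rw [← Real.rpow_natCast ((n : ℝ) ^ b) 2, ← Real.rpow_mul hnpos.le]
    congr 1
    push_cast
    ring
  have hpow : (n : ℝ) ^ (-a₀) * (n : ℝ) ^ 6 / (n : ℝ) ^ (2 * b) = (n : ℝ) ^ (6 - a₀ - 2 * b) := by
    rw [← Real.rpow_natCast (n : ℝ) 6, ← Real.rpow_add hnpos, ← Real.rpow_sub hnpos]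
    congr 1
    push_cast
    ring
  calc (bondPercolation (zdGraph 3) p).real (quasiGiant n ((n : ℝ) ^ b))
      ≤ pairSum p n / ((n : ℝ) ^ b) ^ 2 := h1
    _ ≤ C * (n : ℝ) ^ (-a₀) * (729 * (n : ℝ) ^ 6) / ((n : ℝ) ^ b) ^ 2 :=
        div_le_div_of_nonneg_right hnum (pow_pos ht 2).le
    _ = 729 * C * ((n : ℝ) ^ (-a₀) * (n : ℝ) ^ 6 / (n : ℝ) ^ (2 * b)) := by rw [hsq]; ring
    _ = 729 * C * (n : ℝ) ^ (6 - a₀ - 2 * b) := by rw [hpow]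

/-! ### §11.2 The crux implies the `stub_logBoost` hypothesis (QG-NAS) and the open stub `stub_noCriticalFoam` -/

/-- **Crux ⟹ quasi-giants vanish** (the converse of the line's collapse): under the crux with
exponent `a₀`, `P_{p_c}(QG(n, n^{3-a})) → 0` for `a = a₀ / 4` (indeed for every `a < a₀ / 2`). -/
theorem quasiGiant_tendsto_zero_of_freeBoxPowerSaving (h : FreeBoxPowerSaving) :
    ∃ a : ℝ, 0 < a ∧ Tendsto (fun n : ℕ => (bondPercolation (zdGraph 3) (criticalProbI 3)).real
      {ω | ∃ u ∈ box 3 n, (n : ℝ) ^ (3 - a) ≤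
        (((box 3 n).filter fun v => ω ∈ openConnIn ↑(box 3 n) u v).card : ℝ)}) atTop (𝓝 0) := by
  obtain ⟨a₀, C, ha₀, hC⟩ := freeBoxPowerSaving_iff.1 h
  refine ⟨a₀ / 4, by linarith, ?_⟩
  have hlim : Tendsto (fun n : ℕ => 729 * C * (n : ℝ) ^ (-(a₀ / 2))) atTop (𝓝 0) := by
    have := ((tendsto_rpow_neg_atTop (by linarith : 0 < a₀ / 2)).comp
      tendsto_natCast_atTop_atTop).const_mul (729 * C)
    simpa using this
  refine tendsto_of_tendsto_of_tendsto_of_le_of_le' tendsto_const_nhds hlim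
    (Eventually.of_forall fun n => measureReal_nonneg) ?_
  filter_upwards [eventually_ge_atTop 1] with n hn
  have h1 := measureReal_quasiGiant_rpow_le hC hn (3 - a₀ / 4)
  have he : (6 : ℝ) - a₀ - 2 * (3 - a₀ / 4) = -(a₀ / 2) := by ring
  rw [he] at h1
  exact h1

/-- **Crux ⟹ QG-NAS** (the second hypothesis of `stub_logBoost` at `p_c`, for every `ε < 1`):
modulo `stub_sizeSplitting` + `stub_logBoost` the crux is EQUIVALENT to this one-bit statement. -/
theorem quasiGiantNotAS_of_freeBoxPowerSaving (h : FreeBoxPowerSaving) {ε : ℝ} (hε : ε < 1) :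
    ∃ a : ℝ, 0 < a ∧ ∀ᶠ n : ℕ in atTop,
      (bondPercolation (zdGraph 3) (criticalProbI 3)).real
        {ω | ∃ u ∈ box 3 n, (n : ℝ) ^ (3 - a) ≤
          (((box 3 n).filter fun v => ω ∈ openConnIn ↑(box 3 n) u v).card : ℝ)} ≤ 1 - ε := by
  obtain ⟨a, ha, hlim⟩ := quasiGiant_tendsto_zero_of_freeBoxPowerSaving h
  exact ⟨a, ha, hlim.eventually (eventually_le_nhds (by linarith))⟩

/-- The foam event of `stub_noCriticalFoam` is contained in the inner quasi-giant event. -/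
theorem foam_subset_quasiGiant (n : ℕ) (s : ℝ) :
    {ω : BondConfig (Site 3) | ∃ u ∈ box 3 n, ∃ u' ∈ box 3 (2 * n),
        s ≤ (((box 3 n).filter fun v => ω ∈ openConnIn ↑(box 3 n) u v).card : ℝ) ∧
        s ≤ (((box 3 (2 * n)).filter fun v => ω ∈ openConnIn ↑(box 3 (2 * n)) u' v).card : ℝ) ∧
        ω ∉ openConnIn ↑(box 3 (2 * n)) u u'} ⊆ quasiGiant n s := by
  rintro ω ⟨u, hu, u', -, h1, -, -⟩
  exact ⟨u, hu, h1⟩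

/-- **Crux ⟹ `stub_noCriticalFoam`** (VERBATIM the registered open stub of skeleton `c888e645…`):
with `a = a₀ / 4` the foam event sits inside `QG(n, n^{3-a})`, whose probability is
`≤ 729 C n^{-a₀/2} → 0`.  So the open stub is NECESSARY for the crux; the skeleton proves it
sufficient modulo three provable stubs; a refutation of the stub would refute the crux. -/
theorem noCriticalFoam_of_freeBoxPowerSaving (h : FreeBoxPowerSaving) :
    ∀ η : ℝ, 0 < η → ∃ a : ℝ, 0 < a ∧ ∀ᶠ n : ℕ in atTop,
      (bondPercolation (zdGraph 3) (criticalProbI 3)).real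
        {ω | ∃ u ∈ box 3 n, ∃ u' ∈ box 3 (2 * n),
          (n : ℝ) ^ (3 - a) ≤
            (((box 3 n).filter fun v => ω ∈ openConnIn ↑(box 3 n) u v).card : ℝ) ∧
          (n : ℝ) ^ (3 - a) ≤
            (((box 3 (2 * n)).filter fun v => ω ∈ openConnIn ↑(box 3 (2 * n)) u' v).card : ℝ) ∧
          ω ∉ openConnIn ↑(box 3 (2 * n)) u u'} ≤ η := by
  intro η hη
  obtain ⟨a, ha, hlim⟩ := quasiGiant_tendsto_zero_of_freeBoxPowerSaving h
  refine ⟨a, ha, ?_⟩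
  filter_upwards [hlim.eventually (eventually_le_nhds hη)] with n hn
  exact (measureReal_mono (foam_subset_quasiGiant n _) (measure_ne_top _ _)).trans hn

/-! ### §11.3 The foam event is a non-proliferation event -/

/-- **Foam = a fat inner piece AND two distinct fat outer pieces.**  The registered foam event
(`∃ u ∈ B(n), u' ∈ B(2n)` with fat pieces, `u ↮ u'` in `B(2n)`) coincides with "some piece of `B(n)`
has `≥ s` vertices and `B(2n)` carries two pieces with `≥ s` vertices that are not joined inside
`B(2n)`": the outer piece of a fat inner vertex is fat (domain monotonicity), and of two unjoined fat
outer vertices at least one is unjoined from any given inner vertex. -/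
theorem foam_iff_two_fat_outer (n : ℕ) (s : ℝ) (ω : BondConfig (Site 3)) :
    (∃ u ∈ box 3 n, ∃ u' ∈ box 3 (2 * n),
        s ≤ (((box 3 n).filter fun v => ω ∈ openConnIn ↑(box 3 n) u v).card : ℝ) ∧
        s ≤ (((box 3 (2 * n)).filter fun v => ω ∈ openConnIn ↑(box 3 (2 * n)) u' v).card : ℝ) ∧
        ω ∉ openConnIn ↑(box 3 (2 * n)) u u') ↔
    ((∃ u ∈ box 3 n, s ≤ (((box 3 n).filter fun v => ω ∈ openConnIn ↑(box 3 n) u v).card : ℝ)) ∧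
      ∃ w ∈ box 3 (2 * n), ∃ w' ∈ box 3 (2 * n),
        s ≤ (((box 3 (2 * n)).filter fun v => ω ∈ openConnIn ↑(box 3 (2 * n)) w v).card : ℝ) ∧
        s ≤ (((box 3 (2 * n)).filter fun v => ω ∈ openConnIn ↑(box 3 (2 * n)) w' v).card : ℝ) ∧
        ω ∉ openConnIn ↑(box 3 (2 * n)) w w') := by
  have hsub : box 3 n ⊆ box 3 (2 * n) := box_mono 3 (by omega)
  -- the outer piece of `u` contains its inner piece
  have hmono : ∀ u : Site 3,
      ((box 3 n).filter fun v => ω ∈ openConnIn ↑(box 3 n) u v) ⊆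
        ((box 3 (2 * n)).filter fun v => ω ∈ openConnIn ↑(box 3 (2 * n)) u v) := by
    intro u v hv
    rw [Finset.mem_filter] at hv ⊢
    exact ⟨hsub hv.1, openConnIn_mono_set (Finset.coe_subset.2 hsub) u v hv.2⟩
  have hcard_mono : ∀ u : Site 3,
      (((box 3 n).filter fun v => ω ∈ openConnIn ↑(box 3 n) u v).card : ℝ) ≤
        (((box 3 (2 * n)).filter fun v => ω ∈ openConnIn ↑(box 3 (2 * n)) u v).card : ℝ) :=
    fun u => by exact_mod_cast Finset.card_le_card (hmono u)
  constructor
  · rintro ⟨u, hu, u', hu', h1, h2, h3⟩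
    exact ⟨⟨u, hu, h1⟩, u, hsub hu, u', hu', h1.trans (hcard_mono u), h2, h3⟩
  · rintro ⟨⟨u, hu, h1⟩, w, hw, w', hw', h2, h3, h4⟩
    by_cases huw : ω ∈ openConnIn (↑(box 3 (2 * n)) : Set (Site 3)) u w
    · -- `u ↔ w`, so `u ↮ w'` (else `w ↔ w'`)
      refine ⟨u, hu, w', hw', h1, h3, fun huw' => h4 ?_⟩
      exact GM.openConnIn_trans (openConnIn_symm_mem huw) huw'
    · exact ⟨u, hu, w, hw, h1, h2, huw⟩

/-! ### §11.4 Load-bearing guards of the registered stubs -/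

/-- `QG(n, t)` is the sure event for `t ≤ 1` (every vertex is its own piece). -/
theorem quasiGiant_eq_univ_of_le_one (n : ℕ) {t : ℝ} (ht : t ≤ 1) : quasiGiant n t = Set.univ := by
  refine Set.eq_univ_of_forall fun ω => ⟨0, zero_mem_box 3 n, ht.trans ?_⟩
  have h0 : (0 : Site 3) ∈ (box 3 n).filter fun v => ω ∈ openConnIn ↑(box 3 n) 0 v := by
    rw [Finset.mem_filter]
    exact ⟨zero_mem_box 3 n, Finset.mem_coe.2 (zero_mem_box 3 n), Finset.mem_coe.2 (zero_mem_box 3 n),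
      SimpleGraph.Reachable.refl _⟩
  exact_mod_cast Finset.card_pos.2 ⟨0, h0⟩

/-- **The guard `1 ≤ s` of `stub_sizeSplitting` is not load-bearing**: for `s ≤ 1` the size-splitting
inequality holds at every `p, n` because its right-hand side is `1`.  (So the registered stub is
equivalent to its guard-free version; provers may use either.) -/
theorem sizeSplitting_of_le_one (p : unitInterval) (n : ℕ) {s : ℝ} (hs : s ≤ 1) :
    (bondPercolation (zdGraph 3) p).real
        {ω | ∃ u ∈ box 3 n,
          3 * s ≤ (((box 3 n).filter fun v => ω ∈ openConnIn ↑(box 3 n) u v).card : ℝ)}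
      ≤ ((bondPercolation (zdGraph 3) p).real
          {ω | ∃ u ∈ box 3 n,
            s ≤ (((box 3 n).filter fun v => ω ∈ openConnIn ↑(box 3 n) u v).card : ℝ)}) ^ 2 := by
  have huniv : {ω : BondConfig (Site 3) | ∃ u ∈ box 3 n,
      s ≤ (((box 3 n).filter fun v => ω ∈ openConnIn ↑(box 3 n) u v).card : ℝ)} = Set.univ :=
    quasiGiant_eq_univ_of_le_one n hs
  rw [huniv, probReal_univ, one_pow]
  exact measureReal_le_one

/-- **For `a ≥ 3` the second hypothesis of `stub_logBoost` is unsatisfiable** (`n^{3-a} ≤ 1` for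
`n ≥ 1`, so `QG(n, n^{3-a})` is sure and its probability `1` is not `≤ 1 - ε`): any application of
the log boost has `a < 3`. -/
theorem logBoost_hypothesis_false_of_three_le (p : unitInterval) {a ε : ℝ} (ha : 3 ≤ a) (hε : 0 < ε) :
    ¬ ∀ᶠ n : ℕ in atTop,
      (bondPercolation (zdGraph 3) p).real
        {ω | ∃ u ∈ box 3 n, (n : ℝ) ^ (3 - a) ≤
          (((box 3 n).filter fun v => ω ∈ openConnIn ↑(box 3 n) u v).card : ℝ)} ≤ 1 - ε := by
  intro h
  obtain ⟨n, hn, hn1⟩ := (h.and (eventually_ge_atTop 1)).exists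
  have hn1' : (1 : ℝ) ≤ n := by exact_mod_cast hn1
  have hle : (n : ℝ) ^ (3 - a) ≤ 1 := Real.rpow_le_one_of_one_le_of_nonpos hn1' (by linarith)
  have huniv : {ω : BondConfig (Site 3) | ∃ u ∈ box 3 n, (n : ℝ) ^ (3 - a) ≤
      (((box 3 n).filter fun v => ω ∈ openConnIn ↑(box 3 n) u v).card : ℝ)} = Set.univ :=
    quasiGiant_eq_univ_of_le_one n hle
  rw [huniv, probReal_univ] at hn
  linarith

/-- **The guard `1 ≤ n` of `stub_gluingCriterion` is load-bearing**: without it the criterion is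
FALSE — at `n = 0`, `s = 0` the good event `QG(0,0) ∩ Glued(0,0)` is sure (`B(0) = B(2·0) = {0}`),
so it has `P_0`-probability `1 > 1 - ε₀`, while `θ(0) = 0`. -/
theorem gluingCriterion_false_without_guard :
    ¬ ∃ ε₀ : ℝ, 0 < ε₀ ∧ ∀ (p : unitInterval) (n : ℕ) (s : ℝ),
      1 - ε₀ < (bondPercolation (zdGraph 3) p).real
        ({ω | ∃ u ∈ box 3 n,
            s ≤ (((box 3 n).filter fun v => ω ∈ openConnIn ↑(box 3 n) u v).card : ℝ)} ∩
         {ω | ∀ u ∈ box 3 n, ∀ u' ∈ box 3 (2 * n),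
            s ≤ (((box 3 n).filter fun v => ω ∈ openConnIn ↑(box 3 n) u v).card : ℝ) →
            s ≤ (((box 3 (2 * n)).filter fun v => ω ∈ openConnIn ↑(box 3 (2 * n)) u' v).card : ℝ) →
            ω ∈ openConnIn ↑(box 3 (2 * n)) u u'}) →
      0 < theta (zdGraph 3) (0 : Site 3) p := by
  rintro ⟨ε₀, hε₀, h⟩
  have hbox0 : ∀ u : Site 3, u ∈ box 3 0 → u = 0 := by
    intro u hu
    rw [mem_box] at hu
    funext i
    have := hu i
    push_cast at this
    simp only [Pi.zero_apply]
    omega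
  have huniv : ({ω : BondConfig (Site 3) | ∃ u ∈ box 3 0,
      (0 : ℝ) ≤ (((box 3 0).filter fun v => ω ∈ openConnIn ↑(box 3 0) u v).card : ℝ)} ∩
      {ω | ∀ u ∈ box 3 0, ∀ u' ∈ box 3 (2 * 0),
        (0 : ℝ) ≤ (((box 3 0).filter fun v => ω ∈ openConnIn ↑(box 3 0) u v).card : ℝ) →
        (0 : ℝ) ≤ (((box 3 (2 * 0)).filter fun v => ω ∈ openConnIn ↑(box 3 (2 * 0)) u' v).card : ℝ) →
        ω ∈ openConnIn ↑(box 3 (2 * 0)) u u'}) = Set.univ := by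
    refine Set.eq_univ_of_forall fun ω => ⟨⟨0, zero_mem_box 3 0, Nat.cast_nonneg _⟩, ?_⟩
    intro u hu u' hu' _ _
    have h20 : 2 * 0 = 0 := rfl
    rw [h20] at hu' ⊢
    rw [hbox0 u hu, hbox0 u' hu']
    exact ⟨Finset.mem_coe.2 (zero_mem_box 3 0), Finset.mem_coe.2 (zero_mem_box 3 0),
      SimpleGraph.Reachable.refl _⟩
  have h1 := h 0 0 0
  rw [huniv, probReal_univ] at h1
  have hθ : 0 < theta (zdGraph 3) (0 : Site 3) 0 := h1 (by linarith)
  have hpc : ((0 : unitInterval) : ℝ) < criticalProb (zdGraph 3) (0 : Site 3) := by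
    exact_mod_cast criticalProb_zd_pos 3 (by norm_num)
  have hzero : theta (zdGraph 3) (0 : Site 3) 0 = 0 :=
    theta_eq_zero_of_lt_criticalProb_holds (zdGraph 3) (0 : Site 3) 0 hpc
  linarith

/-! ### §11.5 The archived sibling skeleton's open stubs are crux-necessary too -/

/-- A cluster confined to `S` joins its points inside `S`:
`{0 ↔ y} ∩ {C(0) ⊆ S} ⊆ {0 ↔ y in S}`. -/
theorem openConn_inter_confined_subset_openConnIn (S : Set (Site 3)) (y : Site 3) :
    openConn (0 : Site 3) y ∩ {ω | openCluster ω 0 ⊆ S} ⊆ openConnIn S 0 y := by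
  rintro ω ⟨hr, hS⟩
  apply DCT16.mem_openConnIn_of_pathIn
  refine ⟨hS (mem_openCluster_self ω 0), ?_⟩
  have hr' : Relation.ReflTransGen (openGraph ω).Adj 0 y := (SimpleGraph.reachable_iff_reflTransGen 0 y).1 hr
  clear hr
  induction hr' with
  | refl => exact Relation.ReflTransGen.refl
  | @tail b c hb hbc ih =>
    refine ih.tail ⟨hbc, hS ?_⟩
    show (openGraph ω).Reachable 0 c
    exact ((SimpleGraph.reachable_iff_reflTransGen 0 b).2 hb).trans hbc.reachable

/-- **Crux ⟹ `stub_fatFiniteClusters`** (VERBATIM the sibling skeleton's distinctive open stub: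
`Σ_{y ∈ B(2n)} P_{p_c}(0 ↔ y, C(0) ⊆ B(2n)) ≤ C n^{3-a}`): by confinement the summands are free-box
connectivities, and the crux is a centred free-box bound with exponent `b = 3 - a < 3`
(§6 `freeBoxPowerSaving_iff_centreRooted`). -/
theorem fatFiniteClusters_of_freeBoxPowerSaving (h : FreeBoxPowerSaving) :
    ∃ a C : ℝ, 0 < a ∧ ∀ n : ℕ, 1 ≤ n →
      ∑ y ∈ box 3 (2 * n), (bondPercolation (zdGraph 3) (criticalProbI 3)).real
          (openConn 0 y ∩ {ω | openCluster ω 0 ⊆ ↑(box 3 (2 * n))})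
        ≤ C * (n : ℝ) ^ (3 - a) := by
  obtain ⟨b, hb, C, hC⟩ := freeBoxPowerSaving_iff_centreRooted.1 h
  refine ⟨3 - b, max C 0 * (2 : ℝ) ^ b, by linarith, fun n hn => ?_⟩
  have hnpos : (0 : ℝ) < n := by exact_mod_cast hn
  have h2n : 1 ≤ 2 * n := by omega
  have h1 := hC (2 * n) h2n
  have h2 : ((2 * n : ℕ) : ℝ) ^ b = (2 : ℝ) ^ b * (n : ℝ) ^ b := by
    push_cast; exact Real.mul_rpow (by norm_num) hnpos.le
  calc ∑ y ∈ box 3 (2 * n), (bondPercolation (zdGraph 3) (criticalProbI 3)).real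
          (openConn 0 y ∩ {ω | openCluster ω 0 ⊆ ↑(box 3 (2 * n))})
      ≤ ∑ y ∈ box 3 (2 * n), (bondPercolation (zdGraph 3) (criticalProbI 3)).real
          (openConnIn (↑(box 3 (2 * n)) : Set (Site 3)) 0 y) :=
        Finset.sum_le_sum fun y _ =>
          measureReal_mono (openConn_inter_confined_subset_openConnIn _ y) (measure_ne_top _ _)
    _ ≤ C * ((2 * n : ℕ) : ℝ) ^ b := h1
    _ ≤ max C 0 * ((2 * n : ℕ) : ℝ) ^ b :=
        mul_le_mul_of_nonneg_right (le_max_left _ _) (Real.rpow_nonneg (by positivity) _)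
    _ = max C 0 * (2 : ℝ) ^ b * (n : ℝ) ^ (3 - (3 - b)) := by rw [h2, sub_sub_cancel]; ring

/-- **Crux ⟹ `stub_boundaryQuasiGiantsNotAS`** (VERBATIM the sibling skeleton's hardest stub: with
probability `≥ ε` no boundary-touching piece of `B(n)` has `≥ n^{3-a}` vertices, eventually): the
boundary quasi-giant event lies inside `QG(n, n^{3-a})`, whose probability tends to `0` under the crux. -/
theorem boundaryQuasiGiantsNotAS_of_freeBoxPowerSaving (h : FreeBoxPowerSaving) :
    ∃ a ε : ℝ, 0 < a ∧ 0 < ε ∧ ∀ᶠ n : ℕ in atTop,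
      (bondPercolation (zdGraph 3) (criticalProbI 3)).real
        {ω | ∃ u ∈ innerBoundary (zdGraph 3) (box 3 n), (n : ℝ) ^ (3 - a) ≤
          (((box 3 n).filter fun v => ω ∈ openConnIn ↑(box 3 n) u v).card : ℝ)} ≤ 1 - ε := by
  obtain ⟨a, ha, hlim⟩ := quasiGiant_tendsto_zero_of_freeBoxPowerSaving h
  refine ⟨a, 1 / 2, ha, by norm_num, ?_⟩
  filter_upwards [hlim.eventually (eventually_le_nhds (by norm_num : (0 : ℝ) < 1 - 1 / 2))] with n hn
  refine le_trans (measureReal_mono ?_ (measure_ne_top _ _)) hn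
  rintro ω ⟨u, hu, h1⟩
  exact ⟨u, (mem_innerBoundary_iff.1 hu).1, h1⟩

end Targets

/-! ## §12 (cycle 3) Linear-scale box LRO kills every power saving: `X_D ∧ θ(p_c) > 0 ⟹ ¬ crux`

The other axis of the cone.  `PercFiniteBoxLRO.LinearScaleLROOfTheta` (= `X_D`, stmt-CriticalPhenomena-0855,
Cerf 2015's "missing ingredient"): `θ(p) > 0 ⟹ ∃ ρ > 0, K, ∀ n ≥ 1, ∀ x,y ∈ B(n), P_p(x ↔ y in B(Kn)) ≥ ρ`.
Such LRO at `p` gives `FA₂(p, Kn) ≥ ρ/K⁶` for all `n` (`FA2_mul_ge_of_boxLRO`), hence no power saving at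
`p` (`not_powerSaving_of_boxLRO`; `K = 0` is excluded by `ρ > 0`).  So `X_D ∧ θ(p_c) > 0 ⟹ ¬ crux`
(`not_freeBoxPowerSaving_of_linearLRO_of_theta_pos`) and `X_D ∧ crux ⟹ ¬ θ(p_c) > 0`, i.e. `θ(p_c) = 0`
(`not_theta_pos_of_linearLRO`); and already LRO at EVERY POLYNOMIAL scale `⌈n^α⌉`, `α > 1`
(`PolyScaleLROOfTheta`, stmt-0858, the weaker rank-4 item) does the same, because scale `α` caps the
exponent by `a ≤ 6(1 - 1/α) → 0` (§12.2: `exponent_mul_le_of_boxLRO_rpow`, `not_powerSaving_of_polyBoxLRO`,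
`not_freeBoxPowerSaving_of_polyLRO_of_theta_pos`): modulo `X_D` (or 0858) the crux is SUMMIT-STRENGTH and can replace route
`PercFiniteBoxLRO`'s renormalisation step `RenormaliseFromLinearLRO` (stmt-0857, which carries the
`SprinklingRenormalisation` barrier) — a two-item cross-route assembly for planners.  For the disproof:
`¬ crux` is implied by "`p_c(ℤ³)` percolates WITH linear-scale box LRO", the exact structure of the known
first-order analogues (wired FK `q ≫ 1` on `ℤ³`; Aizenman–Newman `1/r²` on `ℤ`), and by nothing weaker
that is in print: Cerf 2015 Thm 1.3 (tree `Cerf2015_thm_1_3_three`, `Λ(n^16)`) with `θ(p_c) > 0` bounds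
the exponent only by `a ≤ 6(1 - 1/16) = 45/8` here (`3(1 - 1/16) = 45/16` with disjoint translates),
WEAKER than the unconditional DCT ceiling `a ≤ 2` (§5); a single scale `α` beats `a ≤ 2` only for
`α < 3/2` (`α < 3` with translates), far below Cerf's `46/3` — only the full `∀ α > 1` statement bites.  Above `p_c` linear LRO is classical (Grimmett–Marstrand, not in
tree), consistent with §7's profile (no power saving on `(p_c, 1]`).
-/

section LinearLRO

open Summit.CriticalPhenomena.PercolationContinuityZ3.Theses.PercFiniteBoxLRO (LinearScaleLROOfTheta
  PolyScaleLROOfTheta)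

/-- `|B(K n)| ≤ K³ |B(n)|` for `K ≥ 1` (as reals): `2Kn + 1 ≤ K(2n+1)`. -/
theorem card_box_mul_le {K : ℕ} (hK : 1 ≤ K) (n : ℕ) :
    ((box 3 (K * n)).card : ℝ) ≤ (K : ℝ) ^ 3 * ((box 3 n).card : ℝ) := by
  rw [card_box_real, card_box_real]
  have hK1 : (1 : ℝ) ≤ K := by exact_mod_cast hK
  have hn0 : (0 : ℝ) ≤ n := Nat.cast_nonneg n
  have h : 2 * ((K * n : ℕ) : ℝ) + 1 ≤ K * (2 * (n : ℝ) + 1) := by push_cast; nlinarith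
  calc (2 * ((K * n : ℕ) : ℝ) + 1) ^ 3 ≤ ((K : ℝ) * (2 * (n : ℝ) + 1)) ^ 3 := by
        gcongr
    _ = (K : ℝ) ^ 3 * (2 * (n : ℝ) + 1) ^ 3 := by ring

/-- **Box long-range order bounds `FA₂` below**: if `P_p(x ↔ y in B(K n)) ≥ ρ` for all
`x, y ∈ B(n)` (`K ≥ 1`), then `FA₂(p, K n) ≥ ρ / K⁶`. -/
theorem FA2_mul_ge_of_boxLRO {p : unitInterval} {ρ : ℝ} {K n : ℕ} (hK : 1 ≤ K)
    (h : ∀ x ∈ box 3 n, ∀ y ∈ box 3 n,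
      ρ ≤ (bondPercolation (zdGraph 3) p).real (openConnIn ↑(box 3 (K * n)) x y)) :
    ρ / (K : ℝ) ^ 6 ≤ FA2 p (K * n) := by
  have hsub : box 3 n ⊆ box 3 (K * n) := box_mono 3 (Nat.le_mul_of_pos_left n hK)
  have hcK := card_box_pos (K * n)
  have hKpos : (0 : ℝ) < K := by exact_mod_cast hK
  -- a negative `ρ` is trivial
  rcases lt_or_ge ρ 0 with hρneg | hρ
  · exact le_trans (div_neg_of_neg_of_pos hρneg (pow_pos hKpos 6)).le (FA2_nonneg p _)
  -- `ρ |B(n)|² ≤ pairSum p (K n)`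
  have hps : ρ * ((box 3 n).card : ℝ) ^ 2 ≤ pairSum p (K * n) := by
    unfold pairSum
    calc ρ * ((box 3 n).card : ℝ) ^ 2 = ∑ _x ∈ box 3 n, ∑ _y ∈ box 3 n, ρ := by
          rw [Finset.sum_const, Finset.sum_const, nsmul_eq_mul, nsmul_eq_mul]; ring
      _ ≤ ∑ x ∈ box 3 n, ∑ y ∈ box 3 n,
            (bondPercolation (zdGraph 3) p).real (openConnIn ↑(box 3 (K * n)) x y) :=
          Finset.sum_le_sum fun x hx => Finset.sum_le_sum fun y hy => h x hx y hy
      _ ≤ ∑ x ∈ box 3 n, ∑ y ∈ box 3 (K * n),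
            (bondPercolation (zdGraph 3) p).real (openConnIn ↑(box 3 (K * n)) x y) :=
          Finset.sum_le_sum fun x _ =>
            Finset.sum_le_sum_of_subset_of_nonneg hsub fun _ _ _ => measureReal_nonneg
      _ ≤ ∑ x ∈ box 3 (K * n), ∑ y ∈ box 3 (K * n),
            (bondPercolation (zdGraph 3) p).real (openConnIn ↑(box 3 (K * n)) x y) :=
          Finset.sum_le_sum_of_subset_of_nonneg hsub fun _ _ _ =>
            Finset.sum_nonneg fun _ _ => measureReal_nonneg
  -- `|B(K n)|² ≤ K⁶ |B(n)|²`
  have hcard : ((box 3 (K * n)).card : ℝ) ^ 2 ≤ (K : ℝ) ^ 6 * ((box 3 n).card : ℝ) ^ 2 := by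
    calc ((box 3 (K * n)).card : ℝ) ^ 2 ≤ ((K : ℝ) ^ 3 * ((box 3 n).card : ℝ)) ^ 2 :=
          pow_le_pow_left₀ hcK.le (card_box_mul_le hK n) 2
      _ = (K : ℝ) ^ 6 * ((box 3 n).card : ℝ) ^ 2 := by ring
  unfold FA2
  rw [div_le_div_iff₀ (pow_pos hKpos 6) (pow_pos hcK 2)]
  calc ρ * ((box 3 (K * n)).card : ℝ) ^ 2 ≤ ρ * ((K : ℝ) ^ 6 * ((box 3 n).card : ℝ) ^ 2) :=
        mul_le_mul_of_nonneg_left hcard hρ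
    _ = ρ * ((box 3 n).card : ℝ) ^ 2 * (K : ℝ) ^ 6 := by ring
    _ ≤ pairSum p (K * n) * (K : ℝ) ^ 6 :=
        mul_le_mul_of_nonneg_right hps (pow_pos hKpos 6).le

/-- **Linear-scale box LRO at `p` ⟹ no power saving at `p`** (any witness `ρ > 0`, `K`; `K = 0` is
impossible since `B(0) = {0}` cannot contain `B(1)`). -/
theorem not_powerSaving_of_boxLRO {p : unitInterval} {ρ : ℝ} (hρ : 0 < ρ) {K : ℕ}
    (h : ∀ n : ℕ, 1 ≤ n → ∀ x ∈ box 3 n, ∀ y ∈ box 3 n,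
      ρ ≤ (bondPercolation (zdGraph 3) p).real (openConnIn ↑(box 3 (K * n)) x y)) :
    ¬ PowerSavingAt p := by
  rcases Nat.eq_zero_or_pos K with rfl | hKpos
  · -- `K = 0`: the event `{v ↔ v in B(0)}` is empty for `v = (1,1,1) ∉ B(0)`
    exfalso
    set v : Site 3 := fun _ => 1 with hv
    have hv1 : v ∈ box 3 1 := by
      rw [mem_box]; intro i; simp [hv]
    have hv0 : v ∉ box 3 (0 * 1) := by
      rw [mem_box]; push_cast
      intro hcon
      have := (hcon 0).2
      simp [hv] at this
    have hempty : (openConnIn (↑(box 3 (0 * 1)) : Set (Site 3)) v v) = ∅ := by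
      ext ω
      simp only [Set.mem_empty_iff_false, iff_false]
      rintro ⟨hx, -, -⟩
      exact hv0 (Finset.mem_coe.1 hx)
    have h1 := h 1 le_rfl v hv1 v hv1
    rw [hempty, measureReal_empty] at h1
    linarith
  · rintro ⟨a, C, ha, hC⟩
    have hK : 1 ≤ K := hKpos
    have hKr : (0 : ℝ) < K := by exact_mod_cast hKpos
    -- along `N = K n`: `ρ / K⁶ ≤ FA2 p (K n) ≤ C (K n)^{-a} → 0`
    have hKn : Tendsto (fun n : ℕ => K * n) atTop atTop :=
      tendsto_atTop_mono (fun n => Nat.le_mul_of_pos_left n hKpos) tendsto_id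
    have hT : Tendsto (fun n : ℕ => C * (((K * n : ℕ) : ℝ)) ^ (-a)) atTop (𝓝 0) := by
      have := ((tendsto_rpow_neg_atTop ha).comp (tendsto_natCast_atTop_atTop.comp hKn)).const_mul C
      simpa using this
    have hev : ∀ᶠ n : ℕ in atTop, C * (((K * n : ℕ) : ℝ)) ^ (-a) < ρ / (K : ℝ) ^ 6 :=
      hT.eventually (eventually_lt_nhds (div_pos hρ (pow_pos hKr 6)))
    obtain ⟨n, hn, hn1⟩ := (hev.and (eventually_ge_atTop 1)).exists
    have hKn1 : 1 ≤ K * n := le_trans hn1 (Nat.le_mul_of_pos_left n hKpos)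
    have h1 : ρ / (K : ℝ) ^ 6 ≤ FA2 p (K * n) := FA2_mul_ge_of_boxLRO hK (h n hn1)
    have h2 : FA2 p (K * n) ≤ C * (((K * n : ℕ) : ℝ)) ^ (-a) := hC (K * n) hKn1
    linarith

/-- **`X_D ∧ θ(p_c) > 0 ⟹ ¬ FreeBoxPowerSaving`**: linear-scale box long-range order from
`θ > 0` (the crux `LinearScaleLROOfTheta` of route `PercFiniteBoxLRO`, stmt-CriticalPhenomena-0855)
and a discontinuous transition at `p_c(ℤ³)` together refute the crux. -/
theorem not_freeBoxPowerSaving_of_linearLRO_of_theta_pos (hX : LinearScaleLROOfTheta)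
    (hθ : 0 < theta (zdGraph 3) (0 : Site 3) (criticalProbI 3)) : ¬ FreeBoxPowerSaving := by
  obtain ⟨ρ, hρ, K, hK⟩ := hX (criticalProbI 3) hθ
  rw [freeBoxPowerSaving_iff]
  exact not_powerSaving_of_boxLRO hρ hK

/-- **`X_D ∧ FreeBoxPowerSaving ⟹ ¬ (θ(p_c) > 0)`**, i.e. `θ(p_c(ℤ³)) = 0` since `θ ≥ 0`: modulo
the linear-scale LRO crux of route `PercFiniteBoxLRO`, the present crux is summit-strength (it can
stand in for that route's renormalisation step `RenormaliseFromLinearLRO`). -/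
theorem not_theta_pos_of_linearLRO (hX : LinearScaleLROOfTheta) (h : FreeBoxPowerSaving) :
    ¬ 0 < theta (zdGraph 3) (0 : Site 3) (criticalProbI 3) :=
  fun hθ => not_freeBoxPowerSaving_of_linearLRO_of_theta_pos hX hθ h

/-! ### §12.2 Polynomial scales: LRO inside `B(⌈n^α⌉)` caps the exponent by `6(1 - 1/α)`; all `α > 1` kill it -/

/-- **Box LRO at a polynomial scale bounds `FA₂` below**: if `P_p(x ↔ y in B(⌈n^α⌉)) ≥ ρ` for all
`x, y ∈ B(n)` (`α ≥ 1`, `n ≥ 1`), then `FA₂(p, ⌈n^α⌉) ≥ (ρ / 15625) · n^{-6(α-1)}`. -/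
theorem FA2_ceil_rpow_ge_of_boxLRO {p : unitInterval} {ρ α : ℝ} (hα : 1 ≤ α) {n : ℕ} (hn : 1 ≤ n)
    (h : ∀ x ∈ box 3 n, ∀ y ∈ box 3 n,
      ρ ≤ (bondPercolation (zdGraph 3) p).real (openConnIn ↑(box 3 ⌈(n : ℝ) ^ α⌉₊) x y)) :
    ρ / 15625 * (n : ℝ) ^ (-(6 * (α - 1))) ≤ FA2 p ⌈(n : ℝ) ^ α⌉₊ := by
  set m : ℕ := ⌈(n : ℝ) ^ α⌉₊ with hm
  have hn1 : (1 : ℝ) ≤ n := by exact_mod_cast hn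
  have hnpos : (0 : ℝ) < n := by linarith
  have hnα1 : (1 : ℝ) ≤ (n : ℝ) ^ α := Real.one_le_rpow hn1 (by linarith)
  have hnα : (n : ℝ) ≤ (n : ℝ) ^ α := by
    calc (n : ℝ) = (n : ℝ) ^ (1 : ℝ) := (Real.rpow_one _).symm
      _ ≤ (n : ℝ) ^ α := Real.rpow_le_rpow_of_exponent_le hn1 hα
  have hmα : (n : ℝ) ^ α ≤ (m : ℝ) := Nat.le_ceil _
  have hm_le : (m : ℝ) ≤ (n : ℝ) ^ α + 1 := (Nat.ceil_lt_add_one (by linarith)).le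
  have hnm : n ≤ m := by exact_mod_cast hnα.trans hmα
  have hsub : box 3 n ⊆ box 3 m := box_mono 3 hnm
  have hcm := card_box_pos m
  have hpow_pos : 0 < (n : ℝ) ^ (-(6 * (α - 1))) := Real.rpow_pos_of_pos hnpos _
  -- a negative `ρ` is trivial
  rcases lt_or_ge ρ 0 with hρneg | hρ
  · have : ρ / 15625 * (n : ℝ) ^ (-(6 * (α - 1))) < 0 :=
      mul_neg_of_neg_of_pos (div_neg_of_neg_of_pos hρneg (by norm_num)) hpow_pos
    exact this.le.trans (FA2_nonneg p _)
  -- `ρ |B(n)|² ≤ pairSum p m`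
  have hps : ρ * ((box 3 n).card : ℝ) ^ 2 ≤ pairSum p m := by
    unfold pairSum
    calc ρ * ((box 3 n).card : ℝ) ^ 2 = ∑ _x ∈ box 3 n, ∑ _y ∈ box 3 n, ρ := by
          rw [Finset.sum_const, Finset.sum_const, nsmul_eq_mul, nsmul_eq_mul]; ring
      _ ≤ ∑ x ∈ box 3 n, ∑ y ∈ box 3 n,
            (bondPercolation (zdGraph 3) p).real (openConnIn ↑(box 3 m) x y) :=
          Finset.sum_le_sum fun x hx => Finset.sum_le_sum fun y hy => h x hx y hy
      _ ≤ ∑ x ∈ box 3 n, ∑ y ∈ box 3 m,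
            (bondPercolation (zdGraph 3) p).real (openConnIn ↑(box 3 m) x y) :=
          Finset.sum_le_sum fun x _ =>
            Finset.sum_le_sum_of_subset_of_nonneg hsub fun _ _ _ => measureReal_nonneg
      _ ≤ ∑ x ∈ box 3 m, ∑ y ∈ box 3 m,
            (bondPercolation (zdGraph 3) p).real (openConnIn ↑(box 3 m) x y) :=
          Finset.sum_le_sum_of_subset_of_nonneg hsub fun _ _ _ =>
            Finset.sum_nonneg fun _ _ => measureReal_nonneg
  -- `|B(m)|² ≤ 15625 n^{6α}` and `n⁶ ≤ |B(n)|²`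
  have hcardm : ((box 3 m).card : ℝ) ^ 2 ≤ 15625 * (n : ℝ) ^ (6 * α) := by
    rw [card_box_real]
    have h5 : 2 * (m : ℝ) + 1 ≤ 5 * (n : ℝ) ^ α := by linarith
    have h6 : ((n : ℝ) ^ α) ^ 6 = (n : ℝ) ^ (6 * α) := by
      rw [← Real.rpow_natCast ((n : ℝ) ^ α) 6, ← Real.rpow_mul hnpos.le]
      congr 1; push_cast; ring
    calc ((2 * (m : ℝ) + 1) ^ 3) ^ 2 = (2 * (m : ℝ) + 1) ^ 6 := by ring
      _ ≤ (5 * (n : ℝ) ^ α) ^ 6 := by gcongr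
      _ = 15625 * ((n : ℝ) ^ α) ^ 6 := by ring
      _ = 15625 * (n : ℝ) ^ (6 * α) := by rw [h6]
  have hcardn : (n : ℝ) ^ 6 ≤ ((box 3 n).card : ℝ) ^ 2 := by
    rw [card_box_real]
    have : (n : ℝ) ≤ 2 * n + 1 := by linarith
    calc (n : ℝ) ^ 6 = ((n : ℝ) ^ 3) ^ 2 := by ring
      _ ≤ ((2 * (n : ℝ) + 1) ^ 3) ^ 2 := by gcongr
  have hsplit : (n : ℝ) ^ (-(6 * (α - 1))) * (n : ℝ) ^ (6 * α) = (n : ℝ) ^ 6 := by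
    rw [← Real.rpow_add hnpos, ← Real.rpow_natCast (n : ℝ) 6]
    congr 1; push_cast; ring
  unfold FA2
  rw [le_div_iff₀ (pow_pos hcm 2)]
  calc ρ / 15625 * (n : ℝ) ^ (-(6 * (α - 1))) * ((box 3 m).card : ℝ) ^ 2
      ≤ ρ / 15625 * (n : ℝ) ^ (-(6 * (α - 1))) * (15625 * (n : ℝ) ^ (6 * α)) :=
        mul_le_mul_of_nonneg_left hcardm (mul_nonneg (div_nonneg hρ (by norm_num)) hpow_pos.le)
    _ = ρ * ((n : ℝ) ^ (-(6 * (α - 1))) * (n : ℝ) ^ (6 * α)) := by ring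
    _ = ρ * (n : ℝ) ^ 6 := by rw [hsplit]
    _ ≤ ρ * ((box 3 n).card : ℝ) ^ 2 := mul_le_mul_of_nonneg_left hcardn hρ
    _ ≤ pairSum p m := hps

/-- **Quantitative ceiling from polynomial-scale LRO**: box LRO at scale `⌈n^α⌉` with `ρ > 0`, `α ≥ 1`
(e.g. Cerf 2015 Thm 1.3 at a percolating `p`: `α = 16`) forces every power-saving witness `(a, C)`
at that `p` to satisfy `a α ≤ 6(α - 1)`, i.e. `a ≤ 6(1 - 1/α)`. -/
theorem exponent_mul_le_of_boxLRO_rpow {p : unitInterval} {ρ α : ℝ} (hα : 1 ≤ α) (hρ : 0 < ρ)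
    (h : ∀ n : ℕ, 1 ≤ n → ∀ x ∈ box 3 n, ∀ y ∈ box 3 n,
      ρ ≤ (bondPercolation (zdGraph 3) p).real (openConnIn ↑(box 3 ⌈(n : ℝ) ^ α⌉₊) x y))
    {a C : ℝ} (hC : ∀ n : ℕ, 1 ≤ n → FA2 p n ≤ C * (n : ℝ) ^ (-a)) : a * α ≤ 6 * (α - 1) := by
  by_contra hlt
  push Not at hlt
  have he : 0 < a * α - 6 * (α - 1) := by linarith
  have hC0 : 0 ≤ C := by
    have := (FA2_nonneg p 1).trans (hC 1 le_rfl)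
    simpa using this
  -- `C n^{-(aα - 6(α-1))} → 0`, so eventually `< ρ / 15625`
  have hT : Tendsto (fun n : ℕ => C * (n : ℝ) ^ (-(a * α - 6 * (α - 1)))) atTop (𝓝 0) := by
    have := ((tendsto_rpow_neg_atTop he).comp tendsto_natCast_atTop_atTop).const_mul C
    simpa using this
  have hev : ∀ᶠ n : ℕ in atTop, C * (n : ℝ) ^ (-(a * α - 6 * (α - 1))) < ρ / 15625 :=
    hT.eventually (eventually_lt_nhds (by positivity))
  obtain ⟨n, hn, hn1⟩ := (hev.and (eventually_ge_atTop 1)).exists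
  have hn1' : (1 : ℝ) ≤ n := by exact_mod_cast hn1
  have hnpos : (0 : ℝ) < n := by linarith
  set m : ℕ := ⌈(n : ℝ) ^ α⌉₊ with hm
  have hnα1 : (1 : ℝ) ≤ (n : ℝ) ^ α := Real.one_le_rpow hn1' (by linarith)
  have hnα_pos : 0 < (n : ℝ) ^ α := by linarith
  have hmα : (n : ℝ) ^ α ≤ (m : ℝ) := Nat.le_ceil _
  have hm1 : 1 ≤ m := by exact_mod_cast hnα1.trans hmα
  have h1 := FA2_ceil_rpow_ge_of_boxLRO hα hn1 (h n hn1)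
  have h2 : FA2 p m ≤ C * (m : ℝ) ^ (-a) := hC m hm1
  have ha0 : 0 ≤ a := by
    -- `a < 0` would contradict `hlt` since `α ≥ 1`: `a α < 0 ≤ 6(α-1)`; so `a ≥ 0`
    by_contra ha
    push Not at ha
    have : a * α < 0 := mul_neg_of_neg_of_pos ha (by linarith)
    linarith
  have h3 : C * (m : ℝ) ^ (-a) ≤ C * ((n : ℝ) ^ α) ^ (-a) :=
    mul_le_mul_of_nonneg_left (Real.rpow_le_rpow_of_nonpos hnα_pos hmα (by linarith)) hC0
  have h4 : ((n : ℝ) ^ α) ^ (-a) = (n : ℝ) ^ (-(a * α - 6 * (α - 1))) * (n : ℝ) ^ (-(6 * (α - 1))) := by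
    rw [← Real.rpow_mul hnpos.le, ← Real.rpow_add hnpos]
    congr 1; ring
  have key : ρ / 15625 * (n : ℝ) ^ (-(6 * (α - 1))) ≤
      C * (n : ℝ) ^ (-(a * α - 6 * (α - 1))) * (n : ℝ) ^ (-(6 * (α - 1))) := by
    calc _ ≤ FA2 p m := h1
      _ ≤ C * (m : ℝ) ^ (-a) := h2
      _ ≤ C * ((n : ℝ) ^ α) ^ (-a) := h3
      _ = _ := by rw [h4, mul_assoc]
  have hpos : 0 < (n : ℝ) ^ (-(6 * (α - 1))) := Real.rpow_pos_of_pos hnpos _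
  have := le_of_mul_le_mul_right key hpos
  linarith

/-- **LRO at every polynomial scale ⟹ no power saving**: if for every `α > 1` there is `ρ_α > 0`
with `P_p(x ↔ y in B(⌈n^α⌉)) ≥ ρ_α` for all `n ≥ 1`, `x, y ∈ B(n)`, then `FA₂(p, ·)` has no power
saving (take `α = 12/(12 - a)`: then `a α = 12a/(12-a) > 6a/(12-a) = 6(α - 1)`). -/
theorem not_powerSaving_of_polyBoxLRO {p : unitInterval}
    (h : ∀ α : ℝ, 1 < α → ∃ ρ : ℝ, 0 < ρ ∧ ∀ n : ℕ, 1 ≤ n → ∀ x ∈ box 3 n, ∀ y ∈ box 3 n,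
      ρ ≤ (bondPercolation (zdGraph 3) p).real (openConnIn ↑(box 3 ⌈(n : ℝ) ^ α⌉₊) x y)) :
    ¬ PowerSavingAt p := by
  rintro ⟨a, C, ha, hC⟩
  have ha3 : a ≤ 3 := le_of_not_gt fun h3 => not_powerSavingWith_of_three_lt p h3 ⟨C, hC⟩
  have h12 : 0 < 12 - a := by linarith
  have h12ne : (12 - a) ≠ 0 := h12.ne'
  set α : ℝ := 12 / (12 - a) with hαdef
  have hα1 : 1 < α := by
    rw [hαdef, lt_div_iff₀ h12]; linarith
  obtain ⟨ρ, hρ, hlro⟩ := h α hα1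
  have hle := exponent_mul_le_of_boxLRO_rpow hα1.le hρ hlro hC
  -- `a α = 12a/(12 - a)` and `6(α - 1) = 6a/(12 - a)`: contradiction with `a > 0`
  have h1 : a * α = 12 * a / (12 - a) := by rw [hαdef]; ring
  have h2 : 6 * (α - 1) = 6 * a / (12 - a) := by
    rw [hαdef]; field_simp; ring
  rw [h1, h2, div_le_div_iff_of_pos_right h12] at hle
  linarith

/-- **`PolyScaleLROOfTheta ∧ θ(p_c) > 0 ⟹ ¬ FreeBoxPowerSaving`**: already box LRO at EVERY
polynomial scale `⌈n^α⌉`, `α > 1` (route `PercFiniteBoxLRO`'s rank-4 crux, stmt-CriticalPhenomena-0858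
— its `α → 1⁺` tail), from a discontinuity at `p_c(ℤ³)`, refutes the crux.  (A single `α`, e.g. Cerf's
proved `α = 16`, only caps the exponent: `a ≤ 6(1 - 1/α)`, `exponent_mul_le_of_boxLRO_rpow`.) -/
theorem not_freeBoxPowerSaving_of_polyLRO_of_theta_pos (hP : PolyScaleLROOfTheta)
    (hθ : 0 < theta (zdGraph 3) (0 : Site 3) (criticalProbI 3)) : ¬ FreeBoxPowerSaving := by
  rw [freeBoxPowerSaving_iff]
  exact not_powerSaving_of_polyBoxLRO fun α hα => hP α hα (criticalProbI 3) hθ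

/-- **`PolyScaleLROOfTheta ∧ FreeBoxPowerSaving ⟹ ¬ (θ(p_c) > 0)`** (`= θ(p_c) = 0`). -/
theorem not_theta_pos_of_polyLRO (hP : PolyScaleLROOfTheta) (h : FreeBoxPowerSaving) :
    ¬ 0 < theta (zdGraph 3) (0 : Site 3) (criticalProbI 3) :=
  fun hθ => not_freeBoxPowerSaving_of_polyLRO_of_theta_pos hP hθ h

end LinearLRO

end

end Summit.CriticalPhenomena.PercolationContinuityZ3.Cruxes.FreeBoxPowerSaving.Disproof
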